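import Literature.Barriers.CriticalPhenomena.NienhuisWeightsExcludeVertexSAW
import HarnessLib

/-!
# Barrier (SAWScalingLimit): the uniform `ℤ²` SAW observable satisfies no exact boundary identity with direction-indexed coefficients

Barrier catalogue `Literature/Barriers/CriticalPhenomena/` (D-0021), sub-problem `SAWScalingLimit`;
companion of `NienhuisWeightsExcludeVertexSAW` (vertex relations: `not_hasExactVertexRelationZ2`,
`NoExactVertexRelationZ2SC_holds`) and `NoExactVertexRelationZ2Stiffness`, filling the scope caveat
(b) "boundary/strip identities" of the former for the direction-indexed shape.

## What the sources print

* Duminil-Copin–Smirnov, *The connective constant of the honeycomb lattice equals `√(2+√2)`*,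
  Ann. of Math. 175 (2012) 1653–1665, arXiv:1007.0575, §3, Lemma 2: "For critical `x = x_c`, the
  following identity holds `1 = c_α A^{x_c}_{T,L} + B^{x_c}_{T,L} + c_ε E^{x_c}_{T,L}`, with positive
  coefficients `c_α = cos(3π/8)` and `c_ε = cos(π/4)`." Proof: "Sum the relation (2) [Lemma 1:
  `(p - v)F(p) + (q - v)F(q) + (r - v)F(r) = 0`] over all vertices in `V(S_{T,L})`. Values at
  interior mid-edges disappear and we arrive at the identity
  `0 = -Σ_{z ∈ α} F(z) + Σ_{z ∈ β} F(z) + j Σ_{z ∈ ε} F(z) + j̄ Σ_{z ∈ ε̄} F(z)` (5) … the only walk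
  from `a` to `a` is a trivial one of length `0`, and so `F(a) = 1`." — i.e. on ANY finite domain the
  DCS observable summed over the boundary mid-edges, each weighted by (half) its OUTWARD edge
  vector, vanishes, the root mid-edge `a` included with `F(a) = 1`.
* Beaton–Guttmann–Jensen, *A numerical adaptation of self-avoiding walk identities from the
  honeycomb to other 2D lattices*, J. Phys. A 45 (2012) 035201, p. 2: on the square and triangular
  lattices "there is no known appropriate parafermionic observable satisfying an identity like
  (1)"; p. 5: the strip identity fails there at every finite width, but holds asymptotically with
  lattice-dependent constants (`c_α/c_β = 0.382683(2)`, "close to, and probably equal to"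
  `cos(3π/8)`), whence the estimate `x_c(ℤ²) = 0.3790522775(5)` (p. 13).
* Glazman–Manolescu 2019 (arXiv:1708.00395), p. 1: the square-lattice walk "is not believed to be
  integrable, therefore it is not reasonable to expect … the existence of a well-behaved
  equivalent observable."

## What is formalised (square lattice, the library's observable)

With `F = Literature.Probability.RandomPlanarGeometry.SAW.midEdgeParafermionicObservable Ω δ a x σ`
(`SAWParafermion.lean`; vertex-rooted walks, weight `e^{-iσW} x^{#vertices}`), a finite discrete domain
`Ω_δ` with vertex set `V` and a LEAF root `a` hanging off `w₁` in direction `i₀` (the pendant edge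
`{w₁, a}` emulates DCS's boundary mid-edge root: every walk starts along it, and `F({w₁, a}) = x`
plays the part of `F(a) = 1`):
* `boundaryFunctionalZ2 Ω δ V a w₁ i₀ x σ d = d_{i₀} F({w₁,a}) + Σ_{z ∈ V∖{a}} Σ_{i : z+dirᵢ ∉ V} d_i F({z, z+dirᵢ})`
  — the square-lattice transcription of the left side of (5) with one free coefficient `d_i ∈ ℂ`
  per OUTWARD lattice direction `dirZ2 i ∈ {e₀, e₁, -e₀, -e₁}` (DCS: `d` = the outward unit
  vectors);
* the technique class `ExactBoundaryRelationZ2 x σ d`: the functional vanishes on EVERY finite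
  discrete domain with a leaf root; the barrier statement `NoExactBoundaryRelationZ2`: for `x ≠ 0`
  this forces `d = 0`;
* PROVED: `exactBoundaryRelationZ2_eq_zero` / `NoExactBoundaryRelationZ2_holds`, and the remark
  `exactBoundaryRelationZ2_zero_fugacity` (at `x = 0` every `d` qualifies, so `x ≠ 0` is needed).

## Proof

Twelve instances of the class: the single vertex `V`, the `2 × 2` block `Q` and the `3 × 2` block
`R`, each with a pendant root edge, in their four orientations (`NoBoundaryRelation.EV0 … ER3`). On
each, the boundary functional is evaluated EXACTLY: the generic lemma
`NoBoundaryRelation.boundaryFunctional_eq` turns it into the kernel-computable list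
`NoBoundaryRelation.rowTerms` (depth-first enumeration `NoVertexRelation.dfs` of the simple paths
from the root, proved complete by `GoodEdgeList.support_mem_dfs` and sound by an explicit chain
walk, times the boundary half-edges, with the winding read off as signed quarter turns by
`NoVertexRelation.winding_support_medial`), evaluated by `decide` (`rowV0 … rowR3`). The resulting
twelve linear forms in `d` (coefficients in `ℤ[x, t, t⁻¹]`, `t = e^{-iσπ/2}`) have only the common
zero `d = 0` for all complex `x ≠ 0`, `t ≠ 0` (`NoBoundaryRelation.core`): the four orientations
of a table split the system along the characters `ω ∈ {1, -1, ±i}` of the rotation group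
(`D₁ = Σ dₖ`, `D₋₁ = Σ (-1)ᵏ dₖ`, `A ± iB`, `A = d₀ - d₂`, `B = d₁ - d₃`); the vertex `V` contributes
`(1 + x c_ω(t)) D_ω = 0` with `c_ω` Laurent in `t`, linear in `x`; eliminating `x` from the `Q`- and
`R`-rows leaves, per character, two polynomials in `t` alone which are coprime — all by explicit
Bézout certificates checked with `linear_combination` (`xelimQ1 … bezouti`). Mechanism, informally:
already the domino and the `2 × 2` block kill everything except `(x, t⁴) = (-1, 1)` and
`t²⁰ = 1, x = ((3 ± √5)/2)`-type points on two characters; the `3 × 2` block removes those.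

Conventions: `NoVertexRelation.tOf σ = e^{-iσπ/2}` is the weight of a LEFT quarter turn… precisely,
the phase of `m` signed quarter turns is `tpow (tOf σ) m` (`cexp_quarter_int`); integer coordinates
`NoVertexRelation.ZZ`, plane sets `NoVertexRelation.Omega E` (unions of closed unit segments) with
`meshDomain (Omega E) 1 = verts E` and edges `E` (`GoodEdgeList`), all from
`NienhuisWeightsExcludeVertexSAW.lean`.
-/

noncomputable section

open Real

namespace Literature.Barriers.CriticalPhenomena

open Literature.Probability.RandomPlanarGeometry.SAW Literature.Probability.LatticeModels
  Literature.Probability.Percolation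

/-! ### The technique class: direction-indexed boundary identities -/

/-- **The boundary functional** of a finite discrete domain `Ω_δ` with vertex set `V`, rooted at a
LEAF `a` hanging off `w₁` in direction `i₀` (`w₁ + dir i₀ = a`; the pendant edge emulates
Duminil-Copin–Smirnov's boundary mid-edge root, `F(a) = 1`): with
`F = midEdgeParafermionicObservable Ω δ a x σ`,
`B(d) = d_{i₀} F({w₁, a}) + Σ_{z ∈ V ∖ {a}} Σ_{i : z + dir i ∉ V} d_i F({z, z + dir i})` — the sum of
the observable over the boundary half-edges (towards lattice points outside the domain), each
weighted by the coefficient `d_i` of its OUTWARD direction, root term included. This is the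
square-lattice shape of the identity obtained on the hexagonal lattice by summing DCS's Lemma 1
over all vertices of a domain (interior mid-edges cancel; a boundary mid-edge `z` keeps the
coefficient `z - v(z)`, half its outward edge vector), the finite-domain identity behind the strip
identity `1 = c_α A_T + B_T + c_ε E_T` of DCS's Lemma 2.
[cite: DuminilCopinSmirnov2012, Lemma 1 and §3, proof of Lemma 2 (shape of the relation)] -/
def boundaryFunctionalZ2 (Ω : Set ℂ) (δ : ℝ) (V : Finset (Site 2)) (a w₁ : Site 2) (i₀ : Fin 4)
    (x σ : ℝ) (d : Fin 4 → ℂ) : ℂ :=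
  d i₀ * midEdgeParafermionicObservable Ω δ a x σ s(w₁, a) +
    ∑ z ∈ V.erase a, ∑ i : Fin 4,
      if z + dirZ2 i ∈ V then 0 else d i * midEdgeParafermionicObservable Ω δ a x σ s(z, z + dirZ2 i)

/-- **Technique class (explicit).** `ExactBoundaryRelationZ2 x σ d`: the direction-indexed
coefficients `d : Fin 4 → ℂ` (one per OUTWARD lattice direction `e₀, e₁, -e₀, -e₁`) give an EXACT
BOUNDARY IDENTITY, at fugacity `x` and spin `σ`, for the uniform square-lattice SAW's mid-edge
parafermionic observable: for every discrete domain `Ω_δ ⊆ δℤ²` with finite vertex set `V` and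
every leaf root `a` (unique neighbour `w₁`, `w₁ + dir i₀ = a`), the boundary functional
`boundaryFunctionalZ2 Ω δ V a w₁ i₀ x σ d` vanishes. On the hexagonal lattice the analogous
functional (coefficients = outward unit vectors) vanishes identically at `x = 1/√(2+√2)`,
`σ = 5/8` (sum of DCS's Lemma 1 over the domain); this class asks for ANY such identity on `ℤ²`.
[cite: DuminilCopinSmirnov2012, Lemma 1 and §3 (shape of the relation)] -/
def ExactBoundaryRelationZ2 (x σ : ℝ) (d : Fin 4 → ℂ) : Prop :=
  ∀ (Ω : Set ℂ) (δ : ℝ) (V : Finset (Site 2)) (a w₁ : Site 2) (i₀ : Fin 4), 0 < δ →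
    (∀ z, z ∈ V ↔ z ∈ meshDomain Ω δ) →
    (discreteDomainGraph Ω δ).Adj w₁ a → w₁ + dirZ2 i₀ = a →
    (∀ w, (discreteDomainGraph Ω δ).Adj a w → w = w₁) →
      boundaryFunctionalZ2 Ω δ V a w₁ i₀ x σ d = 0

namespace NoBoundaryRelation

open NoVertexRelation Complex

variable {E : List (ZZ × ZZ)}

/-! ### Integer-coordinate bookkeeping -/

/-- The four lattice directions in integer coordinates (`dirZ2` order `e₀, e₁, -e₀, -e₁`). [folklore] -/
def dirZZ : Fin 4 → ZZ := ![(1, 0), (0, 1), (-1, 0), (0, -1)]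

/-- `dirZ2` in integer coordinates. [folklore] -/
private theorem toSite_add_dirZ2 (p : ZZ) (i : Fin 4) : toSite p + dirZ2 i = toSite (p + dirZZ i) := by
  fin_cases i <;> (funext j; fin_cases j <;> simp [toSite, dirZ2, dirZZ])

/-- The vertex set of `Ω_E` as a `Finset` of sites. [folklore] -/
def vertsFinset (E : List (ZZ × ZZ)) : Finset (Site 2) := ((verts E).map toSite).toFinset

/-- Membership in `vertsFinset`, integer coordinates. [folklore] -/
private theorem toSite_mem_vertsFinset_iff (p : ZZ) : toSite p ∈ vertsFinset E ↔ p ∈ verts E := by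
  simp only [vertsFinset, List.mem_toFinset, List.mem_map]
  constructor
  · rintro ⟨q, hq, h⟩; rwa [← toSite_injective h]
  · exact fun h => ⟨p, h, rfl⟩

/-- Membership in `vertsFinset`. [folklore] -/
private theorem mem_vertsFinset_iff' (z : Site 2) : z ∈ vertsFinset E ↔ ofSite z ∈ verts E := by
  rw [← toSite_mem_vertsFinset_iff, toSite_ofSite]

/-- For a good edge list, `vertsFinset E` is the vertex set of the discrete domain `meshDomain (Ω_E) 1`. [folklore] -/
private theorem mem_vertsFinset_iff (hG : GoodEdgeList E) (z : Site 2) :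
    z ∈ vertsFinset E ↔ z ∈ meshDomain (Omega E) 1 := by
  rw [mem_vertsFinset_iff', hG.mem_meshDomain_iff]

/-- A vertex whose neighbour list is a singleton is a leaf of `Ω_E`. [folklore] -/
private theorem leaf_of_nbrs (hG : GoodEdgeList E) {r w₁ : ZZ} (h : nbrs E r = [w₁]) :
    ∀ w, (discreteDomainGraph (Omega E) 1).Adj (toSite r) w → w = toSite w₁ := by
  intro w hw
  have h1 : EAdj E r (ofSite w) := by simpa using (hG.adj_iff (toSite r) w).1 hw
  have h2 : ofSite w ∈ nbrs E r := mem_nbrs_iff.2 h1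
  rw [h] at h2
  rw [← toSite_ofSite w, List.mem_singleton.1 h2]

/-! ### Enumeration data (kernel-computable) -/

/-- The reversed vertex lists of the simple paths of `Ω_E` from `r` to `z` (depth-first). [folklore] -/
def pathsTo (E : List (ZZ × ZZ)) (fuel : ℕ) (r z : ZZ) : List (List ZZ) :=
  (dfs E fuel [r]).filter fun l => l.head? = some z

/-- Boolean chain check: consecutive vertices are joined in the edge list. [folklore] -/
def chainB (E : List (ZZ × ZZ)) : ZZ → List ZZ → Bool
  | _, [] => true
  | v, w :: rest => decide (EAdj E v w) && chainB E w rest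

/-- Last vertex of a chain starting at `v`. [folklore] -/
def lastOf : ZZ → List ZZ → ZZ
  | v, [] => v
  | _, w :: rest => lastOf w rest

/-- Kernel-checkable certificate that a reversed vertex list is a simple path from `r` to `z`. [folklore] -/
def pathOK (E : List (ZZ × ZZ)) (r z : ZZ) (l : List ZZ) : Bool :=
  match l.reverse with
  | [] => false
  | v :: rest => decide (v = r) && chainB E v rest && decide (lastOf v rest = z) && decide ((v :: rest).Nodup)

/-- The boundary half-edges of `Ω_E` away from the root `r`: pairs `(p, i)` with `p ≠ r` a vertex
and `p + dir i` NOT a vertex. [folklore] -/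
def bdry (E : List (ZZ × ZZ)) (r : ZZ) : List (ZZ × Fin 4) :=
  ((verts E).dedup.filter fun p => p ≠ r).flatMap fun p =>
    ((List.finRange 4).filter fun i => p + dirZZ i ∉ verts E).map fun i => (p, i)

/-- The monomials `(i, n, m)` (`d_i x^n t^m`) of the boundary functional of `Ω_E` rooted at `r`
(root term excluded): one per (boundary half-edge `(p, i)`, simple path `r → p`), `n` = number
of vertices of the path, `m` = its signed quarter turns continued into the half-edge. [folklore] -/
def rowTerms (E : List (ZZ × ZZ)) (fuel : ℕ) (r : ZZ) : List (Fin 4 × ℕ × ℤ) :=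
  (bdry E r).flatMap fun pi =>
    (pathsTo E fuel r pi.1).map fun l => (pi.2, l.length, quarterTurns (l.reverse ++ [pi.1 + dirZZ pi.2]))

/-- All side conditions of the evaluation, as one Boolean (checked by `decide` per instance). [folklore] -/
def rowOK (E : List (ZZ × ZZ)) (fuel : ℕ) (r : ZZ) : Bool :=
  (bdry E r).all fun pi =>
    ((pathsTo E fuel r pi.1).all fun l =>
        pathOK E r pi.1 l && goodSteps (l.reverse ++ [pi.1 + dirZZ pi.2])) &&
      decide ((pathsTo E fuel r pi.1).Nodup)

/-- Integer power of the twist as it comes out of the winding count: `t^m` for `m ≥ 0`,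
`(t⁻¹)^{-m}` for `m < 0`. [folklore] -/
def tpow (t : ℂ) (m : ℤ) : ℂ := if 0 ≤ m then t ^ m.toNat else t⁻¹ ^ (-m).toNat

/-- The phase of an integer number of quarter turns. [folklore] -/
private theorem cexp_quarter_int (σ : ℝ) (m : ℤ) :
    Complex.exp (-Complex.I * σ * (((m : ℤ) : ℝ) * (Real.pi / 2) : ℝ)) = tpow (tOf σ) m := by
  unfold tpow
  split_ifs with h
  · obtain ⟨k, rfl⟩ := Int.eq_ofNat_of_zero_le h
    rw [cexp_quarter_nat]; simp
  · obtain ⟨k, hk⟩ := Int.exists_eq_neg_ofNat (le_of_lt (not_le.1 h))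
    subst hk
    rw [cexp_quarter_neg_nat]; simp

/-! ### Walks from chains (soundness of the enumeration) -/

/-- The walk of `Ω_E` along a certified chain. [folklore] -/
def mkWalk (hG : GoodEdgeList E) : (v : ZZ) → (l : List ZZ) → chainB E v l = true →
    (discreteDomainGraph (Omega E) 1).Walk (toSite v) (toSite (lastOf v l))
  | _, [], _ => SimpleGraph.Walk.nil
  | v, w :: rest, h =>
    SimpleGraph.Walk.cons (hG.A v w (by simp [chainB] at h; exact h.1))
      (mkWalk hG w rest (by simp [chainB] at h; exact h.2))

/-- Support of the chain walk. [folklore] -/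
private theorem support_mkWalk (hG : GoodEdgeList E) : ∀ (v : ZZ) (l : List ZZ) (h : chainB E v l = true),
    (mkWalk hG v l h).support = (v :: l).map toSite
  | _, [], _ => rfl
  | v, w :: rest, h => by
    simp only [mkWalk, SimpleGraph.Walk.support_cons, List.map_cons, List.cons.injEq, true_and]
    exact support_mkWalk hG w rest _

/-- A certified reversed vertex list is the support of a self-avoiding walk `r → z`. [folklore] -/
private theorem exists_saw_of_pathOK (hG : GoodEdgeList E) {r z : ZZ} {l : List ZZ} (h : pathOK E r z l = true) :
    ∃ γ : DomainSAW (Omega E) 1 (toSite r) (toSite z), (γ.walk.support.map ofSite).reverse = l := by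
  unfold pathOK at h
  split at h
  · simp at h
  · rename_i v rest hrev
    simp only [Bool.and_eq_true, decide_eq_true_eq] at h
    obtain ⟨⟨⟨rfl, hch⟩, hlast⟩, hnd⟩ := h
    subst hlast
    refine ⟨⟨mkWalk hG v rest hch, ?_⟩, ?_⟩
    · rw [SimpleGraph.Walk.isPath_def, support_mkWalk]
      exact hnd.map toSite_injective
    · change ((mkWalk hG v rest hch).support.map ofSite).reverse = l
      rw [support_mkWalk, List.map_map]
      have : (ofSite ∘ toSite) = id := funext ofSite_toSite
      rw [this, List.map_id, ← hrev, List.reverse_reverse]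

/-! ### Evaluating half-edge terms by the enumeration -/

/-- No walk of `Ω_E` from a vertex reaches a non-vertex. [folklore] -/
private theorem isEmpty_saw_of_not_mem (hG : GoodEdgeList E) {r w : ZZ} (hr : r ∈ verts E) (hw : w ∉ verts E) :
    IsEmpty (DomainSAW (Omega E) 1 (toSite r) (toSite w)) := by
  refine ⟨fun γ => hw ?_⟩
  have hadj : ∀ s t, (discreteDomainGraph (Omega E) 1).Adj s t → EAdj E (ofSite s) (ofSite t) :=
    fun s t h => (hG.adj_iff s t).1 h
  have := support_subset_verts _ hadj γ.walk (by simpa using hr) (toSite w) γ.walk.end_mem_support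
  simpa using this

/-- The half-edge term INTO the domain from a non-vertex vanishes (no walk ends outside). [folklore] -/
private theorem halfEdgeTerm_out (hG : GoodEdgeList E) {r w : ZZ} (hr : r ∈ verts E) (hw : w ∉ verts E)
    (x σ : ℝ) (z : ZZ) :
    halfEdgeTerm (Omega E) 1 (toSite r) x σ (toSite w) (toSite z) = 0 := by
  haveI := isEmpty_saw_of_not_mem hG hr hw
  unfold halfEdgeTerm
  exact tsum_empty

/-- The root's own half-edge term: only the trivial walk, `F = x`. [folklore] -/
private theorem halfEdgeTerm_self (Ω : Set ℂ) (δ : ℝ) (a w : Site 2) (x σ : ℝ) :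
    halfEdgeTerm Ω δ a x σ a w = x := by
  unfold halfEdgeTerm
  rw [tsum_fintype, Fintype.sum_unique, DomainSAW.eq_nil_of_self default]
  simp [DomainSAW.nil, DomainSAW.length]

/-- Towards a leaf root every walk uses the pendant edge: the inward half-edge term at the root edge vanishes. [folklore] -/
private theorem halfEdgeTerm_leaf {Ω : Set ℂ} {δ : ℝ} {a w₁ : Site 2}
    (hadj : (discreteDomainGraph Ω δ).Adj w₁ a)
    (hleaf : ∀ w, (discreteDomainGraph Ω δ).Adj a w → w = w₁) (x σ : ℝ) :
    halfEdgeTerm Ω δ a x σ w₁ a = 0 := by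
  refine halfEdgeTerm_eq_zero x σ a fun γ => ?_
  obtain ⟨p, hp⟩ := γ
  cases p with
  | nil => exact absurd rfl hadj.ne
  | cons h q =>
    rename_i w
    have hw : w = w₁ := hleaf w h
    subst hw
    simp [SimpleGraph.Walk.edges_cons, Sym2.eq_swap]

/-- Summation over a `flatMap`. [folklore] -/
private theorem sum_flatMap {α β : Type*} (L : List α) (f : α → List β) (g : β → ℂ) :
    ((L.flatMap f).map g).sum = (L.map fun a => ((f a).map g).sum).sum := by
  induction L with
  | nil => simp
  | cons a L ih => simp [List.flatMap_cons, ih]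

/-- **Evaluation of a boundary half-edge term by the path enumeration.** For a vertex `z` of `Ω_E`
and a non-vertex lattice neighbour `w`, the half-edge term `z → w` of the observable rooted at the
vertex `r` is the sum, over the certified complete duplicate-free list of simple paths `r → z`, of
`x^{#vertices} t^{quarter turns}`, `t = e^{-iσπ/2}`. [folklore] -/
private theorem halfEdgeTerm_eq_pathSum (hG : GoodEdgeList E) {r z w : ZZ} (hr : r ∈ verts E)
    (hw : w ∉ verts E) {fuel : ℕ} (hfuel : (verts E).length ≤ fuel)
    (hok : ∀ l ∈ pathsTo E fuel r z, pathOK E r z l = true ∧ goodSteps (l.reverse ++ [w]) = true)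
    (hnd : (pathsTo E fuel r z).Nodup) (x σ : ℝ) :
    halfEdgeTerm (Omega E) 1 (toSite r) x σ (toSite z) (toSite w) =
      ((pathsTo E fuel r z).map fun l => (x : ℂ) ^ l.length * tpow (tOf σ) (quarterTurns (l.reverse ++ [w]))).sum := by
  classical
  set P := pathsTo E fuel r z with hP
  let S := DomainSAW (Omega E) 1 (toSite r) (toSite z)
  let φ : S → List ZZ := fun γ => (γ.walk.support.map ofSite).reverse
  have hφmem : ∀ γ : S, φ γ ∈ P := by
    intro γ
    simp only [hP, pathsTo, List.mem_filter, decide_eq_true_eq]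
    refine ⟨by simpa using hG.support_mem_dfs γ (by simpa using hr) hfuel, ?_⟩
    show ((γ.walk.support.map ofSite).reverse).head? = some z
    rw [head?_reverse_map_support, ofSite_toSite]
  have hφinj : Function.Injective φ := by
    intro γ γ' h
    apply DomainSAW_eq_of_support
    have h' := congrArg List.reverse h
    simp only [φ, List.reverse_reverse] at h'
    exact List.map_injective_iff.2 ofSite_injective h'
  haveI : Finite S := Finite.of_injective (fun γ => (⟨φ γ, hφmem γ⟩ : {l // l ∈ P})) fun γ γ' h =>
    hφinj (congrArg Subtype.val h)
  haveI : Fintype S := Fintype.ofFinite S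
  let g : List ZZ → ℂ := fun l => (x : ℂ) ^ l.length * tpow (tOf σ) (quarterTurns (l.reverse ++ [w]))
  have hterm : ∀ γ : S,
      (if s(toSite z, toSite w) ∈ γ.walk.edges then 0 else
        Complex.exp (-Complex.I * σ *
          (winding (γ.walk.support.map (meshPoint 1) ++ [medialPoint 1 s(toSite z, toSite w)]) : ℝ)) *
          (x : ℂ) ^ (γ.length + 1)) = g (φ γ) := by
    intro γ
    have hnot : s(toSite z, toSite w) ∉ γ.walk.edges := by
      intro he
      have hws : toSite w ∈ γ.walk.support := SimpleGraph.Walk.snd_mem_support_of_mem_edges _ he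
      have hadj : ∀ s t, (discreteDomainGraph (Omega E) 1).Adj s t → EAdj E (ofSite s) (ofSite t) :=
        fun s t h => (hG.adj_iff s t).1 h
      have := support_subset_verts _ hadj γ.walk (by simpa using hr) _ hws
      exact hw (by simpa using this)
    rw [if_neg hnot]
    have hgood : goodSteps (γ.walk.support.map ofSite ++ [ofSite (toSite w)]) = true := by
      have := (hok (φ γ) (hφmem γ)).2
      simpa [φ] using this
    rw [winding_support_medial γ.walk (toSite w) hgood, cexp_quarter_int]
    have hlen : (φ γ).length = γ.length + 1 := by
      simp [φ, DomainSAW.length, SimpleGraph.Walk.length_support]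
    have hrev : (φ γ).reverse ++ [w] = γ.walk.support.map ofSite ++ [ofSite (toSite w)] := by
      simp [φ]
    simp only [g, hlen, hrev]
    ring
  unfold halfEdgeTerm
  rw [tsum_fintype]
  rw [show ∑ γ : S, _ = ∑ γ : S, g (φ γ) from Finset.sum_congr rfl fun γ _ => hterm γ]
  rw [← List.sum_toFinset g hnd]
  refine Finset.sum_bij (fun γ _ => φ γ) (fun γ _ => List.mem_toFinset.2 (hφmem γ))
    (fun γ _ γ' _ h => hφinj h) (fun l hl => ?_) (fun γ _ => rfl)
  obtain ⟨γ, hγ⟩ := exists_saw_of_pathOK hG (hok l (List.mem_toFinset.1 hl)).1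
  exact ⟨γ, Finset.mem_univ _, hγ⟩

/-! ### Evaluating the boundary functional on `Ω_E` -/

/-- The boundary double sum of `boundaryFunctionalZ2` on `Ω_E`, as a list sum over `bdry E r`. [folklore] -/
private theorem sum_boundary (r : ZZ) (G : Site 2 → Fin 4 → ℂ) :
    (∑ z ∈ (vertsFinset E).erase (toSite r), ∑ i : Fin 4,
        if z + dirZ2 i ∈ vertsFinset E then 0 else G z i) =
      ((bdry E r).map fun pi => G (toSite pi.1) pi.2).sum := by
  classical
  have hset : (vertsFinset E).erase (toSite r) =
      (((verts E).dedup.filter fun p => p ≠ r).map toSite).toFinset := by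
    ext z
    simp only [Finset.mem_erase, mem_vertsFinset_iff', List.mem_toFinset, List.mem_map,
      List.mem_filter, List.mem_dedup, decide_eq_true_eq]
    constructor
    · rintro ⟨hne, hmem⟩
      exact ⟨ofSite z, ⟨hmem, fun h => hne (by rw [← toSite_ofSite z, h])⟩, toSite_ofSite z⟩
    · rintro ⟨p, ⟨hp, hne⟩, rfl⟩
      exact ⟨fun h => hne (toSite_injective h), by simpa using hp⟩
  have hnd : (((verts E).dedup.filter fun p => p ≠ r).map toSite).Nodup :=
    (((verts E).nodup_dedup).filter _).map toSite_injective
  rw [hset, List.sum_toFinset _ hnd, bdry, sum_flatMap, List.map_map]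
  congr 1
  refine List.map_congr_left fun p _ => ?_
  simp only [Function.comp_apply]
  have h4 : ∀ (h : Fin 4 → ℂ), ∑ i : Fin 4, h i = ((List.finRange 4).map h).sum := by
    intro h; simp [Fin.sum_univ_four, List.finRange_succ, List.sum_cons, add_assoc]
  rw [h4]
  generalize List.finRange 4 = L
  induction L with
  | nil => simp
  | cons i L ih =>
    by_cases hi : p + dirZZ i ∈ verts E
    · have : toSite p + dirZ2 i ∈ vertsFinset E := by
        rw [toSite_add_dirZ2, toSite_mem_vertsFinset_iff]; exact hi
      simp [hi, this, ih]
    · have : toSite p + dirZ2 i ∉ vertsFinset E := by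
        rw [toSite_add_dirZ2, toSite_mem_vertsFinset_iff]; exact hi
      simp [hi, this, ih]

/-- Members of `bdry E r` point out of the domain, from a vertex. [folklore] -/
private theorem mem_bdry {r : ZZ} {pi : ZZ × Fin 4} (h : pi ∈ bdry E r) :
    pi.1 ∈ verts E ∧ pi.1 + dirZZ pi.2 ∉ verts E := by
  simp only [bdry, List.mem_flatMap, List.mem_filter, List.mem_map, List.mem_dedup,
    decide_eq_true_eq, List.mem_finRange, true_and] at h
  obtain ⟨p, ⟨hp, -⟩, i, hi, rfl⟩ := h
  exact ⟨hp, hi⟩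

/-- **The boundary functional on `Ω_E` rooted at a leaf `r`**, evaluated by the enumeration:
`B(d) = d_{i₀} x + Σ_{(i,n,m) ∈ rowTerms} d_i x^n t^m`. [folklore] -/
private theorem boundaryFunctional_eq (hG : GoodEdgeList E) {r w₁ : ZZ} (i₀ : Fin 4) (hr : r ∈ verts E)
    (hnb : nbrs E r = [w₁]) {fuel : ℕ} (hfuel : (verts E).length ≤ fuel)
    (hok : rowOK E fuel r = true) (x σ : ℝ) (d : Fin 4 → ℂ) :
    boundaryFunctionalZ2 (Omega E) 1 (vertsFinset E) (toSite r) (toSite w₁) i₀ x σ d =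
      d i₀ * x + ((rowTerms E fuel r).map fun inm =>
        d inm.1 * ((x : ℂ) ^ inm.2.1 * tpow (tOf σ) inm.2.2)).sum := by
  have hadj : (discreteDomainGraph (Omega E) 1).Adj (toSite w₁) (toSite r) :=
    hG.A w₁ r (mem_nbrs_iff.1 (by rw [hnb]; simp)).symm
  have hleaf := leaf_of_nbrs hG hnb
  unfold boundaryFunctionalZ2
  rw [midEdgeParafermionicObservable_mk, halfEdgeTerm_leaf hadj hleaf, halfEdgeTerm_self, zero_add,
    sum_boundary, rowTerms, sum_flatMap]
  congr 1
  refine congrArg List.sum (List.map_congr_left fun pi hpi => ?_)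
  obtain ⟨-, hout⟩ := mem_bdry hpi
  simp only [rowOK, List.all_eq_true, Bool.and_eq_true, decide_eq_true_eq] at hok
  obtain ⟨hok1, hnd⟩ := hok pi hpi
  rw [toSite_add_dirZ2, midEdgeParafermionicObservable_mk, halfEdgeTerm_out hG hr hout, add_zero,
    halfEdgeTerm_eq_pathSum hG hr hout hfuel (fun l hl => hok1 l hl) hnd, List.map_map,
    ← List.sum_map_mul_left]
  rfl

/-- **Instantiating an exact boundary relation on `Ω_E`.** [folklore] -/
private theorem inst (hG : GoodEdgeList E) {r w₁ : ZZ} {i₀ : Fin 4} (hr : r ∈ verts E)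
    (hnb : nbrs E r = [w₁]) (hdir : w₁ + dirZZ i₀ = r) {fuel : ℕ} (hfuel : (verts E).length ≤ fuel)
    (hok : rowOK E fuel r = true) {x σ : ℝ} {d : Fin 4 → ℂ} (h : ExactBoundaryRelationZ2 x σ d) :
    d i₀ * x + ((rowTerms E fuel r).map fun inm =>
        d inm.1 * ((x : ℂ) ^ inm.2.1 * tpow (tOf σ) inm.2.2)).sum = 0 := by
  rw [← boundaryFunctional_eq hG i₀ hr hnb hfuel hok x σ d]
  have hadj : (discreteDomainGraph (Omega E) 1).Adj (toSite w₁) (toSite r) :=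
    hG.A w₁ r (mem_nbrs_iff.1 (by rw [hnb]; simp)).symm
  exact h (Omega E) 1 (vertsFinset E) (toSite r) (toSite w₁) i₀ one_pos (mem_vertsFinset_iff hG)
    hadj (by rw [toSite_add_dirZ2, hdir]) (leaf_of_nbrs hG hnb)

/-! ### The twelve instances: `V` (single vertex), `Q` (`2 × 2` block), `R` (`3 × 2` block), each rooted at a
pendant leaf, in its four orientations `ρʲ` (`ρ` = rotation by `π/2`) -/

/-- `tpow` at a non-negative exponent. [folklore] -/
@[simp] private theorem tpow_ofNat (t : ℂ) (k : ℕ) : tpow t (Int.ofNat k) = t ^ k := by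
  simp [tpow]

/-- `tpow` at a negative exponent. [folklore] -/
@[simp] private theorem tpow_negSucc (t : ℂ) (k : ℕ) : tpow t (Int.negSucc k) = t⁻¹ ^ (k + 1) := by
  simp only [tpow, Int.negSucc_not_nonneg, if_false, Int.neg_negSucc]
  rfl

/-- Edge list of instance `V0`: the single vertex `ρʲ(0,0)` with pendant root `ρʲ(1,0)` (`j = 0`). [folklore] -/
def EV0 : List (ZZ × ZZ) :=
  [((0, 0), (1, 0))]

/-- Kernel certificate: unit darts, connected. [folklore] -/
private theorem goodV0 : GoodEdgeList EV0 := ⟨by decide, ⟨(1, 0), by decide, 2, by decide⟩⟩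

/-- The boundary monomials of instance `V0` (kernel evaluation of `rowTerms`). [folklore] -/
private theorem rowV0 : rowTerms EV0 2 (1, 0) =
  [(1, 2, Int.negSucc 0), (2, 2, Int.ofNat 0), (3, 2, Int.ofNat 1)] := by
  decide

/-- The exact boundary relation instantiated on `V0` (rotation `j = 0` of the base table; the row is the base row with slots shifted by `j`). [folklore] -/
private theorem instV0 {x σ : ℝ} {d : Fin 4 → ℂ} (h : ExactBoundaryRelationZ2 x σ d) :
    d 0 * ((x : ℂ)) + d 1 * ((x : ℂ) ^ (2 : ℕ) * (tOf σ)⁻¹) + d 2 * ((x : ℂ) ^ (2 : ℕ)) + d 3 * ((x : ℂ) ^ (2 : ℕ) * tOf σ) = 0 := by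
  have h0 := inst goodV0 (r := (1, 0)) (w₁ := (0, 0)) (i₀ := 0) (by decide) (by decide) (by decide)
    (fuel := 2) (by decide) (by decide) h
  rw [rowV0] at h0
  simp only [List.map_cons, List.map_nil, List.sum_cons, List.sum_nil, add_zero, tpow_ofNat, tpow_negSucc, zero_add, pow_zero, mul_one] at h0
  linear_combination h0

/-- Edge list of instance `V1`: the single vertex `ρʲ(0,0)` with pendant root `ρʲ(1,0)` (`j = 1`). [folklore] -/
def EV1 : List (ZZ × ZZ) :=
  [((0, 0), (0, 1))]

/-- Kernel certificate: unit darts, connected. [folklore] -/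
private theorem goodV1 : GoodEdgeList EV1 := ⟨by decide, ⟨(0, 1), by decide, 2, by decide⟩⟩

/-- The boundary monomials of instance `V1` (kernel evaluation of `rowTerms`). [folklore] -/
private theorem rowV1 : rowTerms EV1 2 (0, 1) =
  [(0, 2, Int.ofNat 1), (2, 2, Int.negSucc 0), (3, 2, Int.ofNat 0)] := by
  decide

/-- The exact boundary relation instantiated on `V1` (rotation `j = 1` of the base table; the row is the base row with slots shifted by `j`). [folklore] -/
private theorem instV1 {x σ : ℝ} {d : Fin 4 → ℂ} (h : ExactBoundaryRelationZ2 x σ d) :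
    d 0 * ((x : ℂ) ^ (2 : ℕ) * tOf σ) + d 1 * ((x : ℂ)) + d 2 * ((x : ℂ) ^ (2 : ℕ) * (tOf σ)⁻¹) + d 3 * ((x : ℂ) ^ (2 : ℕ)) = 0 := by
  have h0 := inst goodV1 (r := (0, 1)) (w₁ := (0, 0)) (i₀ := 1) (by decide) (by decide) (by decide)
    (fuel := 2) (by decide) (by decide) h
  rw [rowV1] at h0
  simp only [List.map_cons, List.map_nil, List.sum_cons, List.sum_nil, add_zero, tpow_ofNat, tpow_negSucc, zero_add, pow_zero, mul_one] at h0
  linear_combination h0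

/-- Edge list of instance `V2`: the single vertex `ρʲ(0,0)` with pendant root `ρʲ(1,0)` (`j = 2`). [folklore] -/
def EV2 : List (ZZ × ZZ) :=
  [((-1, 0), (0, 0))]

/-- Kernel certificate: unit darts, connected. [folklore] -/
private theorem goodV2 : GoodEdgeList EV2 := ⟨by decide, ⟨(-1, 0), by decide, 2, by decide⟩⟩

/-- The boundary monomials of instance `V2` (kernel evaluation of `rowTerms`). [folklore] -/
private theorem rowV2 : rowTerms EV2 2 (-1, 0) =
  [(0, 2, Int.ofNat 0), (1, 2, Int.ofNat 1), (3, 2, Int.negSucc 0)] := by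
  decide

/-- The exact boundary relation instantiated on `V2` (rotation `j = 2` of the base table; the row is the base row with slots shifted by `j`). [folklore] -/
private theorem instV2 {x σ : ℝ} {d : Fin 4 → ℂ} (h : ExactBoundaryRelationZ2 x σ d) :
    d 0 * ((x : ℂ) ^ (2 : ℕ)) + d 1 * ((x : ℂ) ^ (2 : ℕ) * tOf σ) + d 2 * ((x : ℂ)) + d 3 * ((x : ℂ) ^ (2 : ℕ) * (tOf σ)⁻¹) = 0 := by
  have h0 := inst goodV2 (r := (-1, 0)) (w₁ := (0, 0)) (i₀ := 2) (by decide) (by decide) (by decide)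
    (fuel := 2) (by decide) (by decide) h
  rw [rowV2] at h0
  simp only [List.map_cons, List.map_nil, List.sum_cons, List.sum_nil, add_zero, tpow_ofNat, tpow_negSucc, zero_add, pow_zero, mul_one] at h0
  linear_combination h0

/-- Edge list of instance `V3`: the single vertex `ρʲ(0,0)` with pendant root `ρʲ(1,0)` (`j = 3`). [folklore] -/
def EV3 : List (ZZ × ZZ) :=
  [((0, -1), (0, 0))]

/-- Kernel certificate: unit darts, connected. [folklore] -/
private theorem goodV3 : GoodEdgeList EV3 := ⟨by decide, ⟨(0, -1), by decide, 2, by decide⟩⟩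

/-- The boundary monomials of instance `V3` (kernel evaluation of `rowTerms`). [folklore] -/
private theorem rowV3 : rowTerms EV3 2 (0, -1) =
  [(0, 2, Int.negSucc 0), (1, 2, Int.ofNat 0), (2, 2, Int.ofNat 1)] := by
  decide

/-- The exact boundary relation instantiated on `V3` (rotation `j = 3` of the base table; the row is the base row with slots shifted by `j`). [folklore] -/
private theorem instV3 {x σ : ℝ} {d : Fin 4 → ℂ} (h : ExactBoundaryRelationZ2 x σ d) :
    d 0 * ((x : ℂ) ^ (2 : ℕ) * (tOf σ)⁻¹) + d 1 * ((x : ℂ) ^ (2 : ℕ)) + d 2 * ((x : ℂ) ^ (2 : ℕ) * tOf σ) + d 3 * ((x : ℂ)) = 0 := by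
  have h0 := inst goodV3 (r := (0, -1)) (w₁ := (0, 0)) (i₀ := 3) (by decide) (by decide) (by decide)
    (fuel := 2) (by decide) (by decide) h
  rw [rowV3] at h0
  simp only [List.map_cons, List.map_nil, List.sum_cons, List.sum_nil, add_zero, tpow_ofNat, tpow_negSucc, zero_add, pow_zero, mul_one] at h0
  linear_combination h0

/-- Edge list of instance `Q0`: the `2 × 2` block `ρʲ({0,1}²)` with pendant root `ρʲ(-1,0)` at `ρʲ(0,0)` (`j = 0`). [folklore] -/
def EQ0 : List (ZZ × ZZ) :=
  [((0, 0), (1, 0)), ((0, 0), (0, 1)), ((0, 1), (1, 1)), ((1, 0), (1, 1)), ((-1, 0), (0, 0))]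

/-- Kernel certificate: unit darts, connected. [folklore] -/
private theorem goodQ0 : GoodEdgeList EQ0 := ⟨by decide, ⟨(-1, 0), by decide, 10, by decide⟩⟩

/-- The boundary monomials of instance `Q0` (kernel evaluation of `rowTerms`). [folklore] -/
private theorem rowQ0 : rowTerms EQ0 10 (-1, 0) =
  [(1, 5, Int.ofNat 1), (1, 3, Int.ofNat 1), (2, 5, Int.ofNat 2), (2, 3, Int.ofNat 2), (0, 3, Int.ofNat 0), (0, 5, Int.ofNat 0), (3, 3, Int.negSucc 0),
      (3, 5, Int.negSucc 0), (0, 4, Int.ofNat 0), (0, 4, Int.ofNat 0), (1, 4, Int.ofNat 1), (1, 4, Int.ofNat 1), (3, 2, Int.negSucc 0)] := by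
  decide

/-- The exact boundary relation instantiated on `Q0` (rotation `j = 0` of the base table; the row is the base row with slots shifted by `j`). [folklore] -/
private theorem instQ0 {x σ : ℝ} {d : Fin 4 → ℂ} (h : ExactBoundaryRelationZ2 x σ d) :
    d 0 * ((x : ℂ) ^ (3 : ℕ) + (2 : ℂ) * (x : ℂ) ^ (4 : ℕ) + (x : ℂ) ^ (5 : ℕ)) + d 1 * ((x : ℂ) ^ (3 : ℕ) * tOf σ +
        (2 : ℂ) * (x : ℂ) ^ (4 : ℕ) * tOf σ + (x : ℂ) ^ (5 : ℕ) * tOf σ) + d 2 * ((x : ℂ) + (x : ℂ) ^ (3 : ℕ) * tOf σ ^ (2 : ℕ) +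
        (x : ℂ) ^ (5 : ℕ) * tOf σ ^ (2 : ℕ)) + d 3 * ((x : ℂ) ^ (2 : ℕ) * (tOf σ)⁻¹ + (x : ℂ) ^ (3 : ℕ) * (tOf σ)⁻¹ +
        (x : ℂ) ^ (5 : ℕ) * (tOf σ)⁻¹) = 0 := by
  have h0 := inst goodQ0 (r := (-1, 0)) (w₁ := (0, 0)) (i₀ := 2) (by decide) (by decide) (by decide)
    (fuel := 10) (by decide) (by decide) h
  rw [rowQ0] at h0
  simp only [List.map_cons, List.map_nil, List.sum_cons, List.sum_nil, add_zero, tpow_ofNat, tpow_negSucc, zero_add, pow_zero, mul_one] at h0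
  linear_combination h0

/-- Edge list of instance `Q1`: the `2 × 2` block `ρʲ({0,1}²)` with pendant root `ρʲ(-1,0)` at `ρʲ(0,0)` (`j = 1`). [folklore] -/
def EQ1 : List (ZZ × ZZ) :=
  [((-1, 0), (0, 0)), ((-1, 0), (-1, 1)), ((-1, 1), (0, 1)), ((0, 0), (0, 1)), ((0, -1), (0, 0))]

/-- Kernel certificate: unit darts, connected. [folklore] -/
private theorem goodQ1 : GoodEdgeList EQ1 := ⟨by decide, ⟨(0, -1), by decide, 10, by decide⟩⟩

/-- The boundary monomials of instance `Q1` (kernel evaluation of `rowTerms`). [folklore] -/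
private theorem rowQ1 : rowTerms EQ1 10 (0, -1) =
  [(2, 5, Int.ofNat 1), (2, 3, Int.ofNat 1), (3, 5, Int.ofNat 2), (3, 3, Int.ofNat 2), (1, 4, Int.ofNat 0), (1, 4, Int.ofNat 0), (2, 4, Int.ofNat 1),
      (2, 4, Int.ofNat 1), (0, 3, Int.negSucc 0), (0, 5, Int.negSucc 0), (1, 3, Int.ofNat 0), (1, 5, Int.ofNat 0), (0, 2, Int.negSucc 0)] := by
  decide

/-- The exact boundary relation instantiated on `Q1` (rotation `j = 1` of the base table; the row is the base row with slots shifted by `j`). [folklore] -/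
private theorem instQ1 {x σ : ℝ} {d : Fin 4 → ℂ} (h : ExactBoundaryRelationZ2 x σ d) :
    d 0 * ((x : ℂ) ^ (2 : ℕ) * (tOf σ)⁻¹ + (x : ℂ) ^ (3 : ℕ) * (tOf σ)⁻¹ + (x : ℂ) ^ (5 : ℕ) * (tOf σ)⁻¹) + d 1 * ((x : ℂ) ^ (3 : ℕ) +
        (2 : ℂ) * (x : ℂ) ^ (4 : ℕ) + (x : ℂ) ^ (5 : ℕ)) + d 2 * ((x : ℂ) ^ (3 : ℕ) * tOf σ + (2 : ℂ) * (x : ℂ) ^ (4 : ℕ) * tOf σ +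
        (x : ℂ) ^ (5 : ℕ) * tOf σ) + d 3 * ((x : ℂ) + (x : ℂ) ^ (3 : ℕ) * tOf σ ^ (2 : ℕ) + (x : ℂ) ^ (5 : ℕ) * tOf σ ^ (2 : ℕ)) = 0 := by
  have h0 := inst goodQ1 (r := (0, -1)) (w₁ := (0, 0)) (i₀ := 3) (by decide) (by decide) (by decide)
    (fuel := 10) (by decide) (by decide) h
  rw [rowQ1] at h0
  simp only [List.map_cons, List.map_nil, List.sum_cons, List.sum_nil, add_zero, tpow_ofNat, tpow_negSucc, zero_add, pow_zero, mul_one] at h0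
  linear_combination h0

/-- Edge list of instance `Q2`: the `2 × 2` block `ρʲ({0,1}²)` with pendant root `ρʲ(-1,0)` at `ρʲ(0,0)` (`j = 2`). [folklore] -/
def EQ2 : List (ZZ × ZZ) :=
  [((-1, -1), (0, -1)), ((-1, -1), (-1, 0)), ((-1, 0), (0, 0)), ((0, -1), (0, 0)), ((0, 0), (1, 0))]

/-- Kernel certificate: unit darts, connected. [folklore] -/
private theorem goodQ2 : GoodEdgeList EQ2 := ⟨by decide, ⟨(1, 0), by decide, 10, by decide⟩⟩

/-- The boundary monomials of instance `Q2` (kernel evaluation of `rowTerms`). [folklore] -/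
private theorem rowQ2 : rowTerms EQ2 10 (1, 0) =
  [(2, 4, Int.ofNat 0), (2, 4, Int.ofNat 0), (3, 4, Int.ofNat 1), (3, 4, Int.ofNat 1), (1, 3, Int.negSucc 0), (1, 5, Int.negSucc 0), (2, 3,
      Int.ofNat 0), (2, 5, Int.ofNat 0), (0, 5, Int.ofNat 2), (0, 3, Int.ofNat 2), (3, 5, Int.ofNat 1), (3, 3, Int.ofNat 1), (1, 2,
      Int.negSucc 0)] := by
  decide

/-- The exact boundary relation instantiated on `Q2` (rotation `j = 2` of the base table; the row is the base row with slots shifted by `j`). [folklore] -/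
private theorem instQ2 {x σ : ℝ} {d : Fin 4 → ℂ} (h : ExactBoundaryRelationZ2 x σ d) :
    d 0 * ((x : ℂ) + (x : ℂ) ^ (3 : ℕ) * tOf σ ^ (2 : ℕ) + (x : ℂ) ^ (5 : ℕ) * tOf σ ^ (2 : ℕ)) + d 1 * ((x : ℂ) ^ (2 : ℕ) * (tOf σ)⁻¹ +
        (x : ℂ) ^ (3 : ℕ) * (tOf σ)⁻¹ + (x : ℂ) ^ (5 : ℕ) * (tOf σ)⁻¹) + d 2 * ((x : ℂ) ^ (3 : ℕ) + (2 : ℂ) * (x : ℂ) ^ (4 : ℕ) + (x : ℂ) ^ (5 : ℕ)) +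
        d 3 * ((x : ℂ) ^ (3 : ℕ) * tOf σ + (2 : ℂ) * (x : ℂ) ^ (4 : ℕ) * tOf σ + (x : ℂ) ^ (5 : ℕ) * tOf σ) = 0 := by
  have h0 := inst goodQ2 (r := (1, 0)) (w₁ := (0, 0)) (i₀ := 0) (by decide) (by decide) (by decide)
    (fuel := 10) (by decide) (by decide) h
  rw [rowQ2] at h0
  simp only [List.map_cons, List.map_nil, List.sum_cons, List.sum_nil, add_zero, tpow_ofNat, tpow_negSucc, zero_add, pow_zero, mul_one] at h0
  linear_combination h0

/-- Edge list of instance `Q3`: the `2 × 2` block `ρʲ({0,1}²)` with pendant root `ρʲ(-1,0)` at `ρʲ(0,0)` (`j = 3`). [folklore] -/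
def EQ3 : List (ZZ × ZZ) :=
  [((0, -1), (1, -1)), ((0, -1), (0, 0)), ((0, 0), (1, 0)), ((1, -1), (1, 0)), ((0, 0), (0, 1))]

/-- Kernel certificate: unit darts, connected. [folklore] -/
private theorem goodQ3 : GoodEdgeList EQ3 := ⟨by decide, ⟨(0, 1), by decide, 10, by decide⟩⟩

/-- The boundary monomials of instance `Q3` (kernel evaluation of `rowTerms`). [folklore] -/
private theorem rowQ3 : rowTerms EQ3 10 (0, 1) =
  [(2, 5, Int.negSucc 0), (2, 3, Int.negSucc 0), (3, 5, Int.ofNat 0), (3, 3, Int.ofNat 0), (0, 4, Int.ofNat 1), (0, 4, Int.ofNat 1), (3, 4,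
      Int.ofNat 0), (3, 4, Int.ofNat 0), (0, 3, Int.ofNat 1), (0, 5, Int.ofNat 1), (1, 3, Int.ofNat 2), (1, 5, Int.ofNat 2), (2, 2,
      Int.negSucc 0)] := by
  decide

/-- The exact boundary relation instantiated on `Q3` (rotation `j = 3` of the base table; the row is the base row with slots shifted by `j`). [folklore] -/
private theorem instQ3 {x σ : ℝ} {d : Fin 4 → ℂ} (h : ExactBoundaryRelationZ2 x σ d) :
    d 0 * ((x : ℂ) ^ (3 : ℕ) * tOf σ + (2 : ℂ) * (x : ℂ) ^ (4 : ℕ) * tOf σ + (x : ℂ) ^ (5 : ℕ) * tOf σ) + d 1 * ((x : ℂ) +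
        (x : ℂ) ^ (3 : ℕ) * tOf σ ^ (2 : ℕ) + (x : ℂ) ^ (5 : ℕ) * tOf σ ^ (2 : ℕ)) + d 2 * ((x : ℂ) ^ (2 : ℕ) * (tOf σ)⁻¹ +
        (x : ℂ) ^ (3 : ℕ) * (tOf σ)⁻¹ + (x : ℂ) ^ (5 : ℕ) * (tOf σ)⁻¹) + d 3 * ((x : ℂ) ^ (3 : ℕ) + (2 : ℂ) * (x : ℂ) ^ (4 : ℕ) +
        (x : ℂ) ^ (5 : ℕ)) = 0 := by
  have h0 := inst goodQ3 (r := (0, 1)) (w₁ := (0, 0)) (i₀ := 1) (by decide) (by decide) (by decide)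
    (fuel := 10) (by decide) (by decide) h
  rw [rowQ3] at h0
  simp only [List.map_cons, List.map_nil, List.sum_cons, List.sum_nil, add_zero, tpow_ofNat, tpow_negSucc, zero_add, pow_zero, mul_one] at h0
  linear_combination h0

/-- Edge list of instance `R0`: the `3 × 2` block `ρʲ({0,1,2} × {0,1})` with pendant root `ρʲ(1,-1)` at `ρʲ(1,0)` (`j = 0`). [folklore] -/
def ER0 : List (ZZ × ZZ) :=
  [((0, 0), (1, 0)), ((0, 0), (0, 1)), ((0, 1), (1, 1)), ((1, 0), (2, 0)), ((1, 0), (1, 1)), ((1, 1), (2, 1)), ((2, 0), (2, 1)), ((1, -1), (1, 0))]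

/-- Kernel certificate: unit darts, connected. [folklore] -/
private theorem goodR0 : GoodEdgeList ER0 := ⟨by decide, ⟨(1, -1), by decide, 16, by decide⟩⟩

/-- The boundary monomials of instance `R0` (kernel evaluation of `rowTerms`). [folklore] -/
private theorem rowR0 : rowTerms ER0 16 (1, -1) =
  [(2, 7, Int.ofNat 1), (2, 5, Int.ofNat 1), (2, 3, Int.ofNat 1), (3, 7, Int.ofNat 2), (3, 5, Int.ofNat 2), (3, 3, Int.ofNat 2), (1, 6, Int.ofNat 0),
      (1, 4, Int.ofNat 0), (1, 4, Int.ofNat 0), (2, 6, Int.ofNat 1), (2, 4, Int.ofNat 1), (2, 4, Int.ofNat 1), (1, 5, Int.ofNat 0), (1, 3,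
      Int.ofNat 0), (1, 5, Int.ofNat 0), (0, 3, Int.negSucc 0), (0, 5, Int.negSucc 0), (0, 7, Int.negSucc 0), (3, 3, Int.negSucc 1), (3, 5,
      Int.negSucc 1), (3, 7, Int.negSucc 1), (0, 4, Int.negSucc 0), (0, 4, Int.negSucc 0), (0, 6, Int.negSucc 0), (1, 4, Int.ofNat 0), (1, 4,
      Int.ofNat 0), (1, 6, Int.ofNat 0)] := by
  decide

/-- The exact boundary relation instantiated on `R0` (rotation `j = 0` of the base table; the row is the base row with slots shifted by `j`). [folklore] -/
private theorem instR0 {x σ : ℝ} {d : Fin 4 → ℂ} (h : ExactBoundaryRelationZ2 x σ d) :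
    d 0 * ((x : ℂ) ^ (3 : ℕ) * (tOf σ)⁻¹ + (2 : ℂ) * (x : ℂ) ^ (4 : ℕ) * (tOf σ)⁻¹ + (x : ℂ) ^ (5 : ℕ) * (tOf σ)⁻¹ + (x : ℂ) ^ (6 : ℕ) * (tOf σ)⁻¹ +
        (x : ℂ) ^ (7 : ℕ) * (tOf σ)⁻¹) + d 1 * ((x : ℂ) ^ (3 : ℕ) + (4 : ℂ) * (x : ℂ) ^ (4 : ℕ) + (2 : ℂ) * (x : ℂ) ^ (5 : ℕ) +
        (2 : ℂ) * (x : ℂ) ^ (6 : ℕ)) + d 2 * ((x : ℂ) ^ (3 : ℕ) * tOf σ + (2 : ℂ) * (x : ℂ) ^ (4 : ℕ) * tOf σ + (x : ℂ) ^ (5 : ℕ) * tOf σ +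
        (x : ℂ) ^ (6 : ℕ) * tOf σ + (x : ℂ) ^ (7 : ℕ) * tOf σ) + d 3 * ((x : ℂ) + (x : ℂ) ^ (3 : ℕ) * (tOf σ)⁻¹ ^ (2 : ℕ) +
        (x : ℂ) ^ (3 : ℕ) * tOf σ ^ (2 : ℕ) + (x : ℂ) ^ (5 : ℕ) * (tOf σ)⁻¹ ^ (2 : ℕ) + (x : ℂ) ^ (5 : ℕ) * tOf σ ^ (2 : ℕ) +
        (x : ℂ) ^ (7 : ℕ) * (tOf σ)⁻¹ ^ (2 : ℕ) + (x : ℂ) ^ (7 : ℕ) * tOf σ ^ (2 : ℕ)) = 0 := by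
  have h0 := inst goodR0 (r := (1, -1)) (w₁ := (1, 0)) (i₀ := 3) (by decide) (by decide) (by decide)
    (fuel := 16) (by decide) (by decide) h
  rw [rowR0] at h0
  simp only [List.map_cons, List.map_nil, List.sum_cons, List.sum_nil, add_zero, tpow_ofNat, tpow_negSucc, zero_add, Nat.reduceAdd, pow_zero,
      mul_one] at h0
  linear_combination h0

/-- Edge list of instance `R1`: the `3 × 2` block `ρʲ({0,1,2} × {0,1})` with pendant root `ρʲ(1,-1)` at `ρʲ(1,0)` (`j = 1`). [folklore] -/
def ER1 : List (ZZ × ZZ) :=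
  [((-1, 0), (0, 0)), ((-1, 0), (-1, 1)), ((-1, 1), (0, 1)), ((-1, 1), (-1, 2)), ((-1, 2), (0, 2)), ((0, 0), (0, 1)), ((0, 1), (0, 2)), ((0, 1), (1,
      1))]

/-- Kernel certificate: unit darts, connected. [folklore] -/
private theorem goodR1 : GoodEdgeList ER1 := ⟨by decide, ⟨(1, 1), by decide, 16, by decide⟩⟩

/-- The boundary monomials of instance `R1` (kernel evaluation of `rowTerms`). [folklore] -/
private theorem rowR1 : rowTerms ER1 16 (1, 1) =
  [(2, 6, Int.ofNat 0), (2, 4, Int.ofNat 0), (2, 4, Int.ofNat 0), (3, 6, Int.ofNat 1), (3, 4, Int.ofNat 1), (3, 4, Int.ofNat 1), (2, 5, Int.ofNat 0),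
      (2, 3, Int.ofNat 0), (2, 5, Int.ofNat 0), (1, 4, Int.negSucc 0), (1, 4, Int.negSucc 0), (1, 6, Int.negSucc 0), (2, 4, Int.ofNat 0), (2, 4,
      Int.ofNat 0), (2, 6, Int.ofNat 0), (0, 7, Int.ofNat 2), (0, 5, Int.ofNat 2), (0, 3, Int.ofNat 2), (3, 7, Int.ofNat 1), (3, 5, Int.ofNat 1), (3,
      3, Int.ofNat 1), (0, 3, Int.negSucc 1), (0, 5, Int.negSucc 1), (0, 7, Int.negSucc 1), (1, 3, Int.negSucc 0), (1, 5, Int.negSucc 0), (1, 7,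
      Int.negSucc 0)] := by
  decide

/-- The exact boundary relation instantiated on `R1` (rotation `j = 1` of the base table; the row is the base row with slots shifted by `j`). [folklore] -/
private theorem instR1 {x σ : ℝ} {d : Fin 4 → ℂ} (h : ExactBoundaryRelationZ2 x σ d) :
    d 0 * ((x : ℂ) + (x : ℂ) ^ (3 : ℕ) * (tOf σ)⁻¹ ^ (2 : ℕ) + (x : ℂ) ^ (3 : ℕ) * tOf σ ^ (2 : ℕ) + (x : ℂ) ^ (5 : ℕ) * (tOf σ)⁻¹ ^ (2 : ℕ) +
        (x : ℂ) ^ (5 : ℕ) * tOf σ ^ (2 : ℕ) + (x : ℂ) ^ (7 : ℕ) * (tOf σ)⁻¹ ^ (2 : ℕ) + (x : ℂ) ^ (7 : ℕ) * tOf σ ^ (2 : ℕ)) +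
        d 1 * ((x : ℂ) ^ (3 : ℕ) * (tOf σ)⁻¹ + (2 : ℂ) * (x : ℂ) ^ (4 : ℕ) * (tOf σ)⁻¹ + (x : ℂ) ^ (5 : ℕ) * (tOf σ)⁻¹ + (x : ℂ) ^ (6 : ℕ) * (tOf σ)⁻¹ +
        (x : ℂ) ^ (7 : ℕ) * (tOf σ)⁻¹) + d 2 * ((x : ℂ) ^ (3 : ℕ) + (4 : ℂ) * (x : ℂ) ^ (4 : ℕ) + (2 : ℂ) * (x : ℂ) ^ (5 : ℕ) +
        (2 : ℂ) * (x : ℂ) ^ (6 : ℕ)) + d 3 * ((x : ℂ) ^ (3 : ℕ) * tOf σ + (2 : ℂ) * (x : ℂ) ^ (4 : ℕ) * tOf σ + (x : ℂ) ^ (5 : ℕ) * tOf σ +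
        (x : ℂ) ^ (6 : ℕ) * tOf σ + (x : ℂ) ^ (7 : ℕ) * tOf σ) = 0 := by
  have h0 := inst goodR1 (r := (1, 1)) (w₁ := (0, 1)) (i₀ := 0) (by decide) (by decide) (by decide)
    (fuel := 16) (by decide) (by decide) h
  rw [rowR1] at h0
  simp only [List.map_cons, List.map_nil, List.sum_cons, List.sum_nil, add_zero, tpow_ofNat, tpow_negSucc, zero_add, Nat.reduceAdd, pow_zero,
      mul_one] at h0
  linear_combination h0

/-- Edge list of instance `R2`: the `3 × 2` block `ρʲ({0,1,2} × {0,1})` with pendant root `ρʲ(1,-1)` at `ρʲ(1,0)` (`j = 2`). [folklore] -/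
def ER2 : List (ZZ × ZZ) :=
  [((-2, -1), (-1, -1)), ((-2, -1), (-2, 0)), ((-2, 0), (-1, 0)), ((-1, -1), (0, -1)), ((-1, -1), (-1, 0)), ((-1, 0), (0, 0)), ((0, -1), (0, 0)), ((-1,
      0), (-1, 1))]

/-- Kernel certificate: unit darts, connected. [folklore] -/
private theorem goodR2 : GoodEdgeList ER2 := ⟨by decide, ⟨(-1, 1), by decide, 16, by decide⟩⟩

/-- The boundary monomials of instance `R2` (kernel evaluation of `rowTerms`). [folklore] -/
private theorem rowR2 : rowTerms ER2 16 (-1, 1) =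
  [(2, 6, Int.negSucc 0), (2, 4, Int.negSucc 0), (2, 4, Int.negSucc 0), (3, 6, Int.ofNat 0), (3, 4, Int.ofNat 0), (3, 4, Int.ofNat 0), (1, 7,
      Int.negSucc 1), (1, 3, Int.negSucc 1), (1, 5, Int.negSucc 1), (2, 7, Int.negSucc 0), (2, 3, Int.negSucc 0), (2, 5, Int.negSucc 0), (3, 5,
      Int.ofNat 0), (3, 5, Int.ofNat 0), (3, 3, Int.ofNat 0), (0, 4, Int.ofNat 1), (0, 6, Int.ofNat 1), (0, 4, Int.ofNat 1), (3, 4, Int.ofNat 0), (3,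
      6, Int.ofNat 0), (3, 4, Int.ofNat 0), (0, 3, Int.ofNat 1), (0, 7, Int.ofNat 1), (0, 5, Int.ofNat 1), (1, 3, Int.ofNat 2), (1, 7, Int.ofNat 2),
      (1, 5, Int.ofNat 2)] := by
  decide

/-- The exact boundary relation instantiated on `R2` (rotation `j = 2` of the base table; the row is the base row with slots shifted by `j`). [folklore] -/
private theorem instR2 {x σ : ℝ} {d : Fin 4 → ℂ} (h : ExactBoundaryRelationZ2 x σ d) :
    d 0 * ((x : ℂ) ^ (3 : ℕ) * tOf σ + (2 : ℂ) * (x : ℂ) ^ (4 : ℕ) * tOf σ + (x : ℂ) ^ (5 : ℕ) * tOf σ + (x : ℂ) ^ (6 : ℕ) * tOf σ +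
        (x : ℂ) ^ (7 : ℕ) * tOf σ) + d 1 * ((x : ℂ) + (x : ℂ) ^ (3 : ℕ) * (tOf σ)⁻¹ ^ (2 : ℕ) + (x : ℂ) ^ (3 : ℕ) * tOf σ ^ (2 : ℕ) +
        (x : ℂ) ^ (5 : ℕ) * (tOf σ)⁻¹ ^ (2 : ℕ) + (x : ℂ) ^ (5 : ℕ) * tOf σ ^ (2 : ℕ) + (x : ℂ) ^ (7 : ℕ) * (tOf σ)⁻¹ ^ (2 : ℕ) +
        (x : ℂ) ^ (7 : ℕ) * tOf σ ^ (2 : ℕ)) + d 2 * ((x : ℂ) ^ (3 : ℕ) * (tOf σ)⁻¹ + (2 : ℂ) * (x : ℂ) ^ (4 : ℕ) * (tOf σ)⁻¹ +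
        (x : ℂ) ^ (5 : ℕ) * (tOf σ)⁻¹ + (x : ℂ) ^ (6 : ℕ) * (tOf σ)⁻¹ + (x : ℂ) ^ (7 : ℕ) * (tOf σ)⁻¹) + d 3 * ((x : ℂ) ^ (3 : ℕ) +
        (4 : ℂ) * (x : ℂ) ^ (4 : ℕ) + (2 : ℂ) * (x : ℂ) ^ (5 : ℕ) + (2 : ℂ) * (x : ℂ) ^ (6 : ℕ)) = 0 := by
  have h0 := inst goodR2 (r := (-1, 1)) (w₁ := (-1, 0)) (i₀ := 1) (by decide) (by decide) (by decide)
    (fuel := 16) (by decide) (by decide) h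
  rw [rowR2] at h0
  simp only [List.map_cons, List.map_nil, List.sum_cons, List.sum_nil, add_zero, tpow_ofNat, tpow_negSucc, zero_add, Nat.reduceAdd, pow_zero,
      mul_one] at h0
  linear_combination h0

/-- Edge list of instance `R3`: the `3 × 2` block `ρʲ({0,1,2} × {0,1})` with pendant root `ρʲ(1,-1)` at `ρʲ(1,0)` (`j = 3`). [folklore] -/
def ER3 : List (ZZ × ZZ) :=
  [((0, -2), (1, -2)), ((0, -2), (0, -1)), ((0, -1), (1, -1)), ((0, -1), (0, 0)), ((0, 0), (1, 0)), ((1, -2), (1, -1)), ((1, -1), (1, 0)), ((-1, -1),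
      (0, -1))]

/-- Kernel certificate: unit darts, connected. [folklore] -/
private theorem goodR3 : GoodEdgeList ER3 := ⟨by decide, ⟨(-1, -1), by decide, 16, by decide⟩⟩

/-- The boundary monomials of instance `R3` (kernel evaluation of `rowTerms`). [folklore] -/
private theorem rowR3 : rowTerms ER3 16 (-1, -1) =
  [(2, 5, Int.negSucc 1), (2, 7, Int.negSucc 1), (2, 3, Int.negSucc 1), (3, 5, Int.negSucc 0), (3, 7, Int.negSucc 0), (3, 3, Int.negSucc 0), (1, 5,
      Int.ofNat 1), (1, 3, Int.ofNat 1), (1, 7, Int.ofNat 1), (2, 5, Int.ofNat 2), (2, 3, Int.ofNat 2), (2, 7, Int.ofNat 2), (0, 4, Int.ofNat 0), (0,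
      6, Int.ofNat 0), (0, 4, Int.ofNat 0), (3, 4, Int.negSucc 0), (3, 6, Int.negSucc 0), (3, 4, Int.negSucc 0), (0, 3, Int.ofNat 0), (0, 5,
      Int.ofNat 0), (0, 5, Int.ofNat 0), (0, 4, Int.ofNat 0), (0, 4, Int.ofNat 0), (0, 6, Int.ofNat 0), (1, 4, Int.ofNat 1), (1, 4, Int.ofNat 1), (1,
      6, Int.ofNat 1)] := by
  decide

/-- The exact boundary relation instantiated on `R3` (rotation `j = 3` of the base table; the row is the base row with slots shifted by `j`). [folklore] -/
private theorem instR3 {x σ : ℝ} {d : Fin 4 → ℂ} (h : ExactBoundaryRelationZ2 x σ d) :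
    d 0 * ((x : ℂ) ^ (3 : ℕ) + (4 : ℂ) * (x : ℂ) ^ (4 : ℕ) + (2 : ℂ) * (x : ℂ) ^ (5 : ℕ) + (2 : ℂ) * (x : ℂ) ^ (6 : ℕ)) +
        d 1 * ((x : ℂ) ^ (3 : ℕ) * tOf σ + (2 : ℂ) * (x : ℂ) ^ (4 : ℕ) * tOf σ + (x : ℂ) ^ (5 : ℕ) * tOf σ + (x : ℂ) ^ (6 : ℕ) * tOf σ +
        (x : ℂ) ^ (7 : ℕ) * tOf σ) + d 2 * ((x : ℂ) + (x : ℂ) ^ (3 : ℕ) * (tOf σ)⁻¹ ^ (2 : ℕ) + (x : ℂ) ^ (3 : ℕ) * tOf σ ^ (2 : ℕ) +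
        (x : ℂ) ^ (5 : ℕ) * (tOf σ)⁻¹ ^ (2 : ℕ) + (x : ℂ) ^ (5 : ℕ) * tOf σ ^ (2 : ℕ) + (x : ℂ) ^ (7 : ℕ) * (tOf σ)⁻¹ ^ (2 : ℕ) +
        (x : ℂ) ^ (7 : ℕ) * tOf σ ^ (2 : ℕ)) + d 3 * ((x : ℂ) ^ (3 : ℕ) * (tOf σ)⁻¹ + (2 : ℂ) * (x : ℂ) ^ (4 : ℕ) * (tOf σ)⁻¹ +
        (x : ℂ) ^ (5 : ℕ) * (tOf σ)⁻¹ + (x : ℂ) ^ (6 : ℕ) * (tOf σ)⁻¹ + (x : ℂ) ^ (7 : ℕ) * (tOf σ)⁻¹) = 0 := by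
  have h0 := inst goodR3 (r := (-1, -1)) (w₁ := (0, -1)) (i₀ := 2) (by decide) (by decide) (by decide)
    (fuel := 16) (by decide) (by decide) h
  rw [rowR3] at h0
  simp only [List.map_cons, List.map_nil, List.sum_cons, List.sum_nil, add_zero, tpow_ofNat, tpow_negSucc, zero_add, Nat.reduceAdd, pow_zero,
      mul_one] at h0
  linear_combination h0

/-! ### Algebraic core: the twelve rows force `d = 0`

Fourier split by the lattice rotation: with `D₁ = Σ dₖ`, `D₋₁ = Σ (-1)ᵏ dₖ`, `A = d₀ - d₂`, `B = d₁ - d₃`,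
the four orientations of a table with base row `R` give `P(1) D₁ = 0`, `P(-1) D₋₁ = 0` and the pair
`(R₀ - R₂) A - (R₃ - R₁) B = 0`, `(R₃ - R₁) A + (R₀ - R₂) B = 0` (`P(ω) = Σₖ Rₖ ω⁻ᵏ`). The single
vertex gives `P_V(ω) = 1 + x c_ω(t)`, linear in `x`; eliminating `x` from `P_Q(ω)`, `P_R(ω)` leaves two
polynomials in `t` alone whose Bézout combination is `1` — for each of `ω = 1, -1, ±i`. All
certificates below are exact (integer/rational coefficients, found by computer algebra and checked by
`linear_combination`; `s` stands for `t⁻¹`, used only through `t s = 1`). -/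

/-- Eliminating `x` between the vertex row and the `Q` row, character `ω = 1` (exact certificate). [folklore] -/
private theorem xelimQ1 {x t s D : ℂ} (hs : t * s = 1)
    (hV : ((1 : ℂ) + x + x * s + x * t) * D = 0)
    (hT : ((1 : ℂ) + x * s + x ^ (2 : ℕ) + x ^ (2 : ℕ) * s + x ^ (2 : ℕ) * t + x ^ (2 : ℕ) * t ^ (2 : ℕ) + (2 : ℂ) * x ^ (3 : ℕ) +
        (2 : ℂ) * x ^ (3 : ℕ) * t + x ^ (4 : ℕ) + x ^ (4 : ℕ) * s + x ^ (4 : ℕ) * t + x ^ (4 : ℕ) * t ^ (2 : ℕ)) * D = 0) :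
    ((18 : ℂ) + (14 : ℂ) * s + (7 : ℂ) * s ^ (2 : ℕ) + (2 : ℂ) * s ^ (3 : ℕ) + (18 : ℂ) * t + (14 : ℂ) * t ^ (2 : ℕ) + (7 : ℂ) * t ^ (3 : ℕ) +
        (2 : ℂ) * t ^ (4 : ℕ)) * D = 0 := by
  linear_combination ((19 : ℂ) + (16 : ℂ) * s + (10 : ℂ) * s ^ (2 : ℕ) + (4 : ℂ) * s ^ (3 : ℕ) + s ^ (4 : ℕ) + (16 : ℂ) * t + (10 : ℂ) * t ^ (2 : ℕ) +
      (4 : ℂ) * t ^ (3 : ℕ) + t ^ (4 : ℕ)) * hT - ((1 : ℂ) + (2 : ℂ) * s + (3 : ℂ) * s ^ (2 : ℕ) + (2 : ℂ) * s ^ (3 : ℕ) + s ^ (4 : ℕ) + (-2 : ℂ) * t +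
      (-4 : ℂ) * t ^ (2 : ℕ) + (-3 : ℂ) * t ^ (3 : ℕ) + -(t ^ (4 : ℕ)) + (15 : ℂ) * x + (13 : ℂ) * x * s + (9 : ℂ) * x * s ^ (2 : ℕ) +
      (4 : ℂ) * x * s ^ (3 : ℕ) + x * s ^ (4 : ℕ) + (15 : ℂ) * x * t + (13 : ℂ) * x * t ^ (2 : ℕ) + (9 : ℂ) * x * t ^ (3 : ℕ) +
      (4 : ℂ) * x * t ^ (4 : ℕ) + x * t ^ (5 : ℕ) + (18 : ℂ) * x ^ (2 : ℕ) + (12 : ℂ) * x ^ (2 : ℕ) * s + (5 : ℂ) * x ^ (2 : ℕ) * s ^ (2 : ℕ) +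
      x ^ (2 : ℕ) * s ^ (3 : ℕ) + (18 : ℂ) * x ^ (2 : ℕ) * t + (12 : ℂ) * x ^ (2 : ℕ) * t ^ (2 : ℕ) + (5 : ℂ) * x ^ (2 : ℕ) * t ^ (3 : ℕ) +
      x ^ (2 : ℕ) * t ^ (4 : ℕ) + (22 : ℂ) * x ^ (3 : ℕ) + (17 : ℂ) * x ^ (3 : ℕ) * s + (10 : ℂ) * x ^ (3 : ℕ) * s ^ (2 : ℕ) +
      (4 : ℂ) * x ^ (3 : ℕ) * s ^ (3 : ℕ) + x ^ (3 : ℕ) * s ^ (4 : ℕ) + (22 : ℂ) * x ^ (3 : ℕ) * t + (17 : ℂ) * x ^ (3 : ℕ) * t ^ (2 : ℕ) +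
      (10 : ℂ) * x ^ (3 : ℕ) * t ^ (3 : ℕ) + (4 : ℂ) * x ^ (3 : ℕ) * t ^ (4 : ℕ) + x ^ (3 : ℕ) * t ^ (5 : ℕ)) * hV + (((-16 : ℂ) * x + (3 : ℂ) * x * s +
      (2 : ℂ) * x * s ^ (2 : ℕ) + x * s ^ (3 : ℕ) + (-14 : ℂ) * x * t + (-7 : ℂ) * x * t ^ (2 : ℕ) + (-2 : ℂ) * x * t ^ (3 : ℕ) +
      (-14 : ℂ) * x ^ (2 : ℕ) + (-5 : ℂ) * x ^ (2 : ℕ) * s + -(x ^ (2 : ℕ) * s ^ (2 : ℕ)) + (-13 : ℂ) * x ^ (2 : ℕ) * t +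
      (-10 : ℂ) * x ^ (2 : ℕ) * t * s + (-4 : ℂ) * x ^ (2 : ℕ) * t * s ^ (2 : ℕ) + -(x ^ (2 : ℕ) * t * s ^ (3 : ℕ)) +
      (5 : ℂ) * x ^ (2 : ℕ) * t ^ (2 : ℕ) + (3 : ℂ) * x ^ (2 : ℕ) * t ^ (3 : ℕ) + x ^ (2 : ℕ) * t ^ (4 : ℕ) + (-2 : ℂ) * x ^ (3 : ℕ) +
      (-15 : ℂ) * x ^ (3 : ℕ) * s + (-7 : ℂ) * x ^ (3 : ℕ) * s ^ (2 : ℕ) + (-2 : ℂ) * x ^ (3 : ℕ) * s ^ (3 : ℕ) + (12 : ℂ) * x ^ (3 : ℕ) * t +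
      (5 : ℂ) * x ^ (3 : ℕ) * t ^ (2 : ℕ) + x ^ (3 : ℕ) * t ^ (3 : ℕ) + (-3 : ℂ) * x ^ (4 : ℕ) + (-4 : ℂ) * x ^ (4 : ℕ) * s +
      -(x ^ (4 : ℕ) * s ^ (2 : ℕ)) + (-9 : ℂ) * x ^ (4 : ℕ) * t + (-10 : ℂ) * x ^ (4 : ℕ) * t * s + (-4 : ℂ) * x ^ (4 : ℕ) * t * s ^ (2 : ℕ) +
      -(x ^ (4 : ℕ) * t * s ^ (3 : ℕ)) + (6 : ℂ) * x ^ (4 : ℕ) * t ^ (2 : ℕ) + (3 : ℂ) * x ^ (4 : ℕ) * t ^ (3 : ℕ) +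
      x ^ (4 : ℕ) * t ^ (4 : ℕ)) * D) * hs

/-- Eliminating `x` between the vertex row and the `R` row, character `ω = 1` (exact certificate). [folklore] -/
private theorem xelimR1 {x t s D : ℂ} (hs : t * s = 1)
    (hV : ((1 : ℂ) + x + x * s + x * t) * D = 0)
    (hT : ((1 : ℂ) + x ^ (2 : ℕ) + x ^ (2 : ℕ) * s + x ^ (2 : ℕ) * s ^ (2 : ℕ) + x ^ (2 : ℕ) * t + x ^ (2 : ℕ) * t ^ (2 : ℕ) + (4 : ℂ) * x ^ (3 : ℕ) +
        (2 : ℂ) * x ^ (3 : ℕ) * s + (2 : ℂ) * x ^ (3 : ℕ) * t + (2 : ℂ) * x ^ (4 : ℕ) + x ^ (4 : ℕ) * s + x ^ (4 : ℕ) * s ^ (2 : ℕ) + x ^ (4 : ℕ) * t +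
        x ^ (4 : ℕ) * t ^ (2 : ℕ) + (2 : ℂ) * x ^ (5 : ℕ) + x ^ (5 : ℕ) * s + x ^ (5 : ℕ) * t + x ^ (6 : ℕ) * s + x ^ (6 : ℕ) * s ^ (2 : ℕ) +
        x ^ (6 : ℕ) * t + x ^ (6 : ℕ) * t ^ (2 : ℕ)) * D = 0) :
    ((168 : ℂ) + (155 : ℂ) * s + (121 : ℂ) * s ^ (2 : ℕ) + (74 : ℂ) * s ^ (3 : ℕ) + (35 : ℂ) * s ^ (4 : ℕ) + (11 : ℂ) * s ^ (5 : ℕ) +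
        (2 : ℂ) * s ^ (6 : ℕ) + (155 : ℂ) * t + (121 : ℂ) * t ^ (2 : ℕ) + (74 : ℂ) * t ^ (3 : ℕ) + (35 : ℂ) * t ^ (4 : ℕ) + (11 : ℂ) * t ^ (5 : ℕ) +
        (2 : ℂ) * t ^ (6 : ℕ)) * D = 0 := by
  linear_combination ((141 : ℂ) + (126 : ℂ) * s + (90 : ℂ) * s ^ (2 : ℕ) + (50 : ℂ) * s ^ (3 : ℕ) + (21 : ℂ) * s ^ (4 : ℕ) + (6 : ℂ) * s ^ (5 : ℕ) +
      s ^ (6 : ℕ) + (126 : ℂ) * t + (90 : ℂ) * t ^ (2 : ℕ) + (50 : ℂ) * t ^ (3 : ℕ) + (21 : ℂ) * t ^ (4 : ℕ) + (6 : ℂ) * t ^ (5 : ℕ) +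
      t ^ (6 : ℕ)) * hT - ((-27 : ℂ) + (-29 : ℂ) * s + (-31 : ℂ) * s ^ (2 : ℕ) + (-24 : ℂ) * s ^ (3 : ℕ) + (-14 : ℂ) * s ^ (4 : ℕ) +
      (-5 : ℂ) * s ^ (5 : ℕ) + -(s ^ (6 : ℕ)) + (-29 : ℂ) * t + (-31 : ℂ) * t ^ (2 : ℕ) + (-24 : ℂ) * t ^ (3 : ℕ) + (-14 : ℂ) * t ^ (4 : ℕ) +
      (-5 : ℂ) * t ^ (5 : ℕ) + -(t ^ (6 : ℕ)) + (85 : ℂ) * x + (87 : ℂ) * x * s + (84 : ℂ) * x * s ^ (2 : ℕ) + (69 : ℂ) * x * s ^ (3 : ℕ) +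
      (43 : ℂ) * x * s ^ (4 : ℕ) + (20 : ℂ) * x * s ^ (5 : ℕ) + (6 : ℂ) * x * s ^ (6 : ℕ) + x * s ^ (7 : ℕ) + (87 : ℂ) * x * t +
      (84 : ℂ) * x * t ^ (2 : ℕ) + (69 : ℂ) * x * t ^ (3 : ℕ) + (43 : ℂ) * x * t ^ (4 : ℕ) + (20 : ℂ) * x * t ^ (5 : ℕ) + (6 : ℂ) * x * t ^ (6 : ℕ) +
      x * t ^ (7 : ℕ) + (314 : ℂ) * x ^ (2 : ℕ) + (277 : ℂ) * x ^ (2 : ℕ) * s + (188 : ℂ) * x ^ (2 : ℕ) * s ^ (2 : ℕ) +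
      (97 : ℂ) * x ^ (2 : ℕ) * s ^ (3 : ℕ) + (36 : ℂ) * x ^ (2 : ℕ) * s ^ (4 : ℕ) + (9 : ℂ) * x ^ (2 : ℕ) * s ^ (5 : ℕ) + x ^ (2 : ℕ) * s ^ (6 : ℕ) +
      (277 : ℂ) * x ^ (2 : ℕ) * t + (188 : ℂ) * x ^ (2 : ℕ) * t ^ (2 : ℕ) + (97 : ℂ) * x ^ (2 : ℕ) * t ^ (3 : ℕ) +
      (36 : ℂ) * x ^ (2 : ℕ) * t ^ (4 : ℕ) + (9 : ℂ) * x ^ (2 : ℕ) * t ^ (5 : ℕ) + x ^ (2 : ℕ) * t ^ (6 : ℕ) + (200 : ℂ) * x ^ (3 : ℕ) +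
      (187 : ℂ) * x ^ (3 : ℕ) * s + (150 : ℂ) * x ^ (3 : ℕ) * s ^ (2 : ℕ) + (101 : ℂ) * x ^ (3 : ℕ) * s ^ (3 : ℕ) +
      (54 : ℂ) * x ^ (3 : ℕ) * s ^ (4 : ℕ) + (22 : ℂ) * x ^ (3 : ℕ) * s ^ (5 : ℕ) + (6 : ℂ) * x ^ (3 : ℕ) * s ^ (6 : ℕ) + x ^ (3 : ℕ) * s ^ (7 : ℕ) +
      (187 : ℂ) * x ^ (3 : ℕ) * t + (150 : ℂ) * x ^ (3 : ℕ) * t ^ (2 : ℕ) + (101 : ℂ) * x ^ (3 : ℕ) * t ^ (3 : ℕ) +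
      (54 : ℂ) * x ^ (3 : ℕ) * t ^ (4 : ℕ) + (22 : ℂ) * x ^ (3 : ℕ) * t ^ (5 : ℕ) + (6 : ℂ) * x ^ (3 : ℕ) * t ^ (6 : ℕ) + x ^ (3 : ℕ) * t ^ (7 : ℕ) +
      (140 : ℂ) * x ^ (4 : ℕ) + (122 : ℂ) * x ^ (4 : ℕ) * s + (80 : ℂ) * x ^ (4 : ℕ) * s ^ (2 : ℕ) + (38 : ℂ) * x ^ (4 : ℕ) * s ^ (3 : ℕ) +
      (12 : ℂ) * x ^ (4 : ℕ) * s ^ (4 : ℕ) + (2 : ℂ) * x ^ (4 : ℕ) * s ^ (5 : ℕ) + (122 : ℂ) * x ^ (4 : ℕ) * t + (80 : ℂ) * x ^ (4 : ℕ) * t ^ (2 : ℕ) +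
      (38 : ℂ) * x ^ (4 : ℕ) * t ^ (3 : ℕ) + (12 : ℂ) * x ^ (4 : ℕ) * t ^ (4 : ℕ) + (2 : ℂ) * x ^ (4 : ℕ) * t ^ (5 : ℕ) + (150 : ℂ) * x ^ (5 : ℕ) +
      (141 : ℂ) * x ^ (5 : ℕ) * s + (116 : ℂ) * x ^ (5 : ℕ) * s ^ (2 : ℕ) + (81 : ℂ) * x ^ (5 : ℕ) * s ^ (3 : ℕ) +
      (46 : ℂ) * x ^ (5 : ℕ) * s ^ (4 : ℕ) + (20 : ℂ) * x ^ (5 : ℕ) * s ^ (5 : ℕ) + (6 : ℂ) * x ^ (5 : ℕ) * s ^ (6 : ℕ) + x ^ (5 : ℕ) * s ^ (7 : ℕ) +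
      (141 : ℂ) * x ^ (5 : ℕ) * t + (116 : ℂ) * x ^ (5 : ℕ) * t ^ (2 : ℕ) + (81 : ℂ) * x ^ (5 : ℕ) * t ^ (3 : ℕ) +
      (46 : ℂ) * x ^ (5 : ℕ) * t ^ (4 : ℕ) + (20 : ℂ) * x ^ (5 : ℕ) * t ^ (5 : ℕ) + (6 : ℂ) * x ^ (5 : ℕ) * t ^ (6 : ℕ) +
      x ^ (5 : ℕ) * t ^ (7 : ℕ)) * hV + (((-58 : ℂ) * x + (-31 : ℂ) * x * s + (-24 : ℂ) * x * s ^ (2 : ℕ) + (-14 : ℂ) * x * s ^ (3 : ℕ) +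
      (-5 : ℂ) * x * s ^ (4 : ℕ) + -(x * s ^ (5 : ℕ)) + (-31 : ℂ) * x * t + (-24 : ℂ) * x * t ^ (2 : ℕ) + (-14 : ℂ) * x * t ^ (3 : ℕ) +
      (-5 : ℂ) * x * t ^ (4 : ℕ) + -(x * t ^ (5 : ℕ)) + (-258 : ℂ) * x ^ (2 : ℕ) + (-182 : ℂ) * x ^ (2 : ℕ) * s + (-2 : ℂ) * x ^ (2 : ℕ) * s ^ (2 : ℕ) +
      (16 : ℂ) * x ^ (2 : ℕ) * s ^ (3 : ℕ) + (13 : ℂ) * x ^ (2 : ℕ) * s ^ (4 : ℕ) + (5 : ℂ) * x ^ (2 : ℕ) * s ^ (5 : ℕ) + x ^ (2 : ℕ) * s ^ (6 : ℕ) +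
      (-182 : ℂ) * x ^ (2 : ℕ) * t + (-180 : ℂ) * x ^ (2 : ℕ) * t * s + (-50 : ℂ) * x ^ (2 : ℕ) * t * s ^ (2 : ℕ) +
      (-21 : ℂ) * x ^ (2 : ℕ) * t * s ^ (3 : ℕ) + (-6 : ℂ) * x ^ (2 : ℕ) * t * s ^ (4 : ℕ) + -(x ^ (2 : ℕ) * t * s ^ (5 : ℕ)) +
      (-2 : ℂ) * x ^ (2 : ℕ) * t ^ (2 : ℕ) + (-50 : ℂ) * x ^ (2 : ℕ) * t ^ (2 : ℕ) * s + (16 : ℂ) * x ^ (2 : ℕ) * t ^ (3 : ℕ) +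
      (-21 : ℂ) * x ^ (2 : ℕ) * t ^ (3 : ℕ) * s + (13 : ℂ) * x ^ (2 : ℕ) * t ^ (4 : ℕ) + (-6 : ℂ) * x ^ (2 : ℕ) * t ^ (4 : ℕ) * s +
      (5 : ℂ) * x ^ (2 : ℕ) * t ^ (5 : ℕ) + -(x ^ (2 : ℕ) * t ^ (5 : ℕ) * s) + x ^ (2 : ℕ) * t ^ (6 : ℕ) + (50 : ℂ) * x ^ (3 : ℕ) +
      (8 : ℂ) * x ^ (3 : ℕ) * s + (-3 : ℂ) * x ^ (3 : ℕ) * s ^ (2 : ℕ) + (-6 : ℂ) * x ^ (3 : ℕ) * s ^ (3 : ℕ) + (-3 : ℂ) * x ^ (3 : ℕ) * s ^ (4 : ℕ) +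
      -(x ^ (3 : ℕ) * s ^ (5 : ℕ)) + (8 : ℂ) * x ^ (3 : ℕ) * t + (-3 : ℂ) * x ^ (3 : ℕ) * t ^ (2 : ℕ) + (-6 : ℂ) * x ^ (3 : ℕ) * t ^ (3 : ℕ) +
      (-3 : ℂ) * x ^ (3 : ℕ) * t ^ (4 : ℕ) + -(x ^ (3 : ℕ) * t ^ (5 : ℕ)) + (-58 : ℂ) * x ^ (4 : ℕ) + (-116 : ℂ) * x ^ (4 : ℕ) * s +
      (30 : ℂ) * x ^ (4 : ℕ) * s ^ (2 : ℕ) + (27 : ℂ) * x ^ (4 : ℕ) * s ^ (3 : ℕ) + (15 : ℂ) * x ^ (4 : ℕ) * s ^ (4 : ℕ) +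
      (5 : ℂ) * x ^ (4 : ℕ) * s ^ (5 : ℕ) + x ^ (4 : ℕ) * s ^ (6 : ℕ) + (-116 : ℂ) * x ^ (4 : ℕ) * t + (-180 : ℂ) * x ^ (4 : ℕ) * t * s +
      (-50 : ℂ) * x ^ (4 : ℕ) * t * s ^ (2 : ℕ) + (-21 : ℂ) * x ^ (4 : ℕ) * t * s ^ (3 : ℕ) + (-6 : ℂ) * x ^ (4 : ℕ) * t * s ^ (4 : ℕ) +
      -(x ^ (4 : ℕ) * t * s ^ (5 : ℕ)) + (30 : ℂ) * x ^ (4 : ℕ) * t ^ (2 : ℕ) + (-50 : ℂ) * x ^ (4 : ℕ) * t ^ (2 : ℕ) * s +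
      (27 : ℂ) * x ^ (4 : ℕ) * t ^ (3 : ℕ) + (-21 : ℂ) * x ^ (4 : ℕ) * t ^ (3 : ℕ) * s + (15 : ℂ) * x ^ (4 : ℕ) * t ^ (4 : ℕ) +
      (-6 : ℂ) * x ^ (4 : ℕ) * t ^ (4 : ℕ) * s + (5 : ℂ) * x ^ (4 : ℕ) * t ^ (5 : ℕ) + -(x ^ (4 : ℕ) * t ^ (5 : ℕ) * s) + x ^ (4 : ℕ) * t ^ (6 : ℕ) +
      (-8 : ℂ) * x ^ (5 : ℕ) + (-10 : ℂ) * x ^ (5 : ℕ) * s + (-12 : ℂ) * x ^ (5 : ℕ) * s ^ (2 : ℕ) + (-9 : ℂ) * x ^ (5 : ℕ) * s ^ (3 : ℕ) +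
      (-4 : ℂ) * x ^ (5 : ℕ) * s ^ (4 : ℕ) + -(x ^ (5 : ℕ) * s ^ (5 : ℕ)) + (-10 : ℂ) * x ^ (5 : ℕ) * t + (-12 : ℂ) * x ^ (5 : ℕ) * t ^ (2 : ℕ) +
      (-9 : ℂ) * x ^ (5 : ℕ) * t ^ (3 : ℕ) + (-4 : ℂ) * x ^ (5 : ℕ) * t ^ (4 : ℕ) + -(x ^ (5 : ℕ) * t ^ (5 : ℕ)) + (-150 : ℂ) * x ^ (6 : ℕ) +
      (-150 : ℂ) * x ^ (6 : ℕ) * s + (10 : ℂ) * x ^ (6 : ℕ) * s ^ (2 : ℕ) + (19 : ℂ) * x ^ (6 : ℕ) * s ^ (3 : ℕ) +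
      (13 : ℂ) * x ^ (6 : ℕ) * s ^ (4 : ℕ) + (5 : ℂ) * x ^ (6 : ℕ) * s ^ (5 : ℕ) + x ^ (6 : ℕ) * s ^ (6 : ℕ) + (-150 : ℂ) * x ^ (6 : ℕ) * t +
      (-180 : ℂ) * x ^ (6 : ℕ) * t * s + (-50 : ℂ) * x ^ (6 : ℕ) * t * s ^ (2 : ℕ) + (-21 : ℂ) * x ^ (6 : ℕ) * t * s ^ (3 : ℕ) +
      (-6 : ℂ) * x ^ (6 : ℕ) * t * s ^ (4 : ℕ) + -(x ^ (6 : ℕ) * t * s ^ (5 : ℕ)) + (10 : ℂ) * x ^ (6 : ℕ) * t ^ (2 : ℕ) +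
      (-50 : ℂ) * x ^ (6 : ℕ) * t ^ (2 : ℕ) * s + (19 : ℂ) * x ^ (6 : ℕ) * t ^ (3 : ℕ) + (-21 : ℂ) * x ^ (6 : ℕ) * t ^ (3 : ℕ) * s +
      (13 : ℂ) * x ^ (6 : ℕ) * t ^ (4 : ℕ) + (-6 : ℂ) * x ^ (6 : ℕ) * t ^ (4 : ℕ) * s + (5 : ℂ) * x ^ (6 : ℕ) * t ^ (5 : ℕ) +
      -(x ^ (6 : ℕ) * t ^ (5 : ℕ) * s) + x ^ (6 : ℕ) * t ^ (6 : ℕ)) * D) * hs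

/-- Bézout step, character `ω = 1`: the two `x`-free polynomials are coprime (exact certificate). [folklore] -/
private theorem bezout1 {t s D : ℂ} (hs : t * s = 1)
    (hQ : ((18 : ℂ) + (14 : ℂ) * s + (7 : ℂ) * s ^ (2 : ℕ) + (2 : ℂ) * s ^ (3 : ℕ) + (18 : ℂ) * t + (14 : ℂ) * t ^ (2 : ℕ) + (7 : ℂ) * t ^ (3 : ℕ) +
        (2 : ℂ) * t ^ (4 : ℕ)) * D = 0)
    (hR : ((168 : ℂ) + (155 : ℂ) * s + (121 : ℂ) * s ^ (2 : ℕ) + (74 : ℂ) * s ^ (3 : ℕ) + (35 : ℂ) * s ^ (4 : ℕ) + (11 : ℂ) * s ^ (5 : ℕ) +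
        (2 : ℂ) * s ^ (6 : ℕ) + (155 : ℂ) * t + (121 : ℂ) * t ^ (2 : ℕ) + (74 : ℂ) * t ^ (3 : ℕ) + (35 : ℂ) * t ^ (4 : ℕ) + (11 : ℂ) * t ^ (5 : ℕ) +
        (2 : ℂ) * t ^ (6 : ℕ)) * D = 0) : D = 0 := by
  linear_combination (((-169 : ℂ) / 108) * t ^ (3 : ℕ) + ((-365 : ℂ) / 18) * t ^ (4 : ℕ) + ((-3029 : ℂ) / 54) * t ^ (5 : ℕ) +
      ((-13709 : ℂ) / 108) * t ^ (6 : ℕ) + ((-10301 : ℂ) / 54) * t ^ (7 : ℕ) + ((-6241 : ℂ) / 27) * t ^ (8 : ℕ) + ((-8419 : ℂ) / 36) * t ^ (9 : ℕ) +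
      ((-5650 : ℂ) / 27) * t ^ (10 : ℕ) + ((-3848 : ℂ) / 27) * t ^ (11 : ℕ) + ((-925 : ℂ) / 12) * t ^ (12 : ℕ) + ((-1459 : ℂ) / 54) * t ^ (13 : ℕ) +
      ((-154 : ℂ) / 27) * t ^ (14 : ℕ)) * hQ + (((223 : ℂ) / 108) * t ^ (6 : ℕ) + ((1555 : ℂ) / 108) * t ^ (7 : ℕ) + ((817 : ℂ) / 36) * t ^ (8 : ℕ) +
      ((2819 : ℂ) / 108) * t ^ (9 : ℕ) + ((2797 : ℂ) / 108) * t ^ (10 : ℕ) + ((281 : ℂ) / 18) * t ^ (11 : ℕ) + ((154 : ℂ) / 27) * t ^ (12 : ℕ)) * hR +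
      (((-1 : ℂ) + -(t * s) + -(t ^ (2 : ℕ) * s ^ (2 : ℕ)) + ((-169 : ℂ) / 6) * t ^ (3 : ℕ) + ((-1183 : ℂ) / 54) * t ^ (3 : ℕ) * s +
      ((-1183 : ℂ) / 108) * t ^ (3 : ℕ) * s ^ (2 : ℕ) + ((-223 : ℂ) / 54) * t ^ (3 : ℕ) * s ^ (3 : ℕ) + ((-2359 : ℂ) / 6) * t ^ (4 : ℕ) +
      ((-5617 : ℂ) / 18) * t ^ (4 : ℕ) * s + ((-4424 : ℂ) / 27) * t ^ (4 : ℕ) * s ^ (2 : ℕ) + ((-5563 : ℂ) / 108) * t ^ (4 : ℕ) * s ^ (3 : ℕ) +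
      ((-223 : ℂ) / 54) * t ^ (4 : ℕ) * s ^ (4 : ℕ) + ((-75415 : ℂ) / 54) * t ^ (5 : ℕ) + ((-63637 : ℂ) / 54) * t ^ (5 : ℕ) * s +
      ((-19027 : ℂ) / 27) * t ^ (5 : ℕ) * s ^ (2 : ℕ) + ((-7453 : ℂ) / 27) * t ^ (5 : ℕ) * s ^ (3 : ℕ) +
      ((-5563 : ℂ) / 108) * t ^ (5 : ℕ) * s ^ (4 : ℕ) + ((-223 : ℂ) / 54) * t ^ (5 : ℕ) * s ^ (5 : ℕ) + ((-350185 : ℂ) / 108) * t ^ (6 : ℕ) +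
      ((-308191 : ℂ) / 108) * t ^ (6 : ℕ) * s + ((-10903 : ℂ) / 6) * t ^ (6 : ℕ) * s ^ (2 : ℕ) + ((-7252 : ℂ) / 9) * t ^ (6 : ℕ) * s ^ (3 : ℕ) +
      ((-22007 : ℂ) / 108) * t ^ (6 : ℕ) * s ^ (4 : ℕ) + ((-1555 : ℂ) / 54) * t ^ (6 : ℕ) * s ^ (5 : ℕ) + ((-422273 : ℂ) / 108) * t ^ (7 : ℕ) +
      ((-99397 : ℂ) / 27) * t ^ (7 : ℕ) * s + ((-132125 : ℂ) / 54) * t ^ (7 : ℕ) * s ^ (2 : ℕ) + ((-10199 : ℂ) / 9) * t ^ (7 : ℕ) * s ^ (3 : ℕ) +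
      ((-32599 : ℂ) / 108) * t ^ (7 : ℕ) * s ^ (4 : ℕ) + ((-817 : ℂ) / 18) * t ^ (7 : ℕ) * s ^ (5 : ℕ) + ((-94781 : ℂ) / 27) * t ^ (8 : ℕ) +
      ((-97966 : ℂ) / 27) * t ^ (8 : ℕ) * s + ((-275765 : ℂ) / 108) * t ^ (8 : ℕ) * s ^ (2 : ℕ) + ((-3689 : ℂ) / 3) * t ^ (8 : ℕ) * s ^ (3 : ℕ) +
      ((-4067 : ℂ) / 12) * t ^ (8 : ℕ) * s ^ (4 : ℕ) + ((-2819 : ℂ) / 54) * t ^ (8 : ℕ) * s ^ (5 : ℕ) + ((-80777 : ℂ) / 36) * t ^ (9 : ℕ) +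
      ((-295777 : ℂ) / 108) * t ^ (9 : ℕ) * s + ((-56891 : ℂ) / 27) * t ^ (9 : ℕ) * s ^ (2 : ℕ) + ((-117673 : ℂ) / 108) * t ^ (9 : ℕ) * s ^ (3 : ℕ) +
      ((-34139 : ℂ) / 108) * t ^ (9 : ℕ) * s ^ (4 : ℕ) + ((-2797 : ℂ) / 54) * t ^ (9 : ℕ) * s ^ (5 : ℕ) + ((-56267 : ℂ) / 108) * t ^ (10 : ℕ) +
      ((-10433 : ℂ) / 9) * t ^ (10 : ℕ) * s + ((-28885 : ℂ) / 27) * t ^ (10 : ℕ) * s ^ (2 : ℕ) + ((-32893 : ℂ) / 54) * t ^ (10 : ℕ) * s ^ (3 : ℕ) +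
      ((-9889 : ℂ) / 54) * t ^ (10 : ℕ) * s ^ (4 : ℕ) + ((-281 : ℂ) / 9) * t ^ (10 : ℕ) * s ^ (5 : ℕ) + ((10682 : ℂ) / 27) * t ^ (11 : ℕ) +
      ((-3475 : ℂ) / 36) * t ^ (11 : ℕ) * s + ((-14467 : ℂ) / 54) * t ^ (11 : ℕ) * s ^ (2 : ℕ) + ((-5390 : ℂ) / 27) * t ^ (11 : ℕ) * s ^ (3 : ℕ) +
      ((-1694 : ℂ) / 27) * t ^ (11 : ℕ) * s ^ (4 : ℕ) + ((-308 : ℂ) / 27) * t ^ (11 : ℕ) * s ^ (5 : ℕ) + ((11291 : ℂ) / 27) * t ^ (12 : ℕ) +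
      ((10829 : ℂ) / 54) * t ^ (12 : ℕ) * s + ((1459 : ℂ) / 27) * t ^ (12 : ℕ) * s ^ (2 : ℕ) + ((2156 : ℂ) / 27) * t ^ (13 : ℕ) +
      ((1078 : ℂ) / 27) * t ^ (13 : ℕ) * s + ((308 : ℂ) / 27) * t ^ (13 : ℕ) * s ^ (2 : ℕ)) * D) * hs

/-- Eliminating `x` between the vertex row and the `Q` row, character `ω = -1` (exact certificate). [folklore] -/
private theorem xelimQm {x t s D : ℂ} (hs : t * s = 1)
    (hV : ((1 : ℂ) + x + -(x * s) + -(x * t)) * D = 0)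
    (hT : ((1 : ℂ) + -(x * s) + x ^ (2 : ℕ) + -(x ^ (2 : ℕ) * s) + -(x ^ (2 : ℕ) * t) + x ^ (2 : ℕ) * t ^ (2 : ℕ) + (2 : ℂ) * x ^ (3 : ℕ) +
        (-2 : ℂ) * x ^ (3 : ℕ) * t + x ^ (4 : ℕ) + -(x ^ (4 : ℕ) * s) + -(x ^ (4 : ℕ) * t) + x ^ (4 : ℕ) * t ^ (2 : ℕ)) * D = 0) :
    ((18 : ℂ) + (-14 : ℂ) * s + (7 : ℂ) * s ^ (2 : ℕ) + (-2 : ℂ) * s ^ (3 : ℕ) + (-18 : ℂ) * t + (14 : ℂ) * t ^ (2 : ℕ) + (-7 : ℂ) * t ^ (3 : ℕ) +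
        (2 : ℂ) * t ^ (4 : ℕ)) * D = 0 := by
  linear_combination ((19 : ℂ) + (-16 : ℂ) * s + (10 : ℂ) * s ^ (2 : ℕ) + (-4 : ℂ) * s ^ (3 : ℕ) + s ^ (4 : ℕ) + (-16 : ℂ) * t +
      (10 : ℂ) * t ^ (2 : ℕ) + (-4 : ℂ) * t ^ (3 : ℕ) + t ^ (4 : ℕ)) * hT - ((1 : ℂ) + (-2 : ℂ) * s + (3 : ℂ) * s ^ (2 : ℕ) + (-2 : ℂ) * s ^ (3 : ℕ) +
      s ^ (4 : ℕ) + (2 : ℂ) * t + (-4 : ℂ) * t ^ (2 : ℕ) + (3 : ℂ) * t ^ (3 : ℕ) + -(t ^ (4 : ℕ)) + (15 : ℂ) * x + (-13 : ℂ) * x * s +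
      (9 : ℂ) * x * s ^ (2 : ℕ) + (-4 : ℂ) * x * s ^ (3 : ℕ) + x * s ^ (4 : ℕ) + (-15 : ℂ) * x * t + (13 : ℂ) * x * t ^ (2 : ℕ) +
      (-9 : ℂ) * x * t ^ (3 : ℕ) + (4 : ℂ) * x * t ^ (4 : ℕ) + -(x * t ^ (5 : ℕ)) + (18 : ℂ) * x ^ (2 : ℕ) + (-12 : ℂ) * x ^ (2 : ℕ) * s +
      (5 : ℂ) * x ^ (2 : ℕ) * s ^ (2 : ℕ) + -(x ^ (2 : ℕ) * s ^ (3 : ℕ)) + (-18 : ℂ) * x ^ (2 : ℕ) * t + (12 : ℂ) * x ^ (2 : ℕ) * t ^ (2 : ℕ) +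
      (-5 : ℂ) * x ^ (2 : ℕ) * t ^ (3 : ℕ) + x ^ (2 : ℕ) * t ^ (4 : ℕ) + (22 : ℂ) * x ^ (3 : ℕ) + (-17 : ℂ) * x ^ (3 : ℕ) * s +
      (10 : ℂ) * x ^ (3 : ℕ) * s ^ (2 : ℕ) + (-4 : ℂ) * x ^ (3 : ℕ) * s ^ (3 : ℕ) + x ^ (3 : ℕ) * s ^ (4 : ℕ) + (-22 : ℂ) * x ^ (3 : ℕ) * t +
      (17 : ℂ) * x ^ (3 : ℕ) * t ^ (2 : ℕ) + (-10 : ℂ) * x ^ (3 : ℕ) * t ^ (3 : ℕ) + (4 : ℂ) * x ^ (3 : ℕ) * t ^ (4 : ℕ) +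
      -(x ^ (3 : ℕ) * t ^ (5 : ℕ))) * hV + (((-16 : ℂ) * x + (-3 : ℂ) * x * s + (2 : ℂ) * x * s ^ (2 : ℕ) + -(x * s ^ (3 : ℕ)) + (14 : ℂ) * x * t +
      (-7 : ℂ) * x * t ^ (2 : ℕ) + (2 : ℂ) * x * t ^ (3 : ℕ) + (-14 : ℂ) * x ^ (2 : ℕ) + (5 : ℂ) * x ^ (2 : ℕ) * s + -(x ^ (2 : ℕ) * s ^ (2 : ℕ)) +
      (13 : ℂ) * x ^ (2 : ℕ) * t + (-10 : ℂ) * x ^ (2 : ℕ) * t * s + (4 : ℂ) * x ^ (2 : ℕ) * t * s ^ (2 : ℕ) + -(x ^ (2 : ℕ) * t * s ^ (3 : ℕ)) +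
      (5 : ℂ) * x ^ (2 : ℕ) * t ^ (2 : ℕ) + (-3 : ℂ) * x ^ (2 : ℕ) * t ^ (3 : ℕ) + x ^ (2 : ℕ) * t ^ (4 : ℕ) + (-2 : ℂ) * x ^ (3 : ℕ) +
      (15 : ℂ) * x ^ (3 : ℕ) * s + (-7 : ℂ) * x ^ (3 : ℕ) * s ^ (2 : ℕ) + (2 : ℂ) * x ^ (3 : ℕ) * s ^ (3 : ℕ) + (-12 : ℂ) * x ^ (3 : ℕ) * t +
      (5 : ℂ) * x ^ (3 : ℕ) * t ^ (2 : ℕ) + -(x ^ (3 : ℕ) * t ^ (3 : ℕ)) + (-3 : ℂ) * x ^ (4 : ℕ) + (4 : ℂ) * x ^ (4 : ℕ) * s +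
      -(x ^ (4 : ℕ) * s ^ (2 : ℕ)) + (9 : ℂ) * x ^ (4 : ℕ) * t + (-10 : ℂ) * x ^ (4 : ℕ) * t * s + (4 : ℂ) * x ^ (4 : ℕ) * t * s ^ (2 : ℕ) +
      -(x ^ (4 : ℕ) * t * s ^ (3 : ℕ)) + (6 : ℂ) * x ^ (4 : ℕ) * t ^ (2 : ℕ) + (-3 : ℂ) * x ^ (4 : ℕ) * t ^ (3 : ℕ) +
      x ^ (4 : ℕ) * t ^ (4 : ℕ)) * D) * hs

/-- Eliminating `x` between the vertex row and the `R` row, character `ω = -1` (exact certificate). [folklore] -/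
private theorem xelimRm {x t s D : ℂ} (hs : t * s = 1)
    (hV : ((1 : ℂ) + x + -(x * s) + -(x * t)) * D = 0)
    (hT : ((-1 : ℂ) + -(x ^ (2 : ℕ)) + x ^ (2 : ℕ) * s + -(x ^ (2 : ℕ) * s ^ (2 : ℕ)) + x ^ (2 : ℕ) * t + -(x ^ (2 : ℕ) * t ^ (2 : ℕ)) +
        (-4 : ℂ) * x ^ (3 : ℕ) + (2 : ℂ) * x ^ (3 : ℕ) * s + (2 : ℂ) * x ^ (3 : ℕ) * t + (-2 : ℂ) * x ^ (4 : ℕ) + x ^ (4 : ℕ) * s +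
        -(x ^ (4 : ℕ) * s ^ (2 : ℕ)) + x ^ (4 : ℕ) * t + -(x ^ (4 : ℕ) * t ^ (2 : ℕ)) + (-2 : ℂ) * x ^ (5 : ℕ) + x ^ (5 : ℕ) * s + x ^ (5 : ℕ) * t +
        x ^ (6 : ℕ) * s + -(x ^ (6 : ℕ) * s ^ (2 : ℕ)) + x ^ (6 : ℕ) * t + -(x ^ (6 : ℕ) * t ^ (2 : ℕ))) * D = 0) :
    ((-168 : ℂ) + (155 : ℂ) * s + (-121 : ℂ) * s ^ (2 : ℕ) + (74 : ℂ) * s ^ (3 : ℕ) + (-35 : ℂ) * s ^ (4 : ℕ) + (11 : ℂ) * s ^ (5 : ℕ) +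
        (-2 : ℂ) * s ^ (6 : ℕ) + (155 : ℂ) * t + (-121 : ℂ) * t ^ (2 : ℕ) + (74 : ℂ) * t ^ (3 : ℕ) + (-35 : ℂ) * t ^ (4 : ℕ) + (11 : ℂ) * t ^ (5 : ℕ) +
        (-2 : ℂ) * t ^ (6 : ℕ)) * D = 0 := by
  linear_combination ((141 : ℂ) + (-126 : ℂ) * s + (90 : ℂ) * s ^ (2 : ℕ) + (-50 : ℂ) * s ^ (3 : ℕ) + (21 : ℂ) * s ^ (4 : ℕ) + (-6 : ℂ) * s ^ (5 : ℕ) +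
      s ^ (6 : ℕ) + (-126 : ℂ) * t + (90 : ℂ) * t ^ (2 : ℕ) + (-50 : ℂ) * t ^ (3 : ℕ) + (21 : ℂ) * t ^ (4 : ℕ) + (-6 : ℂ) * t ^ (5 : ℕ) +
      t ^ (6 : ℕ)) * hT - ((27 : ℂ) + (-29 : ℂ) * s + (31 : ℂ) * s ^ (2 : ℕ) + (-24 : ℂ) * s ^ (3 : ℕ) + (14 : ℂ) * s ^ (4 : ℕ) +
      (-5 : ℂ) * s ^ (5 : ℕ) + s ^ (6 : ℕ) + (-29 : ℂ) * t + (31 : ℂ) * t ^ (2 : ℕ) + (-24 : ℂ) * t ^ (3 : ℕ) + (14 : ℂ) * t ^ (4 : ℕ) +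
      (-5 : ℂ) * t ^ (5 : ℕ) + t ^ (6 : ℕ) + (-85 : ℂ) * x + (87 : ℂ) * x * s + (-84 : ℂ) * x * s ^ (2 : ℕ) + (69 : ℂ) * x * s ^ (3 : ℕ) +
      (-43 : ℂ) * x * s ^ (4 : ℕ) + (20 : ℂ) * x * s ^ (5 : ℕ) + (-6 : ℂ) * x * s ^ (6 : ℕ) + x * s ^ (7 : ℕ) + (87 : ℂ) * x * t +
      (-84 : ℂ) * x * t ^ (2 : ℕ) + (69 : ℂ) * x * t ^ (3 : ℕ) + (-43 : ℂ) * x * t ^ (4 : ℕ) + (20 : ℂ) * x * t ^ (5 : ℕ) + (-6 : ℂ) * x * t ^ (6 : ℕ) +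
      x * t ^ (7 : ℕ) + (-314 : ℂ) * x ^ (2 : ℕ) + (277 : ℂ) * x ^ (2 : ℕ) * s + (-188 : ℂ) * x ^ (2 : ℕ) * s ^ (2 : ℕ) +
      (97 : ℂ) * x ^ (2 : ℕ) * s ^ (3 : ℕ) + (-36 : ℂ) * x ^ (2 : ℕ) * s ^ (4 : ℕ) + (9 : ℂ) * x ^ (2 : ℕ) * s ^ (5 : ℕ) +
      -(x ^ (2 : ℕ) * s ^ (6 : ℕ)) + (277 : ℂ) * x ^ (2 : ℕ) * t + (-188 : ℂ) * x ^ (2 : ℕ) * t ^ (2 : ℕ) + (97 : ℂ) * x ^ (2 : ℕ) * t ^ (3 : ℕ) +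
      (-36 : ℂ) * x ^ (2 : ℕ) * t ^ (4 : ℕ) + (9 : ℂ) * x ^ (2 : ℕ) * t ^ (5 : ℕ) + -(x ^ (2 : ℕ) * t ^ (6 : ℕ)) + (-200 : ℂ) * x ^ (3 : ℕ) +
      (187 : ℂ) * x ^ (3 : ℕ) * s + (-150 : ℂ) * x ^ (3 : ℕ) * s ^ (2 : ℕ) + (101 : ℂ) * x ^ (3 : ℕ) * s ^ (3 : ℕ) +
      (-54 : ℂ) * x ^ (3 : ℕ) * s ^ (4 : ℕ) + (22 : ℂ) * x ^ (3 : ℕ) * s ^ (5 : ℕ) + (-6 : ℂ) * x ^ (3 : ℕ) * s ^ (6 : ℕ) + x ^ (3 : ℕ) * s ^ (7 : ℕ) +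
      (187 : ℂ) * x ^ (3 : ℕ) * t + (-150 : ℂ) * x ^ (3 : ℕ) * t ^ (2 : ℕ) + (101 : ℂ) * x ^ (3 : ℕ) * t ^ (3 : ℕ) +
      (-54 : ℂ) * x ^ (3 : ℕ) * t ^ (4 : ℕ) + (22 : ℂ) * x ^ (3 : ℕ) * t ^ (5 : ℕ) + (-6 : ℂ) * x ^ (3 : ℕ) * t ^ (6 : ℕ) + x ^ (3 : ℕ) * t ^ (7 : ℕ) +
      (-140 : ℂ) * x ^ (4 : ℕ) + (122 : ℂ) * x ^ (4 : ℕ) * s + (-80 : ℂ) * x ^ (4 : ℕ) * s ^ (2 : ℕ) + (38 : ℂ) * x ^ (4 : ℕ) * s ^ (3 : ℕ) +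
      (-12 : ℂ) * x ^ (4 : ℕ) * s ^ (4 : ℕ) + (2 : ℂ) * x ^ (4 : ℕ) * s ^ (5 : ℕ) + (122 : ℂ) * x ^ (4 : ℕ) * t +
      (-80 : ℂ) * x ^ (4 : ℕ) * t ^ (2 : ℕ) + (38 : ℂ) * x ^ (4 : ℕ) * t ^ (3 : ℕ) + (-12 : ℂ) * x ^ (4 : ℕ) * t ^ (4 : ℕ) +
      (2 : ℂ) * x ^ (4 : ℕ) * t ^ (5 : ℕ) + (-150 : ℂ) * x ^ (5 : ℕ) + (141 : ℂ) * x ^ (5 : ℕ) * s + (-116 : ℂ) * x ^ (5 : ℕ) * s ^ (2 : ℕ) +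
      (81 : ℂ) * x ^ (5 : ℕ) * s ^ (3 : ℕ) + (-46 : ℂ) * x ^ (5 : ℕ) * s ^ (4 : ℕ) + (20 : ℂ) * x ^ (5 : ℕ) * s ^ (5 : ℕ) +
      (-6 : ℂ) * x ^ (5 : ℕ) * s ^ (6 : ℕ) + x ^ (5 : ℕ) * s ^ (7 : ℕ) + (141 : ℂ) * x ^ (5 : ℕ) * t + (-116 : ℂ) * x ^ (5 : ℕ) * t ^ (2 : ℕ) +
      (81 : ℂ) * x ^ (5 : ℕ) * t ^ (3 : ℕ) + (-46 : ℂ) * x ^ (5 : ℕ) * t ^ (4 : ℕ) + (20 : ℂ) * x ^ (5 : ℕ) * t ^ (5 : ℕ) +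
      (-6 : ℂ) * x ^ (5 : ℕ) * t ^ (6 : ℕ) + x ^ (5 : ℕ) * t ^ (7 : ℕ)) * hV + (((58 : ℂ) * x + (-31 : ℂ) * x * s + (24 : ℂ) * x * s ^ (2 : ℕ) +
      (-14 : ℂ) * x * s ^ (3 : ℕ) + (5 : ℂ) * x * s ^ (4 : ℕ) + -(x * s ^ (5 : ℕ)) + (-31 : ℂ) * x * t + (24 : ℂ) * x * t ^ (2 : ℕ) +
      (-14 : ℂ) * x * t ^ (3 : ℕ) + (5 : ℂ) * x * t ^ (4 : ℕ) + -(x * t ^ (5 : ℕ)) + (258 : ℂ) * x ^ (2 : ℕ) + (-182 : ℂ) * x ^ (2 : ℕ) * s +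
      (2 : ℂ) * x ^ (2 : ℕ) * s ^ (2 : ℕ) + (16 : ℂ) * x ^ (2 : ℕ) * s ^ (3 : ℕ) + (-13 : ℂ) * x ^ (2 : ℕ) * s ^ (4 : ℕ) +
      (5 : ℂ) * x ^ (2 : ℕ) * s ^ (5 : ℕ) + -(x ^ (2 : ℕ) * s ^ (6 : ℕ)) + (-182 : ℂ) * x ^ (2 : ℕ) * t + (180 : ℂ) * x ^ (2 : ℕ) * t * s +
      (-50 : ℂ) * x ^ (2 : ℕ) * t * s ^ (2 : ℕ) + (21 : ℂ) * x ^ (2 : ℕ) * t * s ^ (3 : ℕ) + (-6 : ℂ) * x ^ (2 : ℕ) * t * s ^ (4 : ℕ) +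
      x ^ (2 : ℕ) * t * s ^ (5 : ℕ) + (2 : ℂ) * x ^ (2 : ℕ) * t ^ (2 : ℕ) + (-50 : ℂ) * x ^ (2 : ℕ) * t ^ (2 : ℕ) * s +
      (16 : ℂ) * x ^ (2 : ℕ) * t ^ (3 : ℕ) + (21 : ℂ) * x ^ (2 : ℕ) * t ^ (3 : ℕ) * s + (-13 : ℂ) * x ^ (2 : ℕ) * t ^ (4 : ℕ) +
      (-6 : ℂ) * x ^ (2 : ℕ) * t ^ (4 : ℕ) * s + (5 : ℂ) * x ^ (2 : ℕ) * t ^ (5 : ℕ) + x ^ (2 : ℕ) * t ^ (5 : ℕ) * s + -(x ^ (2 : ℕ) * t ^ (6 : ℕ)) +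
      (-50 : ℂ) * x ^ (3 : ℕ) + (8 : ℂ) * x ^ (3 : ℕ) * s + (3 : ℂ) * x ^ (3 : ℕ) * s ^ (2 : ℕ) + (-6 : ℂ) * x ^ (3 : ℕ) * s ^ (3 : ℕ) +
      (3 : ℂ) * x ^ (3 : ℕ) * s ^ (4 : ℕ) + -(x ^ (3 : ℕ) * s ^ (5 : ℕ)) + (8 : ℂ) * x ^ (3 : ℕ) * t + (3 : ℂ) * x ^ (3 : ℕ) * t ^ (2 : ℕ) +
      (-6 : ℂ) * x ^ (3 : ℕ) * t ^ (3 : ℕ) + (3 : ℂ) * x ^ (3 : ℕ) * t ^ (4 : ℕ) + -(x ^ (3 : ℕ) * t ^ (5 : ℕ)) + (58 : ℂ) * x ^ (4 : ℕ) +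
      (-116 : ℂ) * x ^ (4 : ℕ) * s + (-30 : ℂ) * x ^ (4 : ℕ) * s ^ (2 : ℕ) + (27 : ℂ) * x ^ (4 : ℕ) * s ^ (3 : ℕ) +
      (-15 : ℂ) * x ^ (4 : ℕ) * s ^ (4 : ℕ) + (5 : ℂ) * x ^ (4 : ℕ) * s ^ (5 : ℕ) + -(x ^ (4 : ℕ) * s ^ (6 : ℕ)) + (-116 : ℂ) * x ^ (4 : ℕ) * t +
      (180 : ℂ) * x ^ (4 : ℕ) * t * s + (-50 : ℂ) * x ^ (4 : ℕ) * t * s ^ (2 : ℕ) + (21 : ℂ) * x ^ (4 : ℕ) * t * s ^ (3 : ℕ) +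
      (-6 : ℂ) * x ^ (4 : ℕ) * t * s ^ (4 : ℕ) + x ^ (4 : ℕ) * t * s ^ (5 : ℕ) + (-30 : ℂ) * x ^ (4 : ℕ) * t ^ (2 : ℕ) +
      (-50 : ℂ) * x ^ (4 : ℕ) * t ^ (2 : ℕ) * s + (27 : ℂ) * x ^ (4 : ℕ) * t ^ (3 : ℕ) + (21 : ℂ) * x ^ (4 : ℕ) * t ^ (3 : ℕ) * s +
      (-15 : ℂ) * x ^ (4 : ℕ) * t ^ (4 : ℕ) + (-6 : ℂ) * x ^ (4 : ℕ) * t ^ (4 : ℕ) * s + (5 : ℂ) * x ^ (4 : ℕ) * t ^ (5 : ℕ) +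
      x ^ (4 : ℕ) * t ^ (5 : ℕ) * s + -(x ^ (4 : ℕ) * t ^ (6 : ℕ)) + (8 : ℂ) * x ^ (5 : ℕ) + (-10 : ℂ) * x ^ (5 : ℕ) * s +
      (12 : ℂ) * x ^ (5 : ℕ) * s ^ (2 : ℕ) + (-9 : ℂ) * x ^ (5 : ℕ) * s ^ (3 : ℕ) + (4 : ℂ) * x ^ (5 : ℕ) * s ^ (4 : ℕ) + -(x ^ (5 : ℕ) * s ^ (5 : ℕ)) +
      (-10 : ℂ) * x ^ (5 : ℕ) * t + (12 : ℂ) * x ^ (5 : ℕ) * t ^ (2 : ℕ) + (-9 : ℂ) * x ^ (5 : ℕ) * t ^ (3 : ℕ) + (4 : ℂ) * x ^ (5 : ℕ) * t ^ (4 : ℕ) +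
      -(x ^ (5 : ℕ) * t ^ (5 : ℕ)) + (150 : ℂ) * x ^ (6 : ℕ) + (-150 : ℂ) * x ^ (6 : ℕ) * s + (-10 : ℂ) * x ^ (6 : ℕ) * s ^ (2 : ℕ) +
      (19 : ℂ) * x ^ (6 : ℕ) * s ^ (3 : ℕ) + (-13 : ℂ) * x ^ (6 : ℕ) * s ^ (4 : ℕ) + (5 : ℂ) * x ^ (6 : ℕ) * s ^ (5 : ℕ) +
      -(x ^ (6 : ℕ) * s ^ (6 : ℕ)) + (-150 : ℂ) * x ^ (6 : ℕ) * t + (180 : ℂ) * x ^ (6 : ℕ) * t * s + (-50 : ℂ) * x ^ (6 : ℕ) * t * s ^ (2 : ℕ) +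
      (21 : ℂ) * x ^ (6 : ℕ) * t * s ^ (3 : ℕ) + (-6 : ℂ) * x ^ (6 : ℕ) * t * s ^ (4 : ℕ) + x ^ (6 : ℕ) * t * s ^ (5 : ℕ) +
      (-10 : ℂ) * x ^ (6 : ℕ) * t ^ (2 : ℕ) + (-50 : ℂ) * x ^ (6 : ℕ) * t ^ (2 : ℕ) * s + (19 : ℂ) * x ^ (6 : ℕ) * t ^ (3 : ℕ) +
      (21 : ℂ) * x ^ (6 : ℕ) * t ^ (3 : ℕ) * s + (-13 : ℂ) * x ^ (6 : ℕ) * t ^ (4 : ℕ) + (-6 : ℂ) * x ^ (6 : ℕ) * t ^ (4 : ℕ) * s +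
      (5 : ℂ) * x ^ (6 : ℕ) * t ^ (5 : ℕ) + x ^ (6 : ℕ) * t ^ (5 : ℕ) * s + -(x ^ (6 : ℕ) * t ^ (6 : ℕ))) * D) * hs

/-- Bézout step, character `ω = -1`: the two `x`-free polynomials are coprime (exact certificate). [folklore] -/
private theorem bezoutm {t s D : ℂ} (hs : t * s = 1)
    (hQ : ((18 : ℂ) + (-14 : ℂ) * s + (7 : ℂ) * s ^ (2 : ℕ) + (-2 : ℂ) * s ^ (3 : ℕ) + (-18 : ℂ) * t + (14 : ℂ) * t ^ (2 : ℕ) + (-7 : ℂ) * t ^ (3 : ℕ) +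
        (2 : ℂ) * t ^ (4 : ℕ)) * D = 0)
    (hR : ((-168 : ℂ) + (155 : ℂ) * s + (-121 : ℂ) * s ^ (2 : ℕ) + (74 : ℂ) * s ^ (3 : ℕ) + (-35 : ℂ) * s ^ (4 : ℕ) + (11 : ℂ) * s ^ (5 : ℕ) +
        (-2 : ℂ) * s ^ (6 : ℕ) + (155 : ℂ) * t + (-121 : ℂ) * t ^ (2 : ℕ) + (74 : ℂ) * t ^ (3 : ℕ) + (-35 : ℂ) * t ^ (4 : ℕ) + (11 : ℂ) * t ^ (5 : ℕ) +
        (-2 : ℂ) * t ^ (6 : ℕ)) * D = 0) : D = 0 := by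
  linear_combination (((169 : ℂ) / 108) * t ^ (3 : ℕ) + ((-365 : ℂ) / 18) * t ^ (4 : ℕ) + ((3029 : ℂ) / 54) * t ^ (5 : ℕ) +
      ((-13709 : ℂ) / 108) * t ^ (6 : ℕ) + ((10301 : ℂ) / 54) * t ^ (7 : ℕ) + ((-6241 : ℂ) / 27) * t ^ (8 : ℕ) + ((8419 : ℂ) / 36) * t ^ (9 : ℕ) +
      ((-5650 : ℂ) / 27) * t ^ (10 : ℕ) + ((3848 : ℂ) / 27) * t ^ (11 : ℕ) + ((-925 : ℂ) / 12) * t ^ (12 : ℕ) + ((1459 : ℂ) / 54) * t ^ (13 : ℕ) +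
      ((-154 : ℂ) / 27) * t ^ (14 : ℕ)) * hQ + (((-223 : ℂ) / 108) * t ^ (6 : ℕ) + ((1555 : ℂ) / 108) * t ^ (7 : ℕ) + ((-817 : ℂ) / 36) * t ^ (8 : ℕ) +
      ((2819 : ℂ) / 108) * t ^ (9 : ℕ) + ((-2797 : ℂ) / 108) * t ^ (10 : ℕ) + ((281 : ℂ) / 18) * t ^ (11 : ℕ) + ((-154 : ℂ) / 27) * t ^ (12 : ℕ)) * hR +
      (((-1 : ℂ) + -(t * s) + -(t ^ (2 : ℕ) * s ^ (2 : ℕ)) + ((169 : ℂ) / 6) * t ^ (3 : ℕ) + ((-1183 : ℂ) / 54) * t ^ (3 : ℕ) * s +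
      ((1183 : ℂ) / 108) * t ^ (3 : ℕ) * s ^ (2 : ℕ) + ((-223 : ℂ) / 54) * t ^ (3 : ℕ) * s ^ (3 : ℕ) + ((-2359 : ℂ) / 6) * t ^ (4 : ℕ) +
      ((5617 : ℂ) / 18) * t ^ (4 : ℕ) * s + ((-4424 : ℂ) / 27) * t ^ (4 : ℕ) * s ^ (2 : ℕ) + ((5563 : ℂ) / 108) * t ^ (4 : ℕ) * s ^ (3 : ℕ) +
      ((-223 : ℂ) / 54) * t ^ (4 : ℕ) * s ^ (4 : ℕ) + ((75415 : ℂ) / 54) * t ^ (5 : ℕ) + ((-63637 : ℂ) / 54) * t ^ (5 : ℕ) * s +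
      ((19027 : ℂ) / 27) * t ^ (5 : ℕ) * s ^ (2 : ℕ) + ((-7453 : ℂ) / 27) * t ^ (5 : ℕ) * s ^ (3 : ℕ) + ((5563 : ℂ) / 108) * t ^ (5 : ℕ) * s ^ (4 : ℕ) +
      ((-223 : ℂ) / 54) * t ^ (5 : ℕ) * s ^ (5 : ℕ) + ((-350185 : ℂ) / 108) * t ^ (6 : ℕ) + ((308191 : ℂ) / 108) * t ^ (6 : ℕ) * s +
      ((-10903 : ℂ) / 6) * t ^ (6 : ℕ) * s ^ (2 : ℕ) + ((7252 : ℂ) / 9) * t ^ (6 : ℕ) * s ^ (3 : ℕ) + ((-22007 : ℂ) / 108) * t ^ (6 : ℕ) * s ^ (4 : ℕ) +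
      ((1555 : ℂ) / 54) * t ^ (6 : ℕ) * s ^ (5 : ℕ) + ((422273 : ℂ) / 108) * t ^ (7 : ℕ) + ((-99397 : ℂ) / 27) * t ^ (7 : ℕ) * s +
      ((132125 : ℂ) / 54) * t ^ (7 : ℕ) * s ^ (2 : ℕ) + ((-10199 : ℂ) / 9) * t ^ (7 : ℕ) * s ^ (3 : ℕ) +
      ((32599 : ℂ) / 108) * t ^ (7 : ℕ) * s ^ (4 : ℕ) + ((-817 : ℂ) / 18) * t ^ (7 : ℕ) * s ^ (5 : ℕ) + ((-94781 : ℂ) / 27) * t ^ (8 : ℕ) +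
      ((97966 : ℂ) / 27) * t ^ (8 : ℕ) * s + ((-275765 : ℂ) / 108) * t ^ (8 : ℕ) * s ^ (2 : ℕ) + ((3689 : ℂ) / 3) * t ^ (8 : ℕ) * s ^ (3 : ℕ) +
      ((-4067 : ℂ) / 12) * t ^ (8 : ℕ) * s ^ (4 : ℕ) + ((2819 : ℂ) / 54) * t ^ (8 : ℕ) * s ^ (5 : ℕ) + ((80777 : ℂ) / 36) * t ^ (9 : ℕ) +
      ((-295777 : ℂ) / 108) * t ^ (9 : ℕ) * s + ((56891 : ℂ) / 27) * t ^ (9 : ℕ) * s ^ (2 : ℕ) + ((-117673 : ℂ) / 108) * t ^ (9 : ℕ) * s ^ (3 : ℕ) +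
      ((34139 : ℂ) / 108) * t ^ (9 : ℕ) * s ^ (4 : ℕ) + ((-2797 : ℂ) / 54) * t ^ (9 : ℕ) * s ^ (5 : ℕ) + ((-56267 : ℂ) / 108) * t ^ (10 : ℕ) +
      ((10433 : ℂ) / 9) * t ^ (10 : ℕ) * s + ((-28885 : ℂ) / 27) * t ^ (10 : ℕ) * s ^ (2 : ℕ) + ((32893 : ℂ) / 54) * t ^ (10 : ℕ) * s ^ (3 : ℕ) +
      ((-9889 : ℂ) / 54) * t ^ (10 : ℕ) * s ^ (4 : ℕ) + ((281 : ℂ) / 9) * t ^ (10 : ℕ) * s ^ (5 : ℕ) + ((-10682 : ℂ) / 27) * t ^ (11 : ℕ) +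
      ((-3475 : ℂ) / 36) * t ^ (11 : ℕ) * s + ((14467 : ℂ) / 54) * t ^ (11 : ℕ) * s ^ (2 : ℕ) + ((-5390 : ℂ) / 27) * t ^ (11 : ℕ) * s ^ (3 : ℕ) +
      ((1694 : ℂ) / 27) * t ^ (11 : ℕ) * s ^ (4 : ℕ) + ((-308 : ℂ) / 27) * t ^ (11 : ℕ) * s ^ (5 : ℕ) + ((11291 : ℂ) / 27) * t ^ (12 : ℕ) +
      ((-10829 : ℂ) / 54) * t ^ (12 : ℕ) * s + ((1459 : ℂ) / 27) * t ^ (12 : ℕ) * s ^ (2 : ℕ) + ((-2156 : ℂ) / 27) * t ^ (13 : ℕ) +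
      ((1078 : ℂ) / 27) * t ^ (13 : ℕ) * s + ((-308 : ℂ) / 27) * t ^ (13 : ℕ) * s ^ (2 : ℕ)) * D) * hs

/-- Eliminating `x` between the vertex rows and the `Q` rows, characters `ω = ±i` in real form (exact certificate). [folklore] -/
private theorem xelimQi {x t s A B : ℂ} (hs : t * s = 1)
    (hVre : ((1 : ℂ) + -(x)) * A + (x * s + -(x * t)) * B = 0)
    (hVim : (-(x * s) + x * t) * A + ((1 : ℂ) + -(x)) * B = 0)
    (hTre : ((-1 : ℂ) + x ^ (2 : ℕ) + -(x ^ (2 : ℕ) * t ^ (2 : ℕ)) + (2 : ℂ) * x ^ (3 : ℕ) + x ^ (4 : ℕ) + -(x ^ (4 : ℕ) * t ^ (2 : ℕ))) * A +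
        (-(x * s) + -(x ^ (2 : ℕ) * s) + x ^ (2 : ℕ) * t + (2 : ℂ) * x ^ (3 : ℕ) * t + -(x ^ (4 : ℕ) * s) + x ^ (4 : ℕ) * t) * B = 0)
    (hTim : (x * s + x ^ (2 : ℕ) * s + -(x ^ (2 : ℕ) * t) + (-2 : ℂ) * x ^ (3 : ℕ) * t + x ^ (4 : ℕ) * s + -(x ^ (4 : ℕ) * t)) * A + ((-1 : ℂ) +
        x ^ (2 : ℕ) + -(x ^ (2 : ℕ) * t ^ (2 : ℕ)) + (2 : ℂ) * x ^ (3 : ℕ) + x ^ (4 : ℕ) + -(x ^ (4 : ℕ) * t ^ (2 : ℕ))) * B = 0) :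
    (s ^ (2 : ℕ)) * A + (t ^ (3 : ℕ)) * B = 0 ∧
    (-(t ^ (3 : ℕ))) * A + (s ^ (2 : ℕ)) * B = 0 := by
  constructor
  · linear_combination ((19 : ℂ) + (-10 : ℂ) * s ^ (2 : ℕ) + s ^ (4 : ℕ) + (-10 : ℂ) * t ^ (2 : ℕ) + t ^ (4 : ℕ)) * hTre - ((16 : ℂ) * s +
      (-4 : ℂ) * s ^ (3 : ℕ) + (-16 : ℂ) * t + (4 : ℂ) * t ^ (3 : ℕ)) * hTim - ((-19 : ℂ) + (9 : ℂ) * s ^ (2 : ℕ) + -(s ^ (4 : ℕ)) +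
      (10 : ℂ) * t ^ (2 : ℕ) + -(t ^ (4 : ℕ)) + (-35 : ℂ) * x + (13 : ℂ) * x * s ^ (2 : ℕ) + -(x * s ^ (4 : ℕ)) + (25 : ℂ) * x * t ^ (2 : ℕ) +
      (-4 : ℂ) * x * t ^ (4 : ℕ) + (-34 : ℂ) * x ^ (2 : ℕ) + (11 : ℂ) * x ^ (2 : ℕ) * s ^ (2 : ℕ) + (24 : ℂ) * x ^ (2 : ℕ) * t ^ (2 : ℕ) +
      (-3 : ℂ) * x ^ (2 : ℕ) * t ^ (4 : ℕ) + (-22 : ℂ) * x ^ (3 : ℕ) + (10 : ℂ) * x ^ (3 : ℕ) * s ^ (2 : ℕ) + -(x ^ (3 : ℕ) * s ^ (4 : ℕ)) +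
      (17 : ℂ) * x ^ (3 : ℕ) * t ^ (2 : ℕ) + (-4 : ℂ) * x ^ (3 : ℕ) * t ^ (4 : ℕ)) * hVre + ((-16 : ℂ) * s + (4 : ℂ) * s ^ (3 : ℕ) + (16 : ℂ) * t +
      (-3 : ℂ) * t ^ (3 : ℕ) + (-25 : ℂ) * x * s + (4 : ℂ) * x * s ^ (3 : ℕ) + (35 : ℂ) * x * t + (-13 : ℂ) * x * t ^ (3 : ℕ) + x * t ^ (5 : ℕ) +
      (-24 : ℂ) * x ^ (2 : ℕ) * s + (3 : ℂ) * x ^ (2 : ℕ) * s ^ (3 : ℕ) + (34 : ℂ) * x ^ (2 : ℕ) * t + (-11 : ℂ) * x ^ (2 : ℕ) * t ^ (3 : ℕ) +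
      (-17 : ℂ) * x ^ (3 : ℕ) * s + (4 : ℂ) * x ^ (3 : ℕ) * s ^ (3 : ℕ) + (22 : ℂ) * x ^ (3 : ℕ) * t + (-10 : ℂ) * x ^ (3 : ℕ) * t ^ (3 : ℕ) +
      x ^ (3 : ℕ) * t ^ (5 : ℕ)) * hVim + (((16 : ℂ) * x + (-4 : ℂ) * x * s ^ (2 : ℕ) + x * t ^ (2 : ℕ) + (18 : ℂ) * x ^ (2 : ℕ) +
      x ^ (2 : ℕ) * s ^ (2 : ℕ) + (-10 : ℂ) * x ^ (2 : ℕ) * t * s + x ^ (2 : ℕ) * t * s ^ (3 : ℕ) + (-9 : ℂ) * x ^ (2 : ℕ) * t ^ (2 : ℕ) +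
      x ^ (2 : ℕ) * t ^ (4 : ℕ) + (26 : ℂ) * x ^ (3 : ℕ) + (5 : ℂ) * x ^ (3 : ℕ) * s ^ (2 : ℕ) + (-11 : ℂ) * x ^ (3 : ℕ) * t ^ (2 : ℕ) +
      (-3 : ℂ) * x ^ (4 : ℕ) + x ^ (4 : ℕ) * s ^ (2 : ℕ) + (-10 : ℂ) * x ^ (4 : ℕ) * t * s + x ^ (4 : ℕ) * t * s ^ (3 : ℕ) +
      (-6 : ℂ) * x ^ (4 : ℕ) * t ^ (2 : ℕ) + x ^ (4 : ℕ) * t ^ (4 : ℕ)) * A + ((-9 : ℂ) * x * s + x * s ^ (3 : ℕ) + x ^ (2 : ℕ) * s +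
      -(x ^ (2 : ℕ) * t) + (4 : ℂ) * x ^ (2 : ℕ) * t * s ^ (2 : ℕ) + (-3 : ℂ) * x ^ (2 : ℕ) * t ^ (3 : ℕ) + (9 : ℂ) * x ^ (3 : ℕ) * s +
      (-2 : ℂ) * x ^ (3 : ℕ) * s ^ (3 : ℕ) + (24 : ℂ) * x ^ (3 : ℕ) * t + (-3 : ℂ) * x ^ (3 : ℕ) * t ^ (3 : ℕ) + (4 : ℂ) * x ^ (4 : ℕ) * s +
      (-9 : ℂ) * x ^ (4 : ℕ) * t + (4 : ℂ) * x ^ (4 : ℕ) * t * s ^ (2 : ℕ) + (-3 : ℂ) * x ^ (4 : ℕ) * t ^ (3 : ℕ)) * B) * hs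
  · linear_combination ((16 : ℂ) * s + (-4 : ℂ) * s ^ (3 : ℕ) + (-16 : ℂ) * t + (4 : ℂ) * t ^ (3 : ℕ)) * hTre + ((19 : ℂ) + (-10 : ℂ) * s ^ (2 : ℕ) +
      s ^ (4 : ℕ) + (-10 : ℂ) * t ^ (2 : ℕ) + t ^ (4 : ℕ)) * hTim - ((-16 : ℂ) * s + (4 : ℂ) * s ^ (3 : ℕ) + (16 : ℂ) * t + (-3 : ℂ) * t ^ (3 : ℕ) +
      (-25 : ℂ) * x * s + (4 : ℂ) * x * s ^ (3 : ℕ) + (35 : ℂ) * x * t + (-13 : ℂ) * x * t ^ (3 : ℕ) + x * t ^ (5 : ℕ) + (-24 : ℂ) * x ^ (2 : ℕ) * s +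
      (3 : ℂ) * x ^ (2 : ℕ) * s ^ (3 : ℕ) + (34 : ℂ) * x ^ (2 : ℕ) * t + (-11 : ℂ) * x ^ (2 : ℕ) * t ^ (3 : ℕ) + (-17 : ℂ) * x ^ (3 : ℕ) * s +
      (4 : ℂ) * x ^ (3 : ℕ) * s ^ (3 : ℕ) + (22 : ℂ) * x ^ (3 : ℕ) * t + (-10 : ℂ) * x ^ (3 : ℕ) * t ^ (3 : ℕ) +
      x ^ (3 : ℕ) * t ^ (5 : ℕ)) * hVre - ((-19 : ℂ) + (9 : ℂ) * s ^ (2 : ℕ) + -(s ^ (4 : ℕ)) + (10 : ℂ) * t ^ (2 : ℕ) + -(t ^ (4 : ℕ)) +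
      (-35 : ℂ) * x + (13 : ℂ) * x * s ^ (2 : ℕ) + -(x * s ^ (4 : ℕ)) + (25 : ℂ) * x * t ^ (2 : ℕ) + (-4 : ℂ) * x * t ^ (4 : ℕ) +
      (-34 : ℂ) * x ^ (2 : ℕ) + (11 : ℂ) * x ^ (2 : ℕ) * s ^ (2 : ℕ) + (24 : ℂ) * x ^ (2 : ℕ) * t ^ (2 : ℕ) + (-3 : ℂ) * x ^ (2 : ℕ) * t ^ (4 : ℕ) +
      (-22 : ℂ) * x ^ (3 : ℕ) + (10 : ℂ) * x ^ (3 : ℕ) * s ^ (2 : ℕ) + -(x ^ (3 : ℕ) * s ^ (4 : ℕ)) + (17 : ℂ) * x ^ (3 : ℕ) * t ^ (2 : ℕ) +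
      (-4 : ℂ) * x ^ (3 : ℕ) * t ^ (4 : ℕ)) * hVim + (((9 : ℂ) * x * s + -(x * s ^ (3 : ℕ)) + -(x ^ (2 : ℕ) * s) + x ^ (2 : ℕ) * t +
      (-4 : ℂ) * x ^ (2 : ℕ) * t * s ^ (2 : ℕ) + (3 : ℂ) * x ^ (2 : ℕ) * t ^ (3 : ℕ) + (-9 : ℂ) * x ^ (3 : ℕ) * s +
      (2 : ℂ) * x ^ (3 : ℕ) * s ^ (3 : ℕ) + (-24 : ℂ) * x ^ (3 : ℕ) * t + (3 : ℂ) * x ^ (3 : ℕ) * t ^ (3 : ℕ) + (-4 : ℂ) * x ^ (4 : ℕ) * s +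
      (9 : ℂ) * x ^ (4 : ℕ) * t + (-4 : ℂ) * x ^ (4 : ℕ) * t * s ^ (2 : ℕ) + (3 : ℂ) * x ^ (4 : ℕ) * t ^ (3 : ℕ)) * A + ((16 : ℂ) * x +
      (-4 : ℂ) * x * s ^ (2 : ℕ) + x * t ^ (2 : ℕ) + (18 : ℂ) * x ^ (2 : ℕ) + x ^ (2 : ℕ) * s ^ (2 : ℕ) + (-10 : ℂ) * x ^ (2 : ℕ) * t * s +
      x ^ (2 : ℕ) * t * s ^ (3 : ℕ) + (-9 : ℂ) * x ^ (2 : ℕ) * t ^ (2 : ℕ) + x ^ (2 : ℕ) * t ^ (4 : ℕ) + (26 : ℂ) * x ^ (3 : ℕ) +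
      (5 : ℂ) * x ^ (3 : ℕ) * s ^ (2 : ℕ) + (-11 : ℂ) * x ^ (3 : ℕ) * t ^ (2 : ℕ) + (-3 : ℂ) * x ^ (4 : ℕ) + x ^ (4 : ℕ) * s ^ (2 : ℕ) +
      (-10 : ℂ) * x ^ (4 : ℕ) * t * s + x ^ (4 : ℕ) * t * s ^ (3 : ℕ) + (-6 : ℂ) * x ^ (4 : ℕ) * t ^ (2 : ℕ) + x ^ (4 : ℕ) * t ^ (4 : ℕ)) * B) * hs

/-- Eliminating `x` between the vertex rows and the `R` rows, characters `ω = ±i` in real form (exact certificate). [folklore] -/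
private theorem xelimRi {x t s A B : ℂ} (hs : t * s = 1)
    (hVre : ((1 : ℂ) + -(x)) * A + (x * s + -(x * t)) * B = 0)
    (hVim : (-(x * s) + x * t) * A + ((1 : ℂ) + -(x)) * B = 0)
    (hTre : (x ^ (2 : ℕ) * s + -(x ^ (2 : ℕ) * t) + (2 : ℂ) * x ^ (3 : ℕ) * s + (-2 : ℂ) * x ^ (3 : ℕ) * t + x ^ (4 : ℕ) * s + -(x ^ (4 : ℕ) * t) +
        x ^ (5 : ℕ) * s + -(x ^ (5 : ℕ) * t) + x ^ (6 : ℕ) * s + -(x ^ (6 : ℕ) * t)) * A + ((-1 : ℂ) + x ^ (2 : ℕ) + -(x ^ (2 : ℕ) * s ^ (2 : ℕ)) +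
        -(x ^ (2 : ℕ) * t ^ (2 : ℕ)) + (4 : ℂ) * x ^ (3 : ℕ) + (2 : ℂ) * x ^ (4 : ℕ) + -(x ^ (4 : ℕ) * s ^ (2 : ℕ)) + -(x ^ (4 : ℕ) * t ^ (2 : ℕ)) +
        (2 : ℂ) * x ^ (5 : ℕ) + -(x ^ (6 : ℕ) * s ^ (2 : ℕ)) + -(x ^ (6 : ℕ) * t ^ (2 : ℕ))) * B = 0)
    (hTim : ((1 : ℂ) + -(x ^ (2 : ℕ)) + x ^ (2 : ℕ) * s ^ (2 : ℕ) + x ^ (2 : ℕ) * t ^ (2 : ℕ) + (-4 : ℂ) * x ^ (3 : ℕ) + (-2 : ℂ) * x ^ (4 : ℕ) +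
        x ^ (4 : ℕ) * s ^ (2 : ℕ) + x ^ (4 : ℕ) * t ^ (2 : ℕ) + (-2 : ℂ) * x ^ (5 : ℕ) + x ^ (6 : ℕ) * s ^ (2 : ℕ) + x ^ (6 : ℕ) * t ^ (2 : ℕ)) * A +
        (x ^ (2 : ℕ) * s + -(x ^ (2 : ℕ) * t) + (2 : ℂ) * x ^ (3 : ℕ) * s + (-2 : ℂ) * x ^ (3 : ℕ) * t + x ^ (4 : ℕ) * s + -(x ^ (4 : ℕ) * t) +
        x ^ (5 : ℕ) * s + -(x ^ (5 : ℕ) * t) + x ^ (6 : ℕ) * s + -(x ^ (6 : ℕ) * t)) * B = 0) :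
    ((-3 : ℂ) * s + (6 : ℂ) * s ^ (3 : ℕ) + -(s ^ (5 : ℕ)) + (3 : ℂ) * t + (-6 : ℂ) * t ^ (3 : ℕ) + t ^ (5 : ℕ)) * A + ((-2 : ℂ) +
        (5 : ℂ) * s ^ (2 : ℕ) + (-3 : ℂ) * s ^ (4 : ℕ) + (5 : ℂ) * t ^ (2 : ℕ) + (-3 : ℂ) * t ^ (4 : ℕ)) * B = 0 ∧
    ((2 : ℂ) + (-5 : ℂ) * s ^ (2 : ℕ) + (3 : ℂ) * s ^ (4 : ℕ) + (-5 : ℂ) * t ^ (2 : ℕ) + (3 : ℂ) * t ^ (4 : ℕ)) * A + ((-3 : ℂ) * s +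
        (6 : ℂ) * s ^ (3 : ℕ) + -(s ^ (5 : ℕ)) + (3 : ℂ) * t + (-6 : ℂ) * t ^ (3 : ℕ) + t ^ (5 : ℕ)) * B = 0 := by
  constructor
  · linear_combination ((141 : ℂ) + (-90 : ℂ) * s ^ (2 : ℕ) + (21 : ℂ) * s ^ (4 : ℕ) + -(s ^ (6 : ℕ)) + (-90 : ℂ) * t ^ (2 : ℕ) +
      (21 : ℂ) * t ^ (4 : ℕ) + -(t ^ (6 : ℕ))) * hTre - ((126 : ℂ) * s + (-50 : ℂ) * s ^ (3 : ℕ) + (6 : ℂ) * s ^ (5 : ℕ) + (-126 : ℂ) * t +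
      (50 : ℂ) * t ^ (3 : ℕ) + (-6 : ℂ) * t ^ (5 : ℕ)) * hTim - ((-123 : ℂ) * s + (44 : ℂ) * s ^ (3 : ℕ) + (-5 : ℂ) * s ^ (5 : ℕ) + (123 : ℂ) * t +
      (-44 : ℂ) * t ^ (3 : ℕ) + (5 : ℂ) * t ^ (5 : ℕ) + (-347 : ℂ) * x * s + (147 : ℂ) * x * s ^ (3 : ℕ) + (-24 : ℂ) * x * s ^ (5 : ℕ) +
      x * s ^ (7 : ℕ) + (347 : ℂ) * x * t + (-147 : ℂ) * x * t ^ (3 : ℕ) + (24 : ℂ) * x * t ^ (5 : ℕ) + -(x * t ^ (7 : ℕ)) +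
      (-451 : ℂ) * x ^ (2 : ℕ) * s + (173 : ℂ) * x ^ (2 : ℕ) * s ^ (3 : ℕ) + (-19 : ℂ) * x ^ (2 : ℕ) * s ^ (5 : ℕ) + (451 : ℂ) * x ^ (2 : ℕ) * t +
      (-173 : ℂ) * x ^ (2 : ℕ) * t ^ (3 : ℕ) + (19 : ℂ) * x ^ (2 : ℕ) * t ^ (5 : ℕ) + (-309 : ℂ) * x ^ (3 : ℕ) * s +
      (139 : ℂ) * x ^ (3 : ℕ) * s ^ (3 : ℕ) + (-24 : ℂ) * x ^ (3 : ℕ) * s ^ (5 : ℕ) + x ^ (3 : ℕ) * s ^ (7 : ℕ) + (309 : ℂ) * x ^ (3 : ℕ) * t +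
      (-139 : ℂ) * x ^ (3 : ℕ) * t ^ (3 : ℕ) + (24 : ℂ) * x ^ (3 : ℕ) * t ^ (5 : ℕ) + -(x ^ (3 : ℕ) * t ^ (7 : ℕ)) + (-220 : ℂ) * x ^ (4 : ℕ) * s +
      (92 : ℂ) * x ^ (4 : ℕ) * s ^ (3 : ℕ) + (-12 : ℂ) * x ^ (4 : ℕ) * s ^ (5 : ℕ) + (220 : ℂ) * x ^ (4 : ℕ) * t +
      (-92 : ℂ) * x ^ (4 : ℕ) * t ^ (3 : ℕ) + (12 : ℂ) * x ^ (4 : ℕ) * t ^ (5 : ℕ) + (-141 : ℂ) * x ^ (5 : ℕ) * s +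
      (81 : ℂ) * x ^ (5 : ℕ) * s ^ (3 : ℕ) + (-20 : ℂ) * x ^ (5 : ℕ) * s ^ (5 : ℕ) + x ^ (5 : ℕ) * s ^ (7 : ℕ) + (141 : ℂ) * x ^ (5 : ℕ) * t +
      (-81 : ℂ) * x ^ (5 : ℕ) * t ^ (3 : ℕ) + (20 : ℂ) * x ^ (5 : ℕ) * t ^ (5 : ℕ) + -(x ^ (5 : ℕ) * t ^ (7 : ℕ))) * hVre + ((139 : ℂ) +
      (-85 : ℂ) * s ^ (2 : ℕ) + (18 : ℂ) * s ^ (4 : ℕ) + -(s ^ (6 : ℕ)) + (-85 : ℂ) * t ^ (2 : ℕ) + (18 : ℂ) * t ^ (4 : ℕ) + -(t ^ (6 : ℕ)) +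
      (385 : ℂ) * x + (-252 : ℂ) * x * s ^ (2 : ℕ) + (67 : ℂ) * x * s ^ (4 : ℕ) + (-6 : ℂ) * x * s ^ (6 : ℕ) + (-252 : ℂ) * x * t ^ (2 : ℕ) +
      (67 : ℂ) * x * t ^ (4 : ℕ) + (-6 : ℂ) * x * t ^ (6 : ℕ) + (506 : ℂ) * x ^ (2 : ℕ) + (-318 : ℂ) * x ^ (2 : ℕ) * s ^ (2 : ℕ) +
      (70 : ℂ) * x ^ (2 : ℕ) * s ^ (4 : ℕ) + (-3 : ℂ) * x ^ (2 : ℕ) * s ^ (6 : ℕ) + (-318 : ℂ) * x ^ (2 : ℕ) * t ^ (2 : ℕ) +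
      (70 : ℂ) * x ^ (2 : ℕ) * t ^ (4 : ℕ) + (-3 : ℂ) * x ^ (2 : ℕ) * t ^ (6 : ℕ) + (340 : ℂ) * x ^ (3 : ℕ) + (-230 : ℂ) * x ^ (3 : ℕ) * s ^ (2 : ℕ) +
      (66 : ℂ) * x ^ (3 : ℕ) * s ^ (4 : ℕ) + (-6 : ℂ) * x ^ (3 : ℕ) * s ^ (6 : ℕ) + (-230 : ℂ) * x ^ (3 : ℕ) * t ^ (2 : ℕ) +
      (66 : ℂ) * x ^ (3 : ℕ) * t ^ (4 : ℕ) + (-6 : ℂ) * x ^ (3 : ℕ) * t ^ (6 : ℕ) + (244 : ℂ) * x ^ (4 : ℕ) + (-160 : ℂ) * x ^ (4 : ℕ) * s ^ (2 : ℕ) +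
      (40 : ℂ) * x ^ (4 : ℕ) * s ^ (4 : ℕ) + (-2 : ℂ) * x ^ (4 : ℕ) * s ^ (6 : ℕ) + (-160 : ℂ) * x ^ (4 : ℕ) * t ^ (2 : ℕ) +
      (40 : ℂ) * x ^ (4 : ℕ) * t ^ (4 : ℕ) + (-2 : ℂ) * x ^ (4 : ℕ) * t ^ (6 : ℕ) + (150 : ℂ) * x ^ (5 : ℕ) + (-116 : ℂ) * x ^ (5 : ℕ) * s ^ (2 : ℕ) +
      (46 : ℂ) * x ^ (5 : ℕ) * s ^ (4 : ℕ) + (-6 : ℂ) * x ^ (5 : ℕ) * s ^ (6 : ℕ) + (-116 : ℂ) * x ^ (5 : ℕ) * t ^ (2 : ℕ) +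
      (46 : ℂ) * x ^ (5 : ℕ) * t ^ (4 : ℕ) + (-6 : ℂ) * x ^ (5 : ℕ) * t ^ (6 : ℕ)) * hVim + (((85 : ℂ) * x * s + (-18 : ℂ) * x * s ^ (3 : ℕ) +
      x * s ^ (5 : ℕ) + (-85 : ℂ) * x * t + (18 : ℂ) * x * t ^ (3 : ℕ) + -(x * t ^ (5 : ℕ)) + (-14 : ℂ) * x ^ (2 : ℕ) * s +
      (-40 : ℂ) * x ^ (2 : ℕ) * s ^ (3 : ℕ) + (5 : ℂ) * x ^ (2 : ℕ) * s ^ (5 : ℕ) + (14 : ℂ) * x ^ (2 : ℕ) * t +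
      (-50 : ℂ) * x ^ (2 : ℕ) * t * s ^ (2 : ℕ) + (6 : ℂ) * x ^ (2 : ℕ) * t * s ^ (4 : ℕ) + (50 : ℂ) * x ^ (2 : ℕ) * t ^ (2 : ℕ) * s +
      (40 : ℂ) * x ^ (2 : ℕ) * t ^ (3 : ℕ) + (-6 : ℂ) * x ^ (2 : ℕ) * t ^ (4 : ℕ) * s + (-5 : ℂ) * x ^ (2 : ℕ) * t ^ (5 : ℕ) +
      (138 : ℂ) * x ^ (3 : ℕ) * s + (-28 : ℂ) * x ^ (3 : ℕ) * s ^ (3 : ℕ) + x ^ (3 : ℕ) * s ^ (5 : ℕ) + (-138 : ℂ) * x ^ (3 : ℕ) * t +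
      (28 : ℂ) * x ^ (3 : ℕ) * t ^ (3 : ℕ) + -(x ^ (3 : ℕ) * t ^ (5 : ℕ)) + (-36 : ℂ) * x ^ (4 : ℕ) * s + (-39 : ℂ) * x ^ (4 : ℕ) * s ^ (3 : ℕ) +
      (5 : ℂ) * x ^ (4 : ℕ) * s ^ (5 : ℕ) + (36 : ℂ) * x ^ (4 : ℕ) * t + (-50 : ℂ) * x ^ (4 : ℕ) * t * s ^ (2 : ℕ) +
      (6 : ℂ) * x ^ (4 : ℕ) * t * s ^ (4 : ℕ) + (50 : ℂ) * x ^ (4 : ℕ) * t ^ (2 : ℕ) * s + (39 : ℂ) * x ^ (4 : ℕ) * t ^ (3 : ℕ) +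
      (-6 : ℂ) * x ^ (4 : ℕ) * t ^ (4 : ℕ) * s + (-5 : ℂ) * x ^ (4 : ℕ) * t ^ (5 : ℕ) + (70 : ℂ) * x ^ (5 : ℕ) * s +
      (-19 : ℂ) * x ^ (5 : ℕ) * s ^ (3 : ℕ) + x ^ (5 : ℕ) * s ^ (5 : ℕ) + (-70 : ℂ) * x ^ (5 : ℕ) * t + (19 : ℂ) * x ^ (5 : ℕ) * t ^ (3 : ℕ) +
      -(x ^ (5 : ℕ) * t ^ (5 : ℕ)) + (-150 : ℂ) * x ^ (6 : ℕ) * s + (-19 : ℂ) * x ^ (6 : ℕ) * s ^ (3 : ℕ) + (5 : ℂ) * x ^ (6 : ℕ) * s ^ (5 : ℕ) +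
      (150 : ℂ) * x ^ (6 : ℕ) * t + (-50 : ℂ) * x ^ (6 : ℕ) * t * s ^ (2 : ℕ) + (6 : ℂ) * x ^ (6 : ℕ) * t * s ^ (4 : ℕ) +
      (50 : ℂ) * x ^ (6 : ℕ) * t ^ (2 : ℕ) * s + (19 : ℂ) * x ^ (6 : ℕ) * t ^ (3 : ℕ) + (-6 : ℂ) * x ^ (6 : ℕ) * t ^ (4 : ℕ) * s +
      (-5 : ℂ) * x ^ (6 : ℕ) * t ^ (5 : ℕ)) * A + ((246 : ℂ) * x + (-44 : ℂ) * x * s ^ (2 : ℕ) + (5 : ℂ) * x * s ^ (4 : ℕ) +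
      (-44 : ℂ) * x * t ^ (2 : ℕ) + (5 : ℂ) * x * t ^ (4 : ℕ) + (262 : ℂ) * x ^ (2 : ℕ) + (-76 : ℂ) * x ^ (2 : ℕ) * s ^ (2 : ℕ) +
      (17 : ℂ) * x ^ (2 : ℕ) * s ^ (4 : ℕ) + -(x ^ (2 : ℕ) * s ^ (6 : ℕ)) + (-180 : ℂ) * x ^ (2 : ℕ) * t * s +
      (21 : ℂ) * x ^ (2 : ℕ) * t * s ^ (3 : ℕ) + -(x ^ (2 : ℕ) * t * s ^ (5 : ℕ)) + (-76 : ℂ) * x ^ (2 : ℕ) * t ^ (2 : ℕ) +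
      (21 : ℂ) * x ^ (2 : ℕ) * t ^ (3 : ℕ) * s + (17 : ℂ) * x ^ (2 : ℕ) * t ^ (4 : ℕ) + -(x ^ (2 : ℕ) * t ^ (5 : ℕ) * s) +
      -(x ^ (2 : ℕ) * t ^ (6 : ℕ)) + (398 : ℂ) * x ^ (3 : ℕ) + (-73 : ℂ) * x ^ (3 : ℕ) * s ^ (2 : ℕ) + (7 : ℂ) * x ^ (3 : ℕ) * s ^ (4 : ℕ) +
      (-73 : ℂ) * x ^ (3 : ℕ) * t ^ (2 : ℕ) + (7 : ℂ) * x ^ (3 : ℕ) * t ^ (4 : ℕ) + (186 : ℂ) * x ^ (4 : ℕ) + (-68 : ℂ) * x ^ (4 : ℕ) * s ^ (2 : ℕ) +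
      (17 : ℂ) * x ^ (4 : ℕ) * s ^ (4 : ℕ) + -(x ^ (4 : ℕ) * s ^ (6 : ℕ)) + (-180 : ℂ) * x ^ (4 : ℕ) * t * s +
      (21 : ℂ) * x ^ (4 : ℕ) * t * s ^ (3 : ℕ) + -(x ^ (4 : ℕ) * t * s ^ (5 : ℕ)) + (-68 : ℂ) * x ^ (4 : ℕ) * t ^ (2 : ℕ) +
      (21 : ℂ) * x ^ (4 : ℕ) * t ^ (3 : ℕ) * s + (17 : ℂ) * x ^ (4 : ℕ) * t ^ (4 : ℕ) + -(x ^ (4 : ℕ) * t ^ (5 : ℕ) * s) +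
      -(x ^ (4 : ℕ) * t ^ (6 : ℕ)) + (188 : ℂ) * x ^ (5 : ℕ) + (-42 : ℂ) * x ^ (5 : ℕ) * s ^ (2 : ℕ) + (6 : ℂ) * x ^ (5 : ℕ) * s ^ (4 : ℕ) +
      (-42 : ℂ) * x ^ (5 : ℕ) * t ^ (2 : ℕ) + (6 : ℂ) * x ^ (5 : ℕ) * t ^ (4 : ℕ) + (-150 : ℂ) * x ^ (6 : ℕ) + (-10 : ℂ) * x ^ (6 : ℕ) * s ^ (2 : ℕ) +
      (13 : ℂ) * x ^ (6 : ℕ) * s ^ (4 : ℕ) + -(x ^ (6 : ℕ) * s ^ (6 : ℕ)) + (-180 : ℂ) * x ^ (6 : ℕ) * t * s +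
      (21 : ℂ) * x ^ (6 : ℕ) * t * s ^ (3 : ℕ) + -(x ^ (6 : ℕ) * t * s ^ (5 : ℕ)) + (-10 : ℂ) * x ^ (6 : ℕ) * t ^ (2 : ℕ) +
      (21 : ℂ) * x ^ (6 : ℕ) * t ^ (3 : ℕ) * s + (13 : ℂ) * x ^ (6 : ℕ) * t ^ (4 : ℕ) + -(x ^ (6 : ℕ) * t ^ (5 : ℕ) * s) +
      -(x ^ (6 : ℕ) * t ^ (6 : ℕ))) * B) * hs
  · linear_combination ((126 : ℂ) * s + (-50 : ℂ) * s ^ (3 : ℕ) + (6 : ℂ) * s ^ (5 : ℕ) + (-126 : ℂ) * t + (50 : ℂ) * t ^ (3 : ℕ) +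
      (-6 : ℂ) * t ^ (5 : ℕ)) * hTre + ((141 : ℂ) + (-90 : ℂ) * s ^ (2 : ℕ) + (21 : ℂ) * s ^ (4 : ℕ) + -(s ^ (6 : ℕ)) + (-90 : ℂ) * t ^ (2 : ℕ) +
      (21 : ℂ) * t ^ (4 : ℕ) + -(t ^ (6 : ℕ))) * hTim - ((139 : ℂ) + (-85 : ℂ) * s ^ (2 : ℕ) + (18 : ℂ) * s ^ (4 : ℕ) + -(s ^ (6 : ℕ)) +
      (-85 : ℂ) * t ^ (2 : ℕ) + (18 : ℂ) * t ^ (4 : ℕ) + -(t ^ (6 : ℕ)) + (385 : ℂ) * x + (-252 : ℂ) * x * s ^ (2 : ℕ) + (67 : ℂ) * x * s ^ (4 : ℕ) +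
      (-6 : ℂ) * x * s ^ (6 : ℕ) + (-252 : ℂ) * x * t ^ (2 : ℕ) + (67 : ℂ) * x * t ^ (4 : ℕ) + (-6 : ℂ) * x * t ^ (6 : ℕ) + (506 : ℂ) * x ^ (2 : ℕ) +
      (-318 : ℂ) * x ^ (2 : ℕ) * s ^ (2 : ℕ) + (70 : ℂ) * x ^ (2 : ℕ) * s ^ (4 : ℕ) + (-3 : ℂ) * x ^ (2 : ℕ) * s ^ (6 : ℕ) +
      (-318 : ℂ) * x ^ (2 : ℕ) * t ^ (2 : ℕ) + (70 : ℂ) * x ^ (2 : ℕ) * t ^ (4 : ℕ) + (-3 : ℂ) * x ^ (2 : ℕ) * t ^ (6 : ℕ) + (340 : ℂ) * x ^ (3 : ℕ) +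
      (-230 : ℂ) * x ^ (3 : ℕ) * s ^ (2 : ℕ) + (66 : ℂ) * x ^ (3 : ℕ) * s ^ (4 : ℕ) + (-6 : ℂ) * x ^ (3 : ℕ) * s ^ (6 : ℕ) +
      (-230 : ℂ) * x ^ (3 : ℕ) * t ^ (2 : ℕ) + (66 : ℂ) * x ^ (3 : ℕ) * t ^ (4 : ℕ) + (-6 : ℂ) * x ^ (3 : ℕ) * t ^ (6 : ℕ) + (244 : ℂ) * x ^ (4 : ℕ) +
      (-160 : ℂ) * x ^ (4 : ℕ) * s ^ (2 : ℕ) + (40 : ℂ) * x ^ (4 : ℕ) * s ^ (4 : ℕ) + (-2 : ℂ) * x ^ (4 : ℕ) * s ^ (6 : ℕ) +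
      (-160 : ℂ) * x ^ (4 : ℕ) * t ^ (2 : ℕ) + (40 : ℂ) * x ^ (4 : ℕ) * t ^ (4 : ℕ) + (-2 : ℂ) * x ^ (4 : ℕ) * t ^ (6 : ℕ) + (150 : ℂ) * x ^ (5 : ℕ) +
      (-116 : ℂ) * x ^ (5 : ℕ) * s ^ (2 : ℕ) + (46 : ℂ) * x ^ (5 : ℕ) * s ^ (4 : ℕ) + (-6 : ℂ) * x ^ (5 : ℕ) * s ^ (6 : ℕ) +
      (-116 : ℂ) * x ^ (5 : ℕ) * t ^ (2 : ℕ) + (46 : ℂ) * x ^ (5 : ℕ) * t ^ (4 : ℕ) + (-6 : ℂ) * x ^ (5 : ℕ) * t ^ (6 : ℕ)) * hVre - ((-123 : ℂ) * s +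
      (44 : ℂ) * s ^ (3 : ℕ) + (-5 : ℂ) * s ^ (5 : ℕ) + (123 : ℂ) * t + (-44 : ℂ) * t ^ (3 : ℕ) + (5 : ℂ) * t ^ (5 : ℕ) + (-347 : ℂ) * x * s +
      (147 : ℂ) * x * s ^ (3 : ℕ) + (-24 : ℂ) * x * s ^ (5 : ℕ) + x * s ^ (7 : ℕ) + (347 : ℂ) * x * t + (-147 : ℂ) * x * t ^ (3 : ℕ) +
      (24 : ℂ) * x * t ^ (5 : ℕ) + -(x * t ^ (7 : ℕ)) + (-451 : ℂ) * x ^ (2 : ℕ) * s + (173 : ℂ) * x ^ (2 : ℕ) * s ^ (3 : ℕ) +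
      (-19 : ℂ) * x ^ (2 : ℕ) * s ^ (5 : ℕ) + (451 : ℂ) * x ^ (2 : ℕ) * t + (-173 : ℂ) * x ^ (2 : ℕ) * t ^ (3 : ℕ) +
      (19 : ℂ) * x ^ (2 : ℕ) * t ^ (5 : ℕ) + (-309 : ℂ) * x ^ (3 : ℕ) * s + (139 : ℂ) * x ^ (3 : ℕ) * s ^ (3 : ℕ) +
      (-24 : ℂ) * x ^ (3 : ℕ) * s ^ (5 : ℕ) + x ^ (3 : ℕ) * s ^ (7 : ℕ) + (309 : ℂ) * x ^ (3 : ℕ) * t + (-139 : ℂ) * x ^ (3 : ℕ) * t ^ (3 : ℕ) +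
      (24 : ℂ) * x ^ (3 : ℕ) * t ^ (5 : ℕ) + -(x ^ (3 : ℕ) * t ^ (7 : ℕ)) + (-220 : ℂ) * x ^ (4 : ℕ) * s + (92 : ℂ) * x ^ (4 : ℕ) * s ^ (3 : ℕ) +
      (-12 : ℂ) * x ^ (4 : ℕ) * s ^ (5 : ℕ) + (220 : ℂ) * x ^ (4 : ℕ) * t + (-92 : ℂ) * x ^ (4 : ℕ) * t ^ (3 : ℕ) +
      (12 : ℂ) * x ^ (4 : ℕ) * t ^ (5 : ℕ) + (-141 : ℂ) * x ^ (5 : ℕ) * s + (81 : ℂ) * x ^ (5 : ℕ) * s ^ (3 : ℕ) +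
      (-20 : ℂ) * x ^ (5 : ℕ) * s ^ (5 : ℕ) + x ^ (5 : ℕ) * s ^ (7 : ℕ) + (141 : ℂ) * x ^ (5 : ℕ) * t + (-81 : ℂ) * x ^ (5 : ℕ) * t ^ (3 : ℕ) +
      (20 : ℂ) * x ^ (5 : ℕ) * t ^ (5 : ℕ) + -(x ^ (5 : ℕ) * t ^ (7 : ℕ))) * hVim + (((-246 : ℂ) * x + (44 : ℂ) * x * s ^ (2 : ℕ) +
      (-5 : ℂ) * x * s ^ (4 : ℕ) + (44 : ℂ) * x * t ^ (2 : ℕ) + (-5 : ℂ) * x * t ^ (4 : ℕ) + (-262 : ℂ) * x ^ (2 : ℕ) +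
      (76 : ℂ) * x ^ (2 : ℕ) * s ^ (2 : ℕ) + (-17 : ℂ) * x ^ (2 : ℕ) * s ^ (4 : ℕ) + x ^ (2 : ℕ) * s ^ (6 : ℕ) + (180 : ℂ) * x ^ (2 : ℕ) * t * s +
      (-21 : ℂ) * x ^ (2 : ℕ) * t * s ^ (3 : ℕ) + x ^ (2 : ℕ) * t * s ^ (5 : ℕ) + (76 : ℂ) * x ^ (2 : ℕ) * t ^ (2 : ℕ) +
      (-21 : ℂ) * x ^ (2 : ℕ) * t ^ (3 : ℕ) * s + (-17 : ℂ) * x ^ (2 : ℕ) * t ^ (4 : ℕ) + x ^ (2 : ℕ) * t ^ (5 : ℕ) * s + x ^ (2 : ℕ) * t ^ (6 : ℕ) +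
      (-398 : ℂ) * x ^ (3 : ℕ) + (73 : ℂ) * x ^ (3 : ℕ) * s ^ (2 : ℕ) + (-7 : ℂ) * x ^ (3 : ℕ) * s ^ (4 : ℕ) + (73 : ℂ) * x ^ (3 : ℕ) * t ^ (2 : ℕ) +
      (-7 : ℂ) * x ^ (3 : ℕ) * t ^ (4 : ℕ) + (-186 : ℂ) * x ^ (4 : ℕ) + (68 : ℂ) * x ^ (4 : ℕ) * s ^ (2 : ℕ) + (-17 : ℂ) * x ^ (4 : ℕ) * s ^ (4 : ℕ) +
      x ^ (4 : ℕ) * s ^ (6 : ℕ) + (180 : ℂ) * x ^ (4 : ℕ) * t * s + (-21 : ℂ) * x ^ (4 : ℕ) * t * s ^ (3 : ℕ) + x ^ (4 : ℕ) * t * s ^ (5 : ℕ) +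
      (68 : ℂ) * x ^ (4 : ℕ) * t ^ (2 : ℕ) + (-21 : ℂ) * x ^ (4 : ℕ) * t ^ (3 : ℕ) * s + (-17 : ℂ) * x ^ (4 : ℕ) * t ^ (4 : ℕ) +
      x ^ (4 : ℕ) * t ^ (5 : ℕ) * s + x ^ (4 : ℕ) * t ^ (6 : ℕ) + (-188 : ℂ) * x ^ (5 : ℕ) + (42 : ℂ) * x ^ (5 : ℕ) * s ^ (2 : ℕ) +
      (-6 : ℂ) * x ^ (5 : ℕ) * s ^ (4 : ℕ) + (42 : ℂ) * x ^ (5 : ℕ) * t ^ (2 : ℕ) + (-6 : ℂ) * x ^ (5 : ℕ) * t ^ (4 : ℕ) + (150 : ℂ) * x ^ (6 : ℕ) +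
      (10 : ℂ) * x ^ (6 : ℕ) * s ^ (2 : ℕ) + (-13 : ℂ) * x ^ (6 : ℕ) * s ^ (4 : ℕ) + x ^ (6 : ℕ) * s ^ (6 : ℕ) + (180 : ℂ) * x ^ (6 : ℕ) * t * s +
      (-21 : ℂ) * x ^ (6 : ℕ) * t * s ^ (3 : ℕ) + x ^ (6 : ℕ) * t * s ^ (5 : ℕ) + (10 : ℂ) * x ^ (6 : ℕ) * t ^ (2 : ℕ) +
      (-21 : ℂ) * x ^ (6 : ℕ) * t ^ (3 : ℕ) * s + (-13 : ℂ) * x ^ (6 : ℕ) * t ^ (4 : ℕ) + x ^ (6 : ℕ) * t ^ (5 : ℕ) * s +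
      x ^ (6 : ℕ) * t ^ (6 : ℕ)) * A + ((85 : ℂ) * x * s + (-18 : ℂ) * x * s ^ (3 : ℕ) + x * s ^ (5 : ℕ) + (-85 : ℂ) * x * t +
      (18 : ℂ) * x * t ^ (3 : ℕ) + -(x * t ^ (5 : ℕ)) + (-14 : ℂ) * x ^ (2 : ℕ) * s + (-40 : ℂ) * x ^ (2 : ℕ) * s ^ (3 : ℕ) +
      (5 : ℂ) * x ^ (2 : ℕ) * s ^ (5 : ℕ) + (14 : ℂ) * x ^ (2 : ℕ) * t + (-50 : ℂ) * x ^ (2 : ℕ) * t * s ^ (2 : ℕ) +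
      (6 : ℂ) * x ^ (2 : ℕ) * t * s ^ (4 : ℕ) + (50 : ℂ) * x ^ (2 : ℕ) * t ^ (2 : ℕ) * s + (40 : ℂ) * x ^ (2 : ℕ) * t ^ (3 : ℕ) +
      (-6 : ℂ) * x ^ (2 : ℕ) * t ^ (4 : ℕ) * s + (-5 : ℂ) * x ^ (2 : ℕ) * t ^ (5 : ℕ) + (138 : ℂ) * x ^ (3 : ℕ) * s +
      (-28 : ℂ) * x ^ (3 : ℕ) * s ^ (3 : ℕ) + x ^ (3 : ℕ) * s ^ (5 : ℕ) + (-138 : ℂ) * x ^ (3 : ℕ) * t + (28 : ℂ) * x ^ (3 : ℕ) * t ^ (3 : ℕ) +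
      -(x ^ (3 : ℕ) * t ^ (5 : ℕ)) + (-36 : ℂ) * x ^ (4 : ℕ) * s + (-39 : ℂ) * x ^ (4 : ℕ) * s ^ (3 : ℕ) + (5 : ℂ) * x ^ (4 : ℕ) * s ^ (5 : ℕ) +
      (36 : ℂ) * x ^ (4 : ℕ) * t + (-50 : ℂ) * x ^ (4 : ℕ) * t * s ^ (2 : ℕ) + (6 : ℂ) * x ^ (4 : ℕ) * t * s ^ (4 : ℕ) +
      (50 : ℂ) * x ^ (4 : ℕ) * t ^ (2 : ℕ) * s + (39 : ℂ) * x ^ (4 : ℕ) * t ^ (3 : ℕ) + (-6 : ℂ) * x ^ (4 : ℕ) * t ^ (4 : ℕ) * s +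
      (-5 : ℂ) * x ^ (4 : ℕ) * t ^ (5 : ℕ) + (70 : ℂ) * x ^ (5 : ℕ) * s + (-19 : ℂ) * x ^ (5 : ℕ) * s ^ (3 : ℕ) + x ^ (5 : ℕ) * s ^ (5 : ℕ) +
      (-70 : ℂ) * x ^ (5 : ℕ) * t + (19 : ℂ) * x ^ (5 : ℕ) * t ^ (3 : ℕ) + -(x ^ (5 : ℕ) * t ^ (5 : ℕ)) + (-150 : ℂ) * x ^ (6 : ℕ) * s +
      (-19 : ℂ) * x ^ (6 : ℕ) * s ^ (3 : ℕ) + (5 : ℂ) * x ^ (6 : ℕ) * s ^ (5 : ℕ) + (150 : ℂ) * x ^ (6 : ℕ) * t +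
      (-50 : ℂ) * x ^ (6 : ℕ) * t * s ^ (2 : ℕ) + (6 : ℂ) * x ^ (6 : ℕ) * t * s ^ (4 : ℕ) + (50 : ℂ) * x ^ (6 : ℕ) * t ^ (2 : ℕ) * s +
      (19 : ℂ) * x ^ (6 : ℕ) * t ^ (3 : ℕ) + (-6 : ℂ) * x ^ (6 : ℕ) * t ^ (4 : ℕ) * s + (-5 : ℂ) * x ^ (6 : ℕ) * t ^ (5 : ℕ)) * B) * hs

/-- Bézout step, characters `ω = ±i` in real form: the two `x`-free Gaussian polynomials are coprime (exact certificate). [folklore] -/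
private theorem bezouti {t s A B : ℂ} (hs : t * s = 1)
    (hQre : (s ^ (2 : ℕ)) * A + (t ^ (3 : ℕ)) * B = 0)
    (hQim : (-(t ^ (3 : ℕ))) * A + (s ^ (2 : ℕ)) * B = 0)
    (hRre : ((-3 : ℂ) * s + (6 : ℂ) * s ^ (3 : ℕ) + -(s ^ (5 : ℕ)) + (3 : ℂ) * t + (-6 : ℂ) * t ^ (3 : ℕ) + t ^ (5 : ℕ)) * A + ((-2 : ℂ) +
        (5 : ℂ) * s ^ (2 : ℕ) + (-3 : ℂ) * s ^ (4 : ℕ) + (5 : ℂ) * t ^ (2 : ℕ) + (-3 : ℂ) * t ^ (4 : ℕ)) * B = 0)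
    (hRim : ((2 : ℂ) + (-5 : ℂ) * s ^ (2 : ℕ) + (3 : ℂ) * s ^ (4 : ℕ) + (-5 : ℂ) * t ^ (2 : ℕ) + (3 : ℂ) * t ^ (4 : ℕ)) * A + ((-3 : ℂ) * s +
        (6 : ℂ) * s ^ (3 : ℕ) + -(s ^ (5 : ℕ)) + (3 : ℂ) * t + (-6 : ℂ) * t ^ (3 : ℕ) + t ^ (5 : ℕ)) * B = 0) : A = 0 ∧ B = 0 := by
  constructor
  · linear_combination (((1 : ℂ) / 2) * t ^ (2 : ℕ) + (5 : ℂ) * t ^ (4 : ℕ) + (-5 : ℂ) * t ^ (6 : ℕ) + ((-7 : ℂ) / 2) * t ^ (8 : ℕ) +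
      (2 : ℂ) * t ^ (10 : ℕ)) * hQre - ((2 : ℂ) * t ^ (3 : ℕ) + ((-13 : ℂ) / 2) * t ^ (5 : ℕ) + t ^ (7 : ℕ) + (4 : ℂ) * t ^ (9 : ℕ) +
      ((-1 : ℂ) / 2) * t ^ (11 : ℕ)) * hQim + (((-1 : ℂ) / 2) * t ^ (5 : ℕ) + ((1 : ℂ) / 2) * t ^ (7 : ℕ) +
      ((1 : ℂ) / 2) * t ^ (9 : ℕ)) * hRre - (((1 : ℂ) / 2) * t ^ (6 : ℕ) + ((1 : ℂ) / 2) * t ^ (8 : ℕ)) * hRim + (((-1 : ℂ) + -(t * s) +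
      ((-1 : ℂ) / 2) * t ^ (2 : ℕ) * s ^ (2 : ℕ) + ((-1 : ℂ) / 2) * t ^ (3 : ℕ) * s ^ (3 : ℕ) + (5 : ℂ) * t ^ (4 : ℕ) * s ^ (2 : ℕ) +
      ((-1 : ℂ) / 2) * t ^ (4 : ℕ) * s ^ (4 : ℕ) + ((3 : ℂ) / 2) * t ^ (5 : ℕ) * s + (2 : ℂ) * t ^ (5 : ℕ) * s ^ (3 : ℕ) +
      ((-1 : ℂ) / 2) * t ^ (6 : ℕ) + -(t ^ (6 : ℕ) * s ^ (2 : ℕ)) + ((1 : ℂ) / 2) * t ^ (6 : ℕ) * s ^ (4 : ℕ) + (-2 : ℂ) * t ^ (7 : ℕ) * s +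
      (2 : ℂ) * t ^ (7 : ℕ) * s ^ (3 : ℕ) + ((-1 : ℂ) / 2) * t ^ (8 : ℕ) + (-3 : ℂ) * t ^ (8 : ℕ) * s ^ (2 : ℕ) +
      ((1 : ℂ) / 2) * t ^ (8 : ℕ) * s ^ (4 : ℕ) + (-2 : ℂ) * t ^ (9 : ℕ) * s) * A + ((-2 : ℂ) * t ^ (3 : ℕ) * s ^ (2 : ℕ) +
      (-2 : ℂ) * t ^ (4 : ℕ) * s ^ (3 : ℕ) + ((3 : ℂ) / 2) * t ^ (5 : ℕ) + (4 : ℂ) * t ^ (5 : ℕ) * s ^ (2 : ℕ) +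
      ((-1 : ℂ) / 2) * t ^ (5 : ℕ) * s ^ (4 : ℕ) + (3 : ℂ) * t ^ (6 : ℕ) * s + t ^ (6 : ℕ) * s ^ (3 : ℕ) + ((9 : ℂ) / 2) * t ^ (7 : ℕ) * s ^ (2 : ℕ) +
      ((-1 : ℂ) / 2) * t ^ (7 : ℕ) * s ^ (4 : ℕ) + ((3 : ℂ) / 2) * t ^ (8 : ℕ) * s + ((3 : ℂ) / 2) * t ^ (8 : ℕ) * s ^ (3 : ℕ) +
      ((-1 : ℂ) / 2) * t ^ (9 : ℕ) + ((-1 : ℂ) / 2) * t ^ (10 : ℕ) * s) * B) * hs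
  · linear_combination ((2 : ℂ) * t ^ (3 : ℕ) + ((-13 : ℂ) / 2) * t ^ (5 : ℕ) + t ^ (7 : ℕ) + (4 : ℂ) * t ^ (9 : ℕ) +
      ((-1 : ℂ) / 2) * t ^ (11 : ℕ)) * hQre + (((1 : ℂ) / 2) * t ^ (2 : ℕ) + (5 : ℂ) * t ^ (4 : ℕ) + (-5 : ℂ) * t ^ (6 : ℕ) +
      ((-7 : ℂ) / 2) * t ^ (8 : ℕ) + (2 : ℂ) * t ^ (10 : ℕ)) * hQim + (((1 : ℂ) / 2) * t ^ (6 : ℕ) + ((1 : ℂ) / 2) * t ^ (8 : ℕ)) * hRre +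
      (((-1 : ℂ) / 2) * t ^ (5 : ℕ) + ((1 : ℂ) / 2) * t ^ (7 : ℕ) + ((1 : ℂ) / 2) * t ^ (9 : ℕ)) * hRim + (((2 : ℂ) * t ^ (3 : ℕ) * s ^ (2 : ℕ) +
      (2 : ℂ) * t ^ (4 : ℕ) * s ^ (3 : ℕ) + ((-3 : ℂ) / 2) * t ^ (5 : ℕ) + (-4 : ℂ) * t ^ (5 : ℕ) * s ^ (2 : ℕ) +
      ((1 : ℂ) / 2) * t ^ (5 : ℕ) * s ^ (4 : ℕ) + (-3 : ℂ) * t ^ (6 : ℕ) * s + -(t ^ (6 : ℕ) * s ^ (3 : ℕ)) +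
      ((-9 : ℂ) / 2) * t ^ (7 : ℕ) * s ^ (2 : ℕ) + ((1 : ℂ) / 2) * t ^ (7 : ℕ) * s ^ (4 : ℕ) + ((-3 : ℂ) / 2) * t ^ (8 : ℕ) * s +
      ((-3 : ℂ) / 2) * t ^ (8 : ℕ) * s ^ (3 : ℕ) + ((1 : ℂ) / 2) * t ^ (9 : ℕ) + ((1 : ℂ) / 2) * t ^ (10 : ℕ) * s) * A + ((-1 : ℂ) + -(t * s) +
      ((-1 : ℂ) / 2) * t ^ (2 : ℕ) * s ^ (2 : ℕ) + ((-1 : ℂ) / 2) * t ^ (3 : ℕ) * s ^ (3 : ℕ) + (5 : ℂ) * t ^ (4 : ℕ) * s ^ (2 : ℕ) +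
      ((-1 : ℂ) / 2) * t ^ (4 : ℕ) * s ^ (4 : ℕ) + ((3 : ℂ) / 2) * t ^ (5 : ℕ) * s + (2 : ℂ) * t ^ (5 : ℕ) * s ^ (3 : ℕ) +
      ((-1 : ℂ) / 2) * t ^ (6 : ℕ) + -(t ^ (6 : ℕ) * s ^ (2 : ℕ)) + ((1 : ℂ) / 2) * t ^ (6 : ℕ) * s ^ (4 : ℕ) + (-2 : ℂ) * t ^ (7 : ℕ) * s +
      (2 : ℂ) * t ^ (7 : ℕ) * s ^ (3 : ℕ) + ((-1 : ℂ) / 2) * t ^ (8 : ℕ) + (-3 : ℂ) * t ^ (8 : ℕ) * s ^ (2 : ℕ) +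
      ((1 : ℂ) / 2) * t ^ (8 : ℕ) * s ^ (4 : ℕ) + (-2 : ℂ) * t ^ (9 : ℕ) * s) * B) * hs

/-- Cancelling the root factor `x` in the `V0` row (`s = t⁻¹`). [folklore] -/
private theorem cancelV0 {x t s : ℂ} (hx : x ≠ 0) {d0 d1 d2 d3 : ℂ}
    (e : d0 * (x) + d1 * (x ^ (2 : ℕ) * s) + d2 * (x ^ (2 : ℕ)) + d3 * (x ^ (2 : ℕ) * t) = 0) :
    d0 * ((1 : ℂ)) + d1 * (x * s) + d2 * (x) + d3 * (x * t) = 0 := by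
  have h' : x * (d0 * ((1 : ℂ)) + d1 * (x * s) + d2 * (x) + d3 * (x * t)) = 0 := by
    linear_combination e
  exact (mul_eq_zero.1 h').resolve_left hx

/-- Cancelling the root factor `x` in the `V1` row (`s = t⁻¹`). [folklore] -/
private theorem cancelV1 {x t s : ℂ} (hx : x ≠ 0) {d0 d1 d2 d3 : ℂ}
    (e : d0 * (x ^ (2 : ℕ) * t) + d1 * (x) + d2 * (x ^ (2 : ℕ) * s) + d3 * (x ^ (2 : ℕ)) = 0) :
    d0 * (x * t) + d1 * ((1 : ℂ)) + d2 * (x * s) + d3 * (x) = 0 := by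
  have h' : x * (d0 * (x * t) + d1 * ((1 : ℂ)) + d2 * (x * s) + d3 * (x)) = 0 := by
    linear_combination e
  exact (mul_eq_zero.1 h').resolve_left hx

/-- Cancelling the root factor `x` in the `V2` row (`s = t⁻¹`). [folklore] -/
private theorem cancelV2 {x t s : ℂ} (hx : x ≠ 0) {d0 d1 d2 d3 : ℂ}
    (e : d0 * (x ^ (2 : ℕ)) + d1 * (x ^ (2 : ℕ) * t) + d2 * (x) + d3 * (x ^ (2 : ℕ) * s) = 0) :
    d0 * (x) + d1 * (x * t) + d2 * ((1 : ℂ)) + d3 * (x * s) = 0 := by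
  have h' : x * (d0 * (x) + d1 * (x * t) + d2 * ((1 : ℂ)) + d3 * (x * s)) = 0 := by
    linear_combination e
  exact (mul_eq_zero.1 h').resolve_left hx

/-- Cancelling the root factor `x` in the `V3` row (`s = t⁻¹`). [folklore] -/
private theorem cancelV3 {x t s : ℂ} (hx : x ≠ 0) {d0 d1 d2 d3 : ℂ}
    (e : d0 * (x ^ (2 : ℕ) * s) + d1 * (x ^ (2 : ℕ)) + d2 * (x ^ (2 : ℕ) * t) + d3 * (x) = 0) :
    d0 * (x * s) + d1 * (x) + d2 * (x * t) + d3 * ((1 : ℂ)) = 0 := by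
  have h' : x * (d0 * (x * s) + d1 * (x) + d2 * (x * t) + d3 * ((1 : ℂ))) = 0 := by
    linear_combination e
  exact (mul_eq_zero.1 h').resolve_left hx

/-- Cancelling the root factor `x` in the `Q0` row (`s = t⁻¹`). [folklore] -/
private theorem cancelQ0 {x t s : ℂ} (hx : x ≠ 0) {d0 d1 d2 d3 : ℂ}
    (e : d0 * (x ^ (3 : ℕ) + (2 : ℂ) * x ^ (4 : ℕ) + x ^ (5 : ℕ)) + d1 * (x ^ (3 : ℕ) * t + (2 : ℂ) * x ^ (4 : ℕ) * t + x ^ (5 : ℕ) * t) + d2 * (x +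
      x ^ (3 : ℕ) * t ^ (2 : ℕ) + x ^ (5 : ℕ) * t ^ (2 : ℕ)) + d3 * (x ^ (2 : ℕ) * s + x ^ (3 : ℕ) * s + x ^ (5 : ℕ) * s) = 0) :
    d0 * (x ^ (2 : ℕ) + (2 : ℂ) * x ^ (3 : ℕ) + x ^ (4 : ℕ)) + d1 * (x ^ (2 : ℕ) * t + (2 : ℂ) * x ^ (3 : ℕ) * t + x ^ (4 : ℕ) * t) + d2 * ((1 : ℂ) +
      x ^ (2 : ℕ) * t ^ (2 : ℕ) + x ^ (4 : ℕ) * t ^ (2 : ℕ)) + d3 * (x * s + x ^ (2 : ℕ) * s + x ^ (4 : ℕ) * s) = 0 := by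
  have h' : x * (d0 * (x ^ (2 : ℕ) + (2 : ℂ) * x ^ (3 : ℕ) + x ^ (4 : ℕ)) + d1 * (x ^ (2 : ℕ) * t + (2 : ℂ) * x ^ (3 : ℕ) * t + x ^ (4 : ℕ) * t) +
      d2 * ((1 : ℂ) +
      x ^ (2 : ℕ) * t ^ (2 : ℕ) + x ^ (4 : ℕ) * t ^ (2 : ℕ)) + d3 * (x * s + x ^ (2 : ℕ) * s + x ^ (4 : ℕ) * s)) = 0 := by
    linear_combination e
  exact (mul_eq_zero.1 h').resolve_left hx

/-- Cancelling the root factor `x` in the `Q1` row (`s = t⁻¹`). [folklore] -/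
private theorem cancelQ1 {x t s : ℂ} (hx : x ≠ 0) {d0 d1 d2 d3 : ℂ}
    (e : d0 * (x ^ (2 : ℕ) * s + x ^ (3 : ℕ) * s + x ^ (5 : ℕ) * s) + d1 * (x ^ (3 : ℕ) + (2 : ℂ) * x ^ (4 : ℕ) + x ^ (5 : ℕ)) +
        d2 * (x ^ (3 : ℕ) * t +
      (2 : ℂ) * x ^ (4 : ℕ) * t + x ^ (5 : ℕ) * t) + d3 * (x + x ^ (3 : ℕ) * t ^ (2 : ℕ) + x ^ (5 : ℕ) * t ^ (2 : ℕ)) = 0) :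
    d0 * (x * s + x ^ (2 : ℕ) * s + x ^ (4 : ℕ) * s) + d1 * (x ^ (2 : ℕ) + (2 : ℂ) * x ^ (3 : ℕ) + x ^ (4 : ℕ)) + d2 * (x ^ (2 : ℕ) * t +
      (2 : ℂ) * x ^ (3 : ℕ) * t + x ^ (4 : ℕ) * t) + d3 * ((1 : ℂ) + x ^ (2 : ℕ) * t ^ (2 : ℕ) + x ^ (4 : ℕ) * t ^ (2 : ℕ)) = 0 := by
  have h' : x * (d0 * (x * s + x ^ (2 : ℕ) * s + x ^ (4 : ℕ) * s) + d1 * (x ^ (2 : ℕ) + (2 : ℂ) * x ^ (3 : ℕ) + x ^ (4 : ℕ)) + d2 * (x ^ (2 : ℕ) * t +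
      (2 : ℂ) * x ^ (3 : ℕ) * t + x ^ (4 : ℕ) * t) + d3 * ((1 : ℂ) + x ^ (2 : ℕ) * t ^ (2 : ℕ) + x ^ (4 : ℕ) * t ^ (2 : ℕ))) = 0 := by
    linear_combination e
  exact (mul_eq_zero.1 h').resolve_left hx

/-- Cancelling the root factor `x` in the `Q2` row (`s = t⁻¹`). [folklore] -/
private theorem cancelQ2 {x t s : ℂ} (hx : x ≠ 0) {d0 d1 d2 d3 : ℂ}
    (e : d0 * (x + x ^ (3 : ℕ) * t ^ (2 : ℕ) + x ^ (5 : ℕ) * t ^ (2 : ℕ)) + d1 * (x ^ (2 : ℕ) * s + x ^ (3 : ℕ) * s + x ^ (5 : ℕ) * s) +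
        d2 * (x ^ (3 : ℕ) +
      (2 : ℂ) * x ^ (4 : ℕ) + x ^ (5 : ℕ)) + d3 * (x ^ (3 : ℕ) * t + (2 : ℂ) * x ^ (4 : ℕ) * t + x ^ (5 : ℕ) * t) = 0) :
    d0 * ((1 : ℂ) + x ^ (2 : ℕ) * t ^ (2 : ℕ) + x ^ (4 : ℕ) * t ^ (2 : ℕ)) + d1 * (x * s + x ^ (2 : ℕ) * s + x ^ (4 : ℕ) * s) + d2 * (x ^ (2 : ℕ) +
      (2 : ℂ) * x ^ (3 : ℕ) + x ^ (4 : ℕ)) + d3 * (x ^ (2 : ℕ) * t + (2 : ℂ) * x ^ (3 : ℕ) * t + x ^ (4 : ℕ) * t) = 0 := by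
  have h' : x * (d0 * ((1 : ℂ) + x ^ (2 : ℕ) * t ^ (2 : ℕ) + x ^ (4 : ℕ) * t ^ (2 : ℕ)) + d1 * (x * s + x ^ (2 : ℕ) * s + x ^ (4 : ℕ) * s) +
      d2 * (x ^ (2 : ℕ) +
      (2 : ℂ) * x ^ (3 : ℕ) + x ^ (4 : ℕ)) + d3 * (x ^ (2 : ℕ) * t + (2 : ℂ) * x ^ (3 : ℕ) * t + x ^ (4 : ℕ) * t)) = 0 := by
    linear_combination e
  exact (mul_eq_zero.1 h').resolve_left hx

/-- Cancelling the root factor `x` in the `Q3` row (`s = t⁻¹`). [folklore] -/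
private theorem cancelQ3 {x t s : ℂ} (hx : x ≠ 0) {d0 d1 d2 d3 : ℂ}
    (e : d0 * (x ^ (3 : ℕ) * t + (2 : ℂ) * x ^ (4 : ℕ) * t + x ^ (5 : ℕ) * t) + d1 * (x + x ^ (3 : ℕ) * t ^ (2 : ℕ) + x ^ (5 : ℕ) * t ^ (2 : ℕ)) +
      d2 * (x ^ (2 : ℕ) * s + x ^ (3 : ℕ) * s + x ^ (5 : ℕ) * s) + d3 * (x ^ (3 : ℕ) + (2 : ℂ) * x ^ (4 : ℕ) + x ^ (5 : ℕ)) = 0) :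
    d0 * (x ^ (2 : ℕ) * t + (2 : ℂ) * x ^ (3 : ℕ) * t + x ^ (4 : ℕ) * t) + d1 * ((1 : ℂ) + x ^ (2 : ℕ) * t ^ (2 : ℕ) + x ^ (4 : ℕ) * t ^ (2 : ℕ)) +
      d2 * (x * s + x ^ (2 : ℕ) * s + x ^ (4 : ℕ) * s) + d3 * (x ^ (2 : ℕ) + (2 : ℂ) * x ^ (3 : ℕ) + x ^ (4 : ℕ)) = 0 := by
  have h' : x * (d0 * (x ^ (2 : ℕ) * t + (2 : ℂ) * x ^ (3 : ℕ) * t + x ^ (4 : ℕ) * t) + d1 * ((1 : ℂ) + x ^ (2 : ℕ) * t ^ (2 : ℕ) +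
      x ^ (4 : ℕ) * t ^ (2 : ℕ)) +
      d2 * (x * s + x ^ (2 : ℕ) * s + x ^ (4 : ℕ) * s) + d3 * (x ^ (2 : ℕ) + (2 : ℂ) * x ^ (3 : ℕ) + x ^ (4 : ℕ))) = 0 := by
    linear_combination e
  exact (mul_eq_zero.1 h').resolve_left hx

/-- Cancelling the root factor `x` in the `R0` row (`s = t⁻¹`). [folklore] -/
private theorem cancelR0 {x t s : ℂ} (hx : x ≠ 0) {d0 d1 d2 d3 : ℂ}
    (e : d0 * (x ^ (3 : ℕ) * s + (2 : ℂ) * x ^ (4 : ℕ) * s + x ^ (5 : ℕ) * s + x ^ (6 : ℕ) * s + x ^ (7 : ℕ) * s) + d1 * (x ^ (3 : ℕ) +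
        (4 : ℂ) * x ^ (4 : ℕ) +
      (2 : ℂ) * x ^ (5 : ℕ) + (2 : ℂ) * x ^ (6 : ℕ)) + d2 * (x ^ (3 : ℕ) * t + (2 : ℂ) * x ^ (4 : ℕ) * t + x ^ (5 : ℕ) * t + x ^ (6 : ℕ) * t +
      x ^ (7 : ℕ) * t) + d3 * (x + x ^ (3 : ℕ) * s ^ (2 : ℕ) + x ^ (3 : ℕ) * t ^ (2 : ℕ) + x ^ (5 : ℕ) * s ^ (2 : ℕ) + x ^ (5 : ℕ) * t ^ (2 : ℕ) +
      x ^ (7 : ℕ) * s ^ (2 : ℕ) + x ^ (7 : ℕ) * t ^ (2 : ℕ)) = 0) :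
    d0 * (x ^ (2 : ℕ) * s + (2 : ℂ) * x ^ (3 : ℕ) * s + x ^ (4 : ℕ) * s + x ^ (5 : ℕ) * s + x ^ (6 : ℕ) * s) + d1 * (x ^ (2 : ℕ) +
        (4 : ℂ) * x ^ (3 : ℕ) +
      (2 : ℂ) * x ^ (4 : ℕ) + (2 : ℂ) * x ^ (5 : ℕ)) + d2 * (x ^ (2 : ℕ) * t + (2 : ℂ) * x ^ (3 : ℕ) * t + x ^ (4 : ℕ) * t + x ^ (5 : ℕ) * t +
      x ^ (6 : ℕ) * t) + d3 * ((1 : ℂ) + x ^ (2 : ℕ) * s ^ (2 : ℕ) + x ^ (2 : ℕ) * t ^ (2 : ℕ) + x ^ (4 : ℕ) * s ^ (2 : ℕ) +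
          x ^ (4 : ℕ) * t ^ (2 : ℕ) +
      x ^ (6 : ℕ) * s ^ (2 : ℕ) + x ^ (6 : ℕ) * t ^ (2 : ℕ)) = 0 := by
  have h' : x * (d0 * (x ^ (2 : ℕ) * s + (2 : ℂ) * x ^ (3 : ℕ) * s + x ^ (4 : ℕ) * s + x ^ (5 : ℕ) * s + x ^ (6 : ℕ) * s) + d1 * (x ^ (2 : ℕ) +
      (4 : ℂ) * x ^ (3 : ℕ) +
      (2 : ℂ) * x ^ (4 : ℕ) + (2 : ℂ) * x ^ (5 : ℕ)) + d2 * (x ^ (2 : ℕ) * t + (2 : ℂ) * x ^ (3 : ℕ) * t + x ^ (4 : ℕ) * t + x ^ (5 : ℕ) * t +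
      x ^ (6 : ℕ) * t) + d3 * ((1 : ℂ) + x ^ (2 : ℕ) * s ^ (2 : ℕ) + x ^ (2 : ℕ) * t ^ (2 : ℕ) + x ^ (4 : ℕ) * s ^ (2 : ℕ) +
          x ^ (4 : ℕ) * t ^ (2 : ℕ) +
      x ^ (6 : ℕ) * s ^ (2 : ℕ) + x ^ (6 : ℕ) * t ^ (2 : ℕ))) = 0 := by
    linear_combination e
  exact (mul_eq_zero.1 h').resolve_left hx

/-- Cancelling the root factor `x` in the `R1` row (`s = t⁻¹`). [folklore] -/
private theorem cancelR1 {x t s : ℂ} (hx : x ≠ 0) {d0 d1 d2 d3 : ℂ}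
    (e : d0 * (x + x ^ (3 : ℕ) * s ^ (2 : ℕ) + x ^ (3 : ℕ) * t ^ (2 : ℕ) + x ^ (5 : ℕ) * s ^ (2 : ℕ) + x ^ (5 : ℕ) * t ^ (2 : ℕ) +
        x ^ (7 : ℕ) * s ^ (2 : ℕ) +
      x ^ (7 : ℕ) * t ^ (2 : ℕ)) + d1 * (x ^ (3 : ℕ) * s + (2 : ℂ) * x ^ (4 : ℕ) * s + x ^ (5 : ℕ) * s + x ^ (6 : ℕ) * s + x ^ (7 : ℕ) * s) +
      d2 * (x ^ (3 : ℕ) + (4 : ℂ) * x ^ (4 : ℕ) + (2 : ℂ) * x ^ (5 : ℕ) + (2 : ℂ) * x ^ (6 : ℕ)) + d3 * (x ^ (3 : ℕ) * t + (2 : ℂ) * x ^ (4 : ℕ) * t +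
      x ^ (5 : ℕ) * t + x ^ (6 : ℕ) * t + x ^ (7 : ℕ) * t) = 0) :
    d0 * ((1 : ℂ) + x ^ (2 : ℕ) * s ^ (2 : ℕ) + x ^ (2 : ℕ) * t ^ (2 : ℕ) + x ^ (4 : ℕ) * s ^ (2 : ℕ) + x ^ (4 : ℕ) * t ^ (2 : ℕ) +
      x ^ (6 : ℕ) * s ^ (2 : ℕ) + x ^ (6 : ℕ) * t ^ (2 : ℕ)) + d1 * (x ^ (2 : ℕ) * s + (2 : ℂ) * x ^ (3 : ℕ) * s + x ^ (4 : ℕ) * s + x ^ (5 : ℕ) * s +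
      x ^ (6 : ℕ) * s) + d2 * (x ^ (2 : ℕ) + (4 : ℂ) * x ^ (3 : ℕ) + (2 : ℂ) * x ^ (4 : ℕ) + (2 : ℂ) * x ^ (5 : ℕ)) + d3 * (x ^ (2 : ℕ) * t +
      (2 : ℂ) * x ^ (3 : ℕ) * t + x ^ (4 : ℕ) * t + x ^ (5 : ℕ) * t + x ^ (6 : ℕ) * t) = 0 := by
  have h' : x * (d0 * ((1 : ℂ) + x ^ (2 : ℕ) * s ^ (2 : ℕ) + x ^ (2 : ℕ) * t ^ (2 : ℕ) + x ^ (4 : ℕ) * s ^ (2 : ℕ) + x ^ (4 : ℕ) * t ^ (2 : ℕ) +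
      x ^ (6 : ℕ) * s ^ (2 : ℕ) + x ^ (6 : ℕ) * t ^ (2 : ℕ)) + d1 * (x ^ (2 : ℕ) * s + (2 : ℂ) * x ^ (3 : ℕ) * s + x ^ (4 : ℕ) * s + x ^ (5 : ℕ) * s +
      x ^ (6 : ℕ) * s) + d2 * (x ^ (2 : ℕ) + (4 : ℂ) * x ^ (3 : ℕ) + (2 : ℂ) * x ^ (4 : ℕ) + (2 : ℂ) * x ^ (5 : ℕ)) + d3 * (x ^ (2 : ℕ) * t +
      (2 : ℂ) * x ^ (3 : ℕ) * t + x ^ (4 : ℕ) * t + x ^ (5 : ℕ) * t + x ^ (6 : ℕ) * t)) = 0 := by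
    linear_combination e
  exact (mul_eq_zero.1 h').resolve_left hx

/-- Cancelling the root factor `x` in the `R2` row (`s = t⁻¹`). [folklore] -/
private theorem cancelR2 {x t s : ℂ} (hx : x ≠ 0) {d0 d1 d2 d3 : ℂ}
    (e : d0 * (x ^ (3 : ℕ) * t + (2 : ℂ) * x ^ (4 : ℕ) * t + x ^ (5 : ℕ) * t + x ^ (6 : ℕ) * t + x ^ (7 : ℕ) * t) + d1 * (x +
        x ^ (3 : ℕ) * s ^ (2 : ℕ) +
      x ^ (3 : ℕ) * t ^ (2 : ℕ) + x ^ (5 : ℕ) * s ^ (2 : ℕ) + x ^ (5 : ℕ) * t ^ (2 : ℕ) + x ^ (7 : ℕ) * s ^ (2 : ℕ) + x ^ (7 : ℕ) * t ^ (2 : ℕ)) +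
      d2 * (x ^ (3 : ℕ) * s + (2 : ℂ) * x ^ (4 : ℕ) * s + x ^ (5 : ℕ) * s + x ^ (6 : ℕ) * s + x ^ (7 : ℕ) * s) + d3 * (x ^ (3 : ℕ) +
          (4 : ℂ) * x ^ (4 : ℕ) +
      (2 : ℂ) * x ^ (5 : ℕ) + (2 : ℂ) * x ^ (6 : ℕ)) = 0) :
    d0 * (x ^ (2 : ℕ) * t + (2 : ℂ) * x ^ (3 : ℕ) * t + x ^ (4 : ℕ) * t + x ^ (5 : ℕ) * t + x ^ (6 : ℕ) * t) + d1 * ((1 : ℂ) +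
        x ^ (2 : ℕ) * s ^ (2 : ℕ) +
      x ^ (2 : ℕ) * t ^ (2 : ℕ) + x ^ (4 : ℕ) * s ^ (2 : ℕ) + x ^ (4 : ℕ) * t ^ (2 : ℕ) + x ^ (6 : ℕ) * s ^ (2 : ℕ) + x ^ (6 : ℕ) * t ^ (2 : ℕ)) +
      d2 * (x ^ (2 : ℕ) * s + (2 : ℂ) * x ^ (3 : ℕ) * s + x ^ (4 : ℕ) * s + x ^ (5 : ℕ) * s + x ^ (6 : ℕ) * s) + d3 * (x ^ (2 : ℕ) +
          (4 : ℂ) * x ^ (3 : ℕ) +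
      (2 : ℂ) * x ^ (4 : ℕ) + (2 : ℂ) * x ^ (5 : ℕ)) = 0 := by
  have h' : x * (d0 * (x ^ (2 : ℕ) * t + (2 : ℂ) * x ^ (3 : ℕ) * t + x ^ (4 : ℕ) * t + x ^ (5 : ℕ) * t + x ^ (6 : ℕ) * t) + d1 * ((1 : ℂ) +
      x ^ (2 : ℕ) * s ^ (2 : ℕ) +
      x ^ (2 : ℕ) * t ^ (2 : ℕ) + x ^ (4 : ℕ) * s ^ (2 : ℕ) + x ^ (4 : ℕ) * t ^ (2 : ℕ) + x ^ (6 : ℕ) * s ^ (2 : ℕ) + x ^ (6 : ℕ) * t ^ (2 : ℕ)) +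
      d2 * (x ^ (2 : ℕ) * s + (2 : ℂ) * x ^ (3 : ℕ) * s + x ^ (4 : ℕ) * s + x ^ (5 : ℕ) * s + x ^ (6 : ℕ) * s) + d3 * (x ^ (2 : ℕ) +
          (4 : ℂ) * x ^ (3 : ℕ) +
      (2 : ℂ) * x ^ (4 : ℕ) + (2 : ℂ) * x ^ (5 : ℕ))) = 0 := by
    linear_combination e
  exact (mul_eq_zero.1 h').resolve_left hx

/-- Cancelling the root factor `x` in the `R3` row (`s = t⁻¹`). [folklore] -/
private theorem cancelR3 {x t s : ℂ} (hx : x ≠ 0) {d0 d1 d2 d3 : ℂ}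
    (e : d0 * (x ^ (3 : ℕ) + (4 : ℂ) * x ^ (4 : ℕ) + (2 : ℂ) * x ^ (5 : ℕ) + (2 : ℂ) * x ^ (6 : ℕ)) + d1 * (x ^ (3 : ℕ) * t +
        (2 : ℂ) * x ^ (4 : ℕ) * t +
      x ^ (5 : ℕ) * t + x ^ (6 : ℕ) * t + x ^ (7 : ℕ) * t) + d2 * (x + x ^ (3 : ℕ) * s ^ (2 : ℕ) + x ^ (3 : ℕ) * t ^ (2 : ℕ) +
          x ^ (5 : ℕ) * s ^ (2 : ℕ) +
      x ^ (5 : ℕ) * t ^ (2 : ℕ) + x ^ (7 : ℕ) * s ^ (2 : ℕ) + x ^ (7 : ℕ) * t ^ (2 : ℕ)) + d3 * (x ^ (3 : ℕ) * s + (2 : ℂ) * x ^ (4 : ℕ) * s +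
      x ^ (5 : ℕ) * s + x ^ (6 : ℕ) * s + x ^ (7 : ℕ) * s) = 0) :
    d0 * (x ^ (2 : ℕ) + (4 : ℂ) * x ^ (3 : ℕ) + (2 : ℂ) * x ^ (4 : ℕ) + (2 : ℂ) * x ^ (5 : ℕ)) + d1 * (x ^ (2 : ℕ) * t + (2 : ℂ) * x ^ (3 : ℕ) * t +
      x ^ (4 : ℕ) * t + x ^ (5 : ℕ) * t + x ^ (6 : ℕ) * t) + d2 * ((1 : ℂ) + x ^ (2 : ℕ) * s ^ (2 : ℕ) + x ^ (2 : ℕ) * t ^ (2 : ℕ) +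
      x ^ (4 : ℕ) * s ^ (2 : ℕ) + x ^ (4 : ℕ) * t ^ (2 : ℕ) + x ^ (6 : ℕ) * s ^ (2 : ℕ) + x ^ (6 : ℕ) * t ^ (2 : ℕ)) + d3 * (x ^ (2 : ℕ) * s +
      (2 : ℂ) * x ^ (3 : ℕ) * s + x ^ (4 : ℕ) * s + x ^ (5 : ℕ) * s + x ^ (6 : ℕ) * s) = 0 := by
  have h' : x * (d0 * (x ^ (2 : ℕ) + (4 : ℂ) * x ^ (3 : ℕ) + (2 : ℂ) * x ^ (4 : ℕ) + (2 : ℂ) * x ^ (5 : ℕ)) + d1 * (x ^ (2 : ℕ) * t +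
      (2 : ℂ) * x ^ (3 : ℕ) * t +
      x ^ (4 : ℕ) * t + x ^ (5 : ℕ) * t + x ^ (6 : ℕ) * t) + d2 * ((1 : ℂ) + x ^ (2 : ℕ) * s ^ (2 : ℕ) + x ^ (2 : ℕ) * t ^ (2 : ℕ) +
      x ^ (4 : ℕ) * s ^ (2 : ℕ) + x ^ (4 : ℕ) * t ^ (2 : ℕ) + x ^ (6 : ℕ) * s ^ (2 : ℕ) + x ^ (6 : ℕ) * t ^ (2 : ℕ)) + d3 * (x ^ (2 : ℕ) * s +
      (2 : ℂ) * x ^ (3 : ℕ) * s + x ^ (4 : ℕ) * s + x ^ (5 : ℕ) * s + x ^ (6 : ℕ) * s)) = 0 := by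
    linear_combination e
  exact (mul_eq_zero.1 h').resolve_left hx

/-- Character `ω = 1` of the four orientations of `V`: `P(1) · D₁ = 0`. [folklore] -/
private theorem sumV1 {x t s : ℂ} {d0 d1 d2 d3 : ℂ}
    (p0 : d0 * ((1 : ℂ)) + d1 * (x * s) + d2 * (x) + d3 * (x * t) = 0)
    (p1 : d0 * (x * t) + d1 * ((1 : ℂ)) + d2 * (x * s) + d3 * (x) = 0)
    (p2 : d0 * (x) + d1 * (x * t) + d2 * ((1 : ℂ)) + d3 * (x * s) = 0)
    (p3 : d0 * (x * s) + d1 * (x) + d2 * (x * t) + d3 * ((1 : ℂ)) = 0) :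
    ((1 : ℂ) + x + x * s + x * t) * (d0 + d1 + d2 + d3) = 0 := by
  linear_combination p0 + p1 + p2 + p3

/-- Character `ω = -1` of the four orientations of `V`: `P(-1) · D₋₁ = 0`. [folklore] -/
private theorem sumVm {x t s : ℂ} {d0 d1 d2 d3 : ℂ}
    (p0 : d0 * ((1 : ℂ)) + d1 * (x * s) + d2 * (x) + d3 * (x * t) = 0)
    (p1 : d0 * (x * t) + d1 * ((1 : ℂ)) + d2 * (x * s) + d3 * (x) = 0)
    (p2 : d0 * (x) + d1 * (x * t) + d2 * ((1 : ℂ)) + d3 * (x * s) = 0)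
    (p3 : d0 * (x * s) + d1 * (x) + d2 * (x * t) + d3 * ((1 : ℂ)) = 0) :
    ((1 : ℂ) + x + -(x * s) + -(x * t)) * (d0 - d1 + d2 - d3) = 0 := by
  linear_combination p0 - p1 + p2 - p3

/-- Characters `ω = ±i` of the four orientations of `V`, real form in `A = d₀ - d₂`, `B = d₁ - d₃`. [folklore] -/
private theorem sumVi {x t s : ℂ} {d0 d1 d2 d3 : ℂ}
    (p0 : d0 * ((1 : ℂ)) + d1 * (x * s) + d2 * (x) + d3 * (x * t) = 0)
    (p1 : d0 * (x * t) + d1 * ((1 : ℂ)) + d2 * (x * s) + d3 * (x) = 0)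
    (p2 : d0 * (x) + d1 * (x * t) + d2 * ((1 : ℂ)) + d3 * (x * s) = 0)
    (p3 : d0 * (x * s) + d1 * (x) + d2 * (x * t) + d3 * ((1 : ℂ)) = 0) :
    ((1 : ℂ) + -(x)) * (d0 - d2) + (x * s + -(x * t)) * (d1 - d3) = 0 ∧
    (-(x * s) + x * t) * (d0 - d2) + ((1 : ℂ) + -(x)) * (d1 - d3) = 0 := by
  constructor
  · linear_combination p0 - p2
  · linear_combination p1 - p3

/-- Character `ω = 1` of the four orientations of `Q`: `P(1) · D₁ = 0`. [folklore] -/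
private theorem sumQ1 {x t s : ℂ} {d0 d1 d2 d3 : ℂ}
    (p0 : d0 * (x ^ (2 : ℕ) + (2 : ℂ) * x ^ (3 : ℕ) + x ^ (4 : ℕ)) + d1 * (x ^ (2 : ℕ) * t + (2 : ℂ) * x ^ (3 : ℕ) * t + x ^ (4 : ℕ) * t) +
        d2 * ((1 : ℂ) +
      x ^ (2 : ℕ) * t ^ (2 : ℕ) + x ^ (4 : ℕ) * t ^ (2 : ℕ)) + d3 * (x * s + x ^ (2 : ℕ) * s + x ^ (4 : ℕ) * s) = 0)
    (p1 : d0 * (x * s + x ^ (2 : ℕ) * s + x ^ (4 : ℕ) * s) + d1 * (x ^ (2 : ℕ) + (2 : ℂ) * x ^ (3 : ℕ) + x ^ (4 : ℕ)) + d2 * (x ^ (2 : ℕ) * t +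
      (2 : ℂ) * x ^ (3 : ℕ) * t + x ^ (4 : ℕ) * t) + d3 * ((1 : ℂ) + x ^ (2 : ℕ) * t ^ (2 : ℕ) + x ^ (4 : ℕ) * t ^ (2 : ℕ)) = 0)
    (p2 : d0 * ((1 : ℂ) + x ^ (2 : ℕ) * t ^ (2 : ℕ) + x ^ (4 : ℕ) * t ^ (2 : ℕ)) + d1 * (x * s + x ^ (2 : ℕ) * s + x ^ (4 : ℕ) * s) +
        d2 * (x ^ (2 : ℕ) +
      (2 : ℂ) * x ^ (3 : ℕ) + x ^ (4 : ℕ)) + d3 * (x ^ (2 : ℕ) * t + (2 : ℂ) * x ^ (3 : ℕ) * t + x ^ (4 : ℕ) * t) = 0)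
    (p3 : d0 * (x ^ (2 : ℕ) * t + (2 : ℂ) * x ^ (3 : ℕ) * t + x ^ (4 : ℕ) * t) + d1 * ((1 : ℂ) + x ^ (2 : ℕ) * t ^ (2 : ℕ) +
        x ^ (4 : ℕ) * t ^ (2 : ℕ)) +
      d2 * (x * s + x ^ (2 : ℕ) * s + x ^ (4 : ℕ) * s) + d3 * (x ^ (2 : ℕ) + (2 : ℂ) * x ^ (3 : ℕ) + x ^ (4 : ℕ)) = 0) :
    ((1 : ℂ) + x * s + x ^ (2 : ℕ) + x ^ (2 : ℕ) * s + x ^ (2 : ℕ) * t + x ^ (2 : ℕ) * t ^ (2 : ℕ) + (2 : ℂ) * x ^ (3 : ℕ) +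
        (2 : ℂ) * x ^ (3 : ℕ) * t +
      x ^ (4 : ℕ) + x ^ (4 : ℕ) * s + x ^ (4 : ℕ) * t + x ^ (4 : ℕ) * t ^ (2 : ℕ)) * (d0 + d1 + d2 + d3) = 0 := by
  linear_combination p0 + p1 + p2 + p3

/-- Character `ω = -1` of the four orientations of `Q`: `P(-1) · D₋₁ = 0`. [folklore] -/
private theorem sumQm {x t s : ℂ} {d0 d1 d2 d3 : ℂ}
    (p0 : d0 * (x ^ (2 : ℕ) + (2 : ℂ) * x ^ (3 : ℕ) + x ^ (4 : ℕ)) + d1 * (x ^ (2 : ℕ) * t + (2 : ℂ) * x ^ (3 : ℕ) * t + x ^ (4 : ℕ) * t) +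
        d2 * ((1 : ℂ) +
      x ^ (2 : ℕ) * t ^ (2 : ℕ) + x ^ (4 : ℕ) * t ^ (2 : ℕ)) + d3 * (x * s + x ^ (2 : ℕ) * s + x ^ (4 : ℕ) * s) = 0)
    (p1 : d0 * (x * s + x ^ (2 : ℕ) * s + x ^ (4 : ℕ) * s) + d1 * (x ^ (2 : ℕ) + (2 : ℂ) * x ^ (3 : ℕ) + x ^ (4 : ℕ)) + d2 * (x ^ (2 : ℕ) * t +
      (2 : ℂ) * x ^ (3 : ℕ) * t + x ^ (4 : ℕ) * t) + d3 * ((1 : ℂ) + x ^ (2 : ℕ) * t ^ (2 : ℕ) + x ^ (4 : ℕ) * t ^ (2 : ℕ)) = 0)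
    (p2 : d0 * ((1 : ℂ) + x ^ (2 : ℕ) * t ^ (2 : ℕ) + x ^ (4 : ℕ) * t ^ (2 : ℕ)) + d1 * (x * s + x ^ (2 : ℕ) * s + x ^ (4 : ℕ) * s) +
        d2 * (x ^ (2 : ℕ) +
      (2 : ℂ) * x ^ (3 : ℕ) + x ^ (4 : ℕ)) + d3 * (x ^ (2 : ℕ) * t + (2 : ℂ) * x ^ (3 : ℕ) * t + x ^ (4 : ℕ) * t) = 0)
    (p3 : d0 * (x ^ (2 : ℕ) * t + (2 : ℂ) * x ^ (3 : ℕ) * t + x ^ (4 : ℕ) * t) + d1 * ((1 : ℂ) + x ^ (2 : ℕ) * t ^ (2 : ℕ) +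
        x ^ (4 : ℕ) * t ^ (2 : ℕ)) +
      d2 * (x * s + x ^ (2 : ℕ) * s + x ^ (4 : ℕ) * s) + d3 * (x ^ (2 : ℕ) + (2 : ℂ) * x ^ (3 : ℕ) + x ^ (4 : ℕ)) = 0) :
    ((1 : ℂ) + -(x * s) + x ^ (2 : ℕ) + -(x ^ (2 : ℕ) * s) + -(x ^ (2 : ℕ) * t) + x ^ (2 : ℕ) * t ^ (2 : ℕ) + (2 : ℂ) * x ^ (3 : ℕ) +
      (-2 : ℂ) * x ^ (3 : ℕ) * t + x ^ (4 : ℕ) + -(x ^ (4 : ℕ) * s) + -(x ^ (4 : ℕ) * t) + x ^ (4 : ℕ) * t ^ (2 : ℕ)) * (d0 - d1 + d2 - d3) = 0 := by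
  linear_combination p0 - p1 + p2 - p3

/-- Characters `ω = ±i` of the four orientations of `Q`, real form in `A = d₀ - d₂`, `B = d₁ - d₃`. [folklore] -/
private theorem sumQi {x t s : ℂ} {d0 d1 d2 d3 : ℂ}
    (p0 : d0 * (x ^ (2 : ℕ) + (2 : ℂ) * x ^ (3 : ℕ) + x ^ (4 : ℕ)) + d1 * (x ^ (2 : ℕ) * t + (2 : ℂ) * x ^ (3 : ℕ) * t + x ^ (4 : ℕ) * t) +
        d2 * ((1 : ℂ) +
      x ^ (2 : ℕ) * t ^ (2 : ℕ) + x ^ (4 : ℕ) * t ^ (2 : ℕ)) + d3 * (x * s + x ^ (2 : ℕ) * s + x ^ (4 : ℕ) * s) = 0)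
    (p1 : d0 * (x * s + x ^ (2 : ℕ) * s + x ^ (4 : ℕ) * s) + d1 * (x ^ (2 : ℕ) + (2 : ℂ) * x ^ (3 : ℕ) + x ^ (4 : ℕ)) + d2 * (x ^ (2 : ℕ) * t +
      (2 : ℂ) * x ^ (3 : ℕ) * t + x ^ (4 : ℕ) * t) + d3 * ((1 : ℂ) + x ^ (2 : ℕ) * t ^ (2 : ℕ) + x ^ (4 : ℕ) * t ^ (2 : ℕ)) = 0)
    (p2 : d0 * ((1 : ℂ) + x ^ (2 : ℕ) * t ^ (2 : ℕ) + x ^ (4 : ℕ) * t ^ (2 : ℕ)) + d1 * (x * s + x ^ (2 : ℕ) * s + x ^ (4 : ℕ) * s) +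
        d2 * (x ^ (2 : ℕ) +
      (2 : ℂ) * x ^ (3 : ℕ) + x ^ (4 : ℕ)) + d3 * (x ^ (2 : ℕ) * t + (2 : ℂ) * x ^ (3 : ℕ) * t + x ^ (4 : ℕ) * t) = 0)
    (p3 : d0 * (x ^ (2 : ℕ) * t + (2 : ℂ) * x ^ (3 : ℕ) * t + x ^ (4 : ℕ) * t) + d1 * ((1 : ℂ) + x ^ (2 : ℕ) * t ^ (2 : ℕ) +
        x ^ (4 : ℕ) * t ^ (2 : ℕ)) +
      d2 * (x * s + x ^ (2 : ℕ) * s + x ^ (4 : ℕ) * s) + d3 * (x ^ (2 : ℕ) + (2 : ℂ) * x ^ (3 : ℕ) + x ^ (4 : ℕ)) = 0) :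
    ((-1 : ℂ) + x ^ (2 : ℕ) + -(x ^ (2 : ℕ) * t ^ (2 : ℕ)) + (2 : ℂ) * x ^ (3 : ℕ) + x ^ (4 : ℕ) + -(x ^ (4 : ℕ) * t ^ (2 : ℕ))) * (d0 - d2) +
        (-(x * s) +
      -(x ^ (2 : ℕ) * s) + x ^ (2 : ℕ) * t + (2 : ℂ) * x ^ (3 : ℕ) * t + -(x ^ (4 : ℕ) * s) + x ^ (4 : ℕ) * t) * (d1 - d3) = 0 ∧
    (x * s + x ^ (2 : ℕ) * s + -(x ^ (2 : ℕ) * t) + (-2 : ℂ) * x ^ (3 : ℕ) * t + x ^ (4 : ℕ) * s + -(x ^ (4 : ℕ) * t)) * (d0 - d2) + ((-1 : ℂ) +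
      x ^ (2 : ℕ) + -(x ^ (2 : ℕ) * t ^ (2 : ℕ)) + (2 : ℂ) * x ^ (3 : ℕ) + x ^ (4 : ℕ) + -(x ^ (4 : ℕ) * t ^ (2 : ℕ))) * (d1 - d3) = 0 := by
  constructor
  · linear_combination p0 - p2
  · linear_combination p1 - p3

/-- Character `ω = 1` of the four orientations of `R`: `P(1) · D₁ = 0`. [folklore] -/
private theorem sumR1 {x t s : ℂ} {d0 d1 d2 d3 : ℂ}
    (p0 : d0 * (x ^ (2 : ℕ) * s + (2 : ℂ) * x ^ (3 : ℕ) * s + x ^ (4 : ℕ) * s + x ^ (5 : ℕ) * s + x ^ (6 : ℕ) * s) + d1 * (x ^ (2 : ℕ) +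
        (4 : ℂ) * x ^ (3 : ℕ) +
      (2 : ℂ) * x ^ (4 : ℕ) + (2 : ℂ) * x ^ (5 : ℕ)) + d2 * (x ^ (2 : ℕ) * t + (2 : ℂ) * x ^ (3 : ℕ) * t + x ^ (4 : ℕ) * t + x ^ (5 : ℕ) * t +
      x ^ (6 : ℕ) * t) + d3 * ((1 : ℂ) + x ^ (2 : ℕ) * s ^ (2 : ℕ) + x ^ (2 : ℕ) * t ^ (2 : ℕ) + x ^ (4 : ℕ) * s ^ (2 : ℕ) +
          x ^ (4 : ℕ) * t ^ (2 : ℕ) +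
      x ^ (6 : ℕ) * s ^ (2 : ℕ) + x ^ (6 : ℕ) * t ^ (2 : ℕ)) = 0)
    (p1 : d0 * ((1 : ℂ) + x ^ (2 : ℕ) * s ^ (2 : ℕ) + x ^ (2 : ℕ) * t ^ (2 : ℕ) + x ^ (4 : ℕ) * s ^ (2 : ℕ) + x ^ (4 : ℕ) * t ^ (2 : ℕ) +
      x ^ (6 : ℕ) * s ^ (2 : ℕ) + x ^ (6 : ℕ) * t ^ (2 : ℕ)) + d1 * (x ^ (2 : ℕ) * s + (2 : ℂ) * x ^ (3 : ℕ) * s + x ^ (4 : ℕ) * s + x ^ (5 : ℕ) * s +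
      x ^ (6 : ℕ) * s) + d2 * (x ^ (2 : ℕ) + (4 : ℂ) * x ^ (3 : ℕ) + (2 : ℂ) * x ^ (4 : ℕ) + (2 : ℂ) * x ^ (5 : ℕ)) + d3 * (x ^ (2 : ℕ) * t +
      (2 : ℂ) * x ^ (3 : ℕ) * t + x ^ (4 : ℕ) * t + x ^ (5 : ℕ) * t + x ^ (6 : ℕ) * t) = 0)
    (p2 : d0 * (x ^ (2 : ℕ) * t + (2 : ℂ) * x ^ (3 : ℕ) * t + x ^ (4 : ℕ) * t + x ^ (5 : ℕ) * t + x ^ (6 : ℕ) * t) + d1 * ((1 : ℂ) +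
        x ^ (2 : ℕ) * s ^ (2 : ℕ) +
      x ^ (2 : ℕ) * t ^ (2 : ℕ) + x ^ (4 : ℕ) * s ^ (2 : ℕ) + x ^ (4 : ℕ) * t ^ (2 : ℕ) + x ^ (6 : ℕ) * s ^ (2 : ℕ) + x ^ (6 : ℕ) * t ^ (2 : ℕ)) +
      d2 * (x ^ (2 : ℕ) * s + (2 : ℂ) * x ^ (3 : ℕ) * s + x ^ (4 : ℕ) * s + x ^ (5 : ℕ) * s + x ^ (6 : ℕ) * s) + d3 * (x ^ (2 : ℕ) +
          (4 : ℂ) * x ^ (3 : ℕ) +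
      (2 : ℂ) * x ^ (4 : ℕ) + (2 : ℂ) * x ^ (5 : ℕ)) = 0)
    (p3 : d0 * (x ^ (2 : ℕ) + (4 : ℂ) * x ^ (3 : ℕ) + (2 : ℂ) * x ^ (4 : ℕ) + (2 : ℂ) * x ^ (5 : ℕ)) + d1 * (x ^ (2 : ℕ) * t +
        (2 : ℂ) * x ^ (3 : ℕ) * t +
      x ^ (4 : ℕ) * t + x ^ (5 : ℕ) * t + x ^ (6 : ℕ) * t) + d2 * ((1 : ℂ) + x ^ (2 : ℕ) * s ^ (2 : ℕ) + x ^ (2 : ℕ) * t ^ (2 : ℕ) +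
      x ^ (4 : ℕ) * s ^ (2 : ℕ) + x ^ (4 : ℕ) * t ^ (2 : ℕ) + x ^ (6 : ℕ) * s ^ (2 : ℕ) + x ^ (6 : ℕ) * t ^ (2 : ℕ)) + d3 * (x ^ (2 : ℕ) * s +
      (2 : ℂ) * x ^ (3 : ℕ) * s + x ^ (4 : ℕ) * s + x ^ (5 : ℕ) * s + x ^ (6 : ℕ) * s) = 0) :
    ((1 : ℂ) + x ^ (2 : ℕ) + x ^ (2 : ℕ) * s + x ^ (2 : ℕ) * s ^ (2 : ℕ) + x ^ (2 : ℕ) * t + x ^ (2 : ℕ) * t ^ (2 : ℕ) + (4 : ℂ) * x ^ (3 : ℕ) +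
      (2 : ℂ) * x ^ (3 : ℕ) * s + (2 : ℂ) * x ^ (3 : ℕ) * t + (2 : ℂ) * x ^ (4 : ℕ) + x ^ (4 : ℕ) * s + x ^ (4 : ℕ) * s ^ (2 : ℕ) + x ^ (4 : ℕ) * t +
      x ^ (4 : ℕ) * t ^ (2 : ℕ) + (2 : ℂ) * x ^ (5 : ℕ) + x ^ (5 : ℕ) * s + x ^ (5 : ℕ) * t + x ^ (6 : ℕ) * s + x ^ (6 : ℕ) * s ^ (2 : ℕ) +
          x ^ (6 : ℕ) * t +
      x ^ (6 : ℕ) * t ^ (2 : ℕ)) * (d0 + d1 + d2 + d3) = 0 := by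
  linear_combination p0 + p1 + p2 + p3

/-- Character `ω = -1` of the four orientations of `R`: `P(-1) · D₋₁ = 0`. [folklore] -/
private theorem sumRm {x t s : ℂ} {d0 d1 d2 d3 : ℂ}
    (p0 : d0 * (x ^ (2 : ℕ) * s + (2 : ℂ) * x ^ (3 : ℕ) * s + x ^ (4 : ℕ) * s + x ^ (5 : ℕ) * s + x ^ (6 : ℕ) * s) + d1 * (x ^ (2 : ℕ) +
        (4 : ℂ) * x ^ (3 : ℕ) +
      (2 : ℂ) * x ^ (4 : ℕ) + (2 : ℂ) * x ^ (5 : ℕ)) + d2 * (x ^ (2 : ℕ) * t + (2 : ℂ) * x ^ (3 : ℕ) * t + x ^ (4 : ℕ) * t + x ^ (5 : ℕ) * t +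
      x ^ (6 : ℕ) * t) + d3 * ((1 : ℂ) + x ^ (2 : ℕ) * s ^ (2 : ℕ) + x ^ (2 : ℕ) * t ^ (2 : ℕ) + x ^ (4 : ℕ) * s ^ (2 : ℕ) +
          x ^ (4 : ℕ) * t ^ (2 : ℕ) +
      x ^ (6 : ℕ) * s ^ (2 : ℕ) + x ^ (6 : ℕ) * t ^ (2 : ℕ)) = 0)
    (p1 : d0 * ((1 : ℂ) + x ^ (2 : ℕ) * s ^ (2 : ℕ) + x ^ (2 : ℕ) * t ^ (2 : ℕ) + x ^ (4 : ℕ) * s ^ (2 : ℕ) + x ^ (4 : ℕ) * t ^ (2 : ℕ) +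
      x ^ (6 : ℕ) * s ^ (2 : ℕ) + x ^ (6 : ℕ) * t ^ (2 : ℕ)) + d1 * (x ^ (2 : ℕ) * s + (2 : ℂ) * x ^ (3 : ℕ) * s + x ^ (4 : ℕ) * s + x ^ (5 : ℕ) * s +
      x ^ (6 : ℕ) * s) + d2 * (x ^ (2 : ℕ) + (4 : ℂ) * x ^ (3 : ℕ) + (2 : ℂ) * x ^ (4 : ℕ) + (2 : ℂ) * x ^ (5 : ℕ)) + d3 * (x ^ (2 : ℕ) * t +
      (2 : ℂ) * x ^ (3 : ℕ) * t + x ^ (4 : ℕ) * t + x ^ (5 : ℕ) * t + x ^ (6 : ℕ) * t) = 0)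
    (p2 : d0 * (x ^ (2 : ℕ) * t + (2 : ℂ) * x ^ (3 : ℕ) * t + x ^ (4 : ℕ) * t + x ^ (5 : ℕ) * t + x ^ (6 : ℕ) * t) + d1 * ((1 : ℂ) +
        x ^ (2 : ℕ) * s ^ (2 : ℕ) +
      x ^ (2 : ℕ) * t ^ (2 : ℕ) + x ^ (4 : ℕ) * s ^ (2 : ℕ) + x ^ (4 : ℕ) * t ^ (2 : ℕ) + x ^ (6 : ℕ) * s ^ (2 : ℕ) + x ^ (6 : ℕ) * t ^ (2 : ℕ)) +
      d2 * (x ^ (2 : ℕ) * s + (2 : ℂ) * x ^ (3 : ℕ) * s + x ^ (4 : ℕ) * s + x ^ (5 : ℕ) * s + x ^ (6 : ℕ) * s) + d3 * (x ^ (2 : ℕ) +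
          (4 : ℂ) * x ^ (3 : ℕ) +
      (2 : ℂ) * x ^ (4 : ℕ) + (2 : ℂ) * x ^ (5 : ℕ)) = 0)
    (p3 : d0 * (x ^ (2 : ℕ) + (4 : ℂ) * x ^ (3 : ℕ) + (2 : ℂ) * x ^ (4 : ℕ) + (2 : ℂ) * x ^ (5 : ℕ)) + d1 * (x ^ (2 : ℕ) * t +
        (2 : ℂ) * x ^ (3 : ℕ) * t +
      x ^ (4 : ℕ) * t + x ^ (5 : ℕ) * t + x ^ (6 : ℕ) * t) + d2 * ((1 : ℂ) + x ^ (2 : ℕ) * s ^ (2 : ℕ) + x ^ (2 : ℕ) * t ^ (2 : ℕ) +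
      x ^ (4 : ℕ) * s ^ (2 : ℕ) + x ^ (4 : ℕ) * t ^ (2 : ℕ) + x ^ (6 : ℕ) * s ^ (2 : ℕ) + x ^ (6 : ℕ) * t ^ (2 : ℕ)) + d3 * (x ^ (2 : ℕ) * s +
      (2 : ℂ) * x ^ (3 : ℕ) * s + x ^ (4 : ℕ) * s + x ^ (5 : ℕ) * s + x ^ (6 : ℕ) * s) = 0) :
    ((-1 : ℂ) + -(x ^ (2 : ℕ)) + x ^ (2 : ℕ) * s + -(x ^ (2 : ℕ) * s ^ (2 : ℕ)) + x ^ (2 : ℕ) * t + -(x ^ (2 : ℕ) * t ^ (2 : ℕ)) +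
        (-4 : ℂ) * x ^ (3 : ℕ) +
      (2 : ℂ) * x ^ (3 : ℕ) * s + (2 : ℂ) * x ^ (3 : ℕ) * t + (-2 : ℂ) * x ^ (4 : ℕ) + x ^ (4 : ℕ) * s + -(x ^ (4 : ℕ) * s ^ (2 : ℕ)) +
          x ^ (4 : ℕ) * t +
      -(x ^ (4 : ℕ) * t ^ (2 : ℕ)) + (-2 : ℂ) * x ^ (5 : ℕ) + x ^ (5 : ℕ) * s + x ^ (5 : ℕ) * t + x ^ (6 : ℕ) * s + -(x ^ (6 : ℕ) * s ^ (2 : ℕ)) +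
      x ^ (6 : ℕ) * t + -(x ^ (6 : ℕ) * t ^ (2 : ℕ))) * (d0 - d1 + d2 - d3) = 0 := by
  linear_combination p0 - p1 + p2 - p3

/-- Characters `ω = ±i` of the four orientations of `R`, real form in `A = d₀ - d₂`, `B = d₁ - d₃`. [folklore] -/
private theorem sumRi {x t s : ℂ} {d0 d1 d2 d3 : ℂ}
    (p0 : d0 * (x ^ (2 : ℕ) * s + (2 : ℂ) * x ^ (3 : ℕ) * s + x ^ (4 : ℕ) * s + x ^ (5 : ℕ) * s + x ^ (6 : ℕ) * s) + d1 * (x ^ (2 : ℕ) +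
        (4 : ℂ) * x ^ (3 : ℕ) +
      (2 : ℂ) * x ^ (4 : ℕ) + (2 : ℂ) * x ^ (5 : ℕ)) + d2 * (x ^ (2 : ℕ) * t + (2 : ℂ) * x ^ (3 : ℕ) * t + x ^ (4 : ℕ) * t + x ^ (5 : ℕ) * t +
      x ^ (6 : ℕ) * t) + d3 * ((1 : ℂ) + x ^ (2 : ℕ) * s ^ (2 : ℕ) + x ^ (2 : ℕ) * t ^ (2 : ℕ) + x ^ (4 : ℕ) * s ^ (2 : ℕ) +
          x ^ (4 : ℕ) * t ^ (2 : ℕ) +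
      x ^ (6 : ℕ) * s ^ (2 : ℕ) + x ^ (6 : ℕ) * t ^ (2 : ℕ)) = 0)
    (p1 : d0 * ((1 : ℂ) + x ^ (2 : ℕ) * s ^ (2 : ℕ) + x ^ (2 : ℕ) * t ^ (2 : ℕ) + x ^ (4 : ℕ) * s ^ (2 : ℕ) + x ^ (4 : ℕ) * t ^ (2 : ℕ) +
      x ^ (6 : ℕ) * s ^ (2 : ℕ) + x ^ (6 : ℕ) * t ^ (2 : ℕ)) + d1 * (x ^ (2 : ℕ) * s + (2 : ℂ) * x ^ (3 : ℕ) * s + x ^ (4 : ℕ) * s + x ^ (5 : ℕ) * s +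
      x ^ (6 : ℕ) * s) + d2 * (x ^ (2 : ℕ) + (4 : ℂ) * x ^ (3 : ℕ) + (2 : ℂ) * x ^ (4 : ℕ) + (2 : ℂ) * x ^ (5 : ℕ)) + d3 * (x ^ (2 : ℕ) * t +
      (2 : ℂ) * x ^ (3 : ℕ) * t + x ^ (4 : ℕ) * t + x ^ (5 : ℕ) * t + x ^ (6 : ℕ) * t) = 0)
    (p2 : d0 * (x ^ (2 : ℕ) * t + (2 : ℂ) * x ^ (3 : ℕ) * t + x ^ (4 : ℕ) * t + x ^ (5 : ℕ) * t + x ^ (6 : ℕ) * t) + d1 * ((1 : ℂ) +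
        x ^ (2 : ℕ) * s ^ (2 : ℕ) +
      x ^ (2 : ℕ) * t ^ (2 : ℕ) + x ^ (4 : ℕ) * s ^ (2 : ℕ) + x ^ (4 : ℕ) * t ^ (2 : ℕ) + x ^ (6 : ℕ) * s ^ (2 : ℕ) + x ^ (6 : ℕ) * t ^ (2 : ℕ)) +
      d2 * (x ^ (2 : ℕ) * s + (2 : ℂ) * x ^ (3 : ℕ) * s + x ^ (4 : ℕ) * s + x ^ (5 : ℕ) * s + x ^ (6 : ℕ) * s) + d3 * (x ^ (2 : ℕ) +
          (4 : ℂ) * x ^ (3 : ℕ) +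
      (2 : ℂ) * x ^ (4 : ℕ) + (2 : ℂ) * x ^ (5 : ℕ)) = 0)
    (p3 : d0 * (x ^ (2 : ℕ) + (4 : ℂ) * x ^ (3 : ℕ) + (2 : ℂ) * x ^ (4 : ℕ) + (2 : ℂ) * x ^ (5 : ℕ)) + d1 * (x ^ (2 : ℕ) * t +
        (2 : ℂ) * x ^ (3 : ℕ) * t +
      x ^ (4 : ℕ) * t + x ^ (5 : ℕ) * t + x ^ (6 : ℕ) * t) + d2 * ((1 : ℂ) + x ^ (2 : ℕ) * s ^ (2 : ℕ) + x ^ (2 : ℕ) * t ^ (2 : ℕ) +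
      x ^ (4 : ℕ) * s ^ (2 : ℕ) + x ^ (4 : ℕ) * t ^ (2 : ℕ) + x ^ (6 : ℕ) * s ^ (2 : ℕ) + x ^ (6 : ℕ) * t ^ (2 : ℕ)) + d3 * (x ^ (2 : ℕ) * s +
      (2 : ℂ) * x ^ (3 : ℕ) * s + x ^ (4 : ℕ) * s + x ^ (5 : ℕ) * s + x ^ (6 : ℕ) * s) = 0) :
    (x ^ (2 : ℕ) * s + -(x ^ (2 : ℕ) * t) + (2 : ℂ) * x ^ (3 : ℕ) * s + (-2 : ℂ) * x ^ (3 : ℕ) * t + x ^ (4 : ℕ) * s + -(x ^ (4 : ℕ) * t) +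
      x ^ (5 : ℕ) * s + -(x ^ (5 : ℕ) * t) + x ^ (6 : ℕ) * s + -(x ^ (6 : ℕ) * t)) * (d0 - d2) + ((-1 : ℂ) + x ^ (2 : ℕ) +
          -(x ^ (2 : ℕ) * s ^ (2 : ℕ)) +
      -(x ^ (2 : ℕ) * t ^ (2 : ℕ)) + (4 : ℂ) * x ^ (3 : ℕ) + (2 : ℂ) * x ^ (4 : ℕ) + -(x ^ (4 : ℕ) * s ^ (2 : ℕ)) + -(x ^ (4 : ℕ) * t ^ (2 : ℕ)) +
      (2 : ℂ) * x ^ (5 : ℕ) + -(x ^ (6 : ℕ) * s ^ (2 : ℕ)) + -(x ^ (6 : ℕ) * t ^ (2 : ℕ))) * (d1 - d3) = 0 ∧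
    ((1 : ℂ) + -(x ^ (2 : ℕ)) + x ^ (2 : ℕ) * s ^ (2 : ℕ) + x ^ (2 : ℕ) * t ^ (2 : ℕ) + (-4 : ℂ) * x ^ (3 : ℕ) + (-2 : ℂ) * x ^ (4 : ℕ) +
      x ^ (4 : ℕ) * s ^ (2 : ℕ) + x ^ (4 : ℕ) * t ^ (2 : ℕ) + (-2 : ℂ) * x ^ (5 : ℕ) + x ^ (6 : ℕ) * s ^ (2 : ℕ) +
          x ^ (6 : ℕ) * t ^ (2 : ℕ)) * (d0 - d2) +
      (x ^ (2 : ℕ) * s + -(x ^ (2 : ℕ) * t) + (2 : ℂ) * x ^ (3 : ℕ) * s + (-2 : ℂ) * x ^ (3 : ℕ) * t + x ^ (4 : ℕ) * s + -(x ^ (4 : ℕ) * t) +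
      x ^ (5 : ℕ) * s + -(x ^ (5 : ℕ) * t) + x ^ (6 : ℕ) * s + -(x ^ (6 : ℕ) * t)) * (d1 - d3) = 0 := by
  constructor
  · linear_combination p0 - p2
  · linear_combination p1 - p3

/-- **Algebraic core.** For `x ≠ 0`, `t ≠ 0` in `ℂ`, the twelve exact boundary relations of the instances
`V0 … R3` force `d = 0`. [folklore] -/
private theorem core {x t : ℂ} (hx : x ≠ 0) (ht : t ≠ 0) {d0 d1 d2 d3 : ℂ}
    (eV0 : d0 * (x) + d1 * (x ^ (2 : ℕ) * t⁻¹) + d2 * (x ^ (2 : ℕ)) + d3 * (x ^ (2 : ℕ) * t) = 0)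
    (eV1 : d0 * (x ^ (2 : ℕ) * t) + d1 * (x) + d2 * (x ^ (2 : ℕ) * t⁻¹) + d3 * (x ^ (2 : ℕ)) = 0)
    (eV2 : d0 * (x ^ (2 : ℕ)) + d1 * (x ^ (2 : ℕ) * t) + d2 * (x) + d3 * (x ^ (2 : ℕ) * t⁻¹) = 0)
    (eV3 : d0 * (x ^ (2 : ℕ) * t⁻¹) + d1 * (x ^ (2 : ℕ)) + d2 * (x ^ (2 : ℕ) * t) + d3 * (x) = 0)
    (eQ0 : d0 * (x ^ (3 : ℕ) + (2 : ℂ) * x ^ (4 : ℕ) + x ^ (5 : ℕ)) + d1 * (x ^ (3 : ℕ) * t + (2 : ℂ) * x ^ (4 : ℕ) * t + x ^ (5 : ℕ) * t) + d2 * (x +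
      x ^ (3 : ℕ) * t ^ (2 : ℕ) + x ^ (5 : ℕ) * t ^ (2 : ℕ)) + d3 * (x ^ (2 : ℕ) * t⁻¹ + x ^ (3 : ℕ) * t⁻¹ + x ^ (5 : ℕ) * t⁻¹) = 0)
    (eQ1 : d0 * (x ^ (2 : ℕ) * t⁻¹ + x ^ (3 : ℕ) * t⁻¹ + x ^ (5 : ℕ) * t⁻¹) + d1 * (x ^ (3 : ℕ) + (2 : ℂ) * x ^ (4 : ℕ) + x ^ (5 : ℕ)) +
        d2 * (x ^ (3 : ℕ) * t +
      (2 : ℂ) * x ^ (4 : ℕ) * t + x ^ (5 : ℕ) * t) + d3 * (x + x ^ (3 : ℕ) * t ^ (2 : ℕ) + x ^ (5 : ℕ) * t ^ (2 : ℕ)) = 0)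
    (eQ2 : d0 * (x + x ^ (3 : ℕ) * t ^ (2 : ℕ) + x ^ (5 : ℕ) * t ^ (2 : ℕ)) + d1 * (x ^ (2 : ℕ) * t⁻¹ + x ^ (3 : ℕ) * t⁻¹ + x ^ (5 : ℕ) * t⁻¹) +
      d2 * (x ^ (3 : ℕ) + (2 : ℂ) * x ^ (4 : ℕ) + x ^ (5 : ℕ)) + d3 * (x ^ (3 : ℕ) * t + (2 : ℂ) * x ^ (4 : ℕ) * t + x ^ (5 : ℕ) * t) = 0)
    (eQ3 : d0 * (x ^ (3 : ℕ) * t + (2 : ℂ) * x ^ (4 : ℕ) * t + x ^ (5 : ℕ) * t) + d1 * (x + x ^ (3 : ℕ) * t ^ (2 : ℕ) + x ^ (5 : ℕ) * t ^ (2 : ℕ)) +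
      d2 * (x ^ (2 : ℕ) * t⁻¹ + x ^ (3 : ℕ) * t⁻¹ + x ^ (5 : ℕ) * t⁻¹) + d3 * (x ^ (3 : ℕ) + (2 : ℂ) * x ^ (4 : ℕ) + x ^ (5 : ℕ)) = 0)
    (eR0 : d0 * (x ^ (3 : ℕ) * t⁻¹ + (2 : ℂ) * x ^ (4 : ℕ) * t⁻¹ + x ^ (5 : ℕ) * t⁻¹ + x ^ (6 : ℕ) * t⁻¹ + x ^ (7 : ℕ) * t⁻¹) + d1 * (x ^ (3 : ℕ) +
      (4 : ℂ) * x ^ (4 : ℕ) + (2 : ℂ) * x ^ (5 : ℕ) + (2 : ℂ) * x ^ (6 : ℕ)) + d2 * (x ^ (3 : ℕ) * t + (2 : ℂ) * x ^ (4 : ℕ) * t + x ^ (5 : ℕ) * t +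
      x ^ (6 : ℕ) * t + x ^ (7 : ℕ) * t) + d3 * (x + x ^ (3 : ℕ) * t⁻¹ ^ (2 : ℕ) + x ^ (3 : ℕ) * t ^ (2 : ℕ) + x ^ (5 : ℕ) * t⁻¹ ^ (2 : ℕ) +
      x ^ (5 : ℕ) * t ^ (2 : ℕ) + x ^ (7 : ℕ) * t⁻¹ ^ (2 : ℕ) + x ^ (7 : ℕ) * t ^ (2 : ℕ)) = 0)
    (eR1 : d0 * (x + x ^ (3 : ℕ) * t⁻¹ ^ (2 : ℕ) + x ^ (3 : ℕ) * t ^ (2 : ℕ) + x ^ (5 : ℕ) * t⁻¹ ^ (2 : ℕ) + x ^ (5 : ℕ) * t ^ (2 : ℕ) +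
      x ^ (7 : ℕ) * t⁻¹ ^ (2 : ℕ) + x ^ (7 : ℕ) * t ^ (2 : ℕ)) + d1 * (x ^ (3 : ℕ) * t⁻¹ + (2 : ℂ) * x ^ (4 : ℕ) * t⁻¹ + x ^ (5 : ℕ) * t⁻¹ +
      x ^ (6 : ℕ) * t⁻¹ + x ^ (7 : ℕ) * t⁻¹) + d2 * (x ^ (3 : ℕ) + (4 : ℂ) * x ^ (4 : ℕ) + (2 : ℂ) * x ^ (5 : ℕ) + (2 : ℂ) * x ^ (6 : ℕ)) +
      d3 * (x ^ (3 : ℕ) * t + (2 : ℂ) * x ^ (4 : ℕ) * t + x ^ (5 : ℕ) * t + x ^ (6 : ℕ) * t + x ^ (7 : ℕ) * t) = 0)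
    (eR2 : d0 * (x ^ (3 : ℕ) * t + (2 : ℂ) * x ^ (4 : ℕ) * t + x ^ (5 : ℕ) * t + x ^ (6 : ℕ) * t + x ^ (7 : ℕ) * t) + d1 * (x +
        x ^ (3 : ℕ) * t⁻¹ ^ (2 : ℕ) +
      x ^ (3 : ℕ) * t ^ (2 : ℕ) + x ^ (5 : ℕ) * t⁻¹ ^ (2 : ℕ) + x ^ (5 : ℕ) * t ^ (2 : ℕ) + x ^ (7 : ℕ) * t⁻¹ ^ (2 : ℕ) + x ^ (7 : ℕ) * t ^ (2 : ℕ)) +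
      d2 * (x ^ (3 : ℕ) * t⁻¹ + (2 : ℂ) * x ^ (4 : ℕ) * t⁻¹ + x ^ (5 : ℕ) * t⁻¹ + x ^ (6 : ℕ) * t⁻¹ + x ^ (7 : ℕ) * t⁻¹) + d3 * (x ^ (3 : ℕ) +
      (4 : ℂ) * x ^ (4 : ℕ) + (2 : ℂ) * x ^ (5 : ℕ) + (2 : ℂ) * x ^ (6 : ℕ)) = 0)
    (eR3 : d0 * (x ^ (3 : ℕ) + (4 : ℂ) * x ^ (4 : ℕ) + (2 : ℂ) * x ^ (5 : ℕ) + (2 : ℂ) * x ^ (6 : ℕ)) + d1 * (x ^ (3 : ℕ) * t +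
        (2 : ℂ) * x ^ (4 : ℕ) * t +
      x ^ (5 : ℕ) * t + x ^ (6 : ℕ) * t + x ^ (7 : ℕ) * t) + d2 * (x + x ^ (3 : ℕ) * t⁻¹ ^ (2 : ℕ) + x ^ (3 : ℕ) * t ^ (2 : ℕ) +
          x ^ (5 : ℕ) * t⁻¹ ^ (2 : ℕ) +
      x ^ (5 : ℕ) * t ^ (2 : ℕ) + x ^ (7 : ℕ) * t⁻¹ ^ (2 : ℕ) + x ^ (7 : ℕ) * t ^ (2 : ℕ)) + d3 * (x ^ (3 : ℕ) * t⁻¹ + (2 : ℂ) * x ^ (4 : ℕ) * t⁻¹ +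
      x ^ (5 : ℕ) * t⁻¹ + x ^ (6 : ℕ) * t⁻¹ + x ^ (7 : ℕ) * t⁻¹) = 0)
    : d0 = 0 ∧ d1 = 0 ∧ d2 = 0 ∧ d3 = 0 := by
  have hs : t * t⁻¹ = 1 := mul_inv_cancel₀ ht
  generalize t⁻¹ = s at hs eV0 eV1 eV2 eV3 eQ0 eQ1 eQ2 eQ3 eR0 eR1 eR2 eR3
  have pV0 := cancelV0 (s := s) hx eV0
  have pV1 := cancelV1 (s := s) hx eV1
  have pV2 := cancelV2 (s := s) hx eV2
  have pV3 := cancelV3 (s := s) hx eV3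
  have pQ0 := cancelQ0 (s := s) hx eQ0
  have pQ1 := cancelQ1 (s := s) hx eQ1
  have pQ2 := cancelQ2 (s := s) hx eQ2
  have pQ3 := cancelQ3 (s := s) hx eQ3
  have pR0 := cancelR0 (s := s) hx eR0
  have pR1 := cancelR1 (s := s) hx eR1
  have pR2 := cancelR2 (s := s) hx eR2
  have pR3 := cancelR3 (s := s) hx eR3
  have hV1 := sumV1 pV0 pV1 pV2 pV3
  have hVm := sumVm pV0 pV1 pV2 pV3
  obtain ⟨hVre, hVim⟩ := sumVi pV0 pV1 pV2 pV3
  have hQ1 := sumQ1 pQ0 pQ1 pQ2 pQ3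
  have hQm := sumQm pQ0 pQ1 pQ2 pQ3
  obtain ⟨hQre, hQim⟩ := sumQi pQ0 pQ1 pQ2 pQ3
  have hR1 := sumR1 pR0 pR1 pR2 pR3
  have hRm := sumRm pR0 pR1 pR2 pR3
  obtain ⟨hRre, hRim⟩ := sumRi pR0 pR1 pR2 pR3
  have hD1 : (d0 + d1 + d2 + d3) = 0 := bezout1 hs (xelimQ1 hs hV1 hQ1) (xelimR1 hs hV1 hR1)
  have hDm : (d0 - d1 + d2 - d3) = 0 := bezoutm hs (xelimQm hs hVm hQm) (xelimRm hs hVm hRm)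
  obtain ⟨hQre', hQim'⟩ := xelimQi hs hVre hVim hQre hQim
  obtain ⟨hRre', hRim'⟩ := xelimRi hs hVre hVim hRre hRim
  obtain ⟨hA, hB⟩ := bezouti hs hQre' hQim' hRre' hRim'
  refine ⟨?_, ?_, ?_, ?_⟩
  · linear_combination (hD1 + hDm + 2 * hA) / 4
  · linear_combination (hD1 - hDm + 2 * hB) / 4
  · linear_combination (hD1 + hDm - 2 * hA) / 4
  · linear_combination (hD1 - hDm - 2 * hB) / 4

end NoBoundaryRelation
/-! ### The theorem -/

/-- `t = e^{-iσπ/2}` is non-zero. [folklore] -/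
private theorem NoBoundaryRelation.tOf_ne_zero (σ : ℝ) : NoVertexRelation.tOf σ ≠ 0 := by
  intro h
  have := NoVertexRelation.norm_tOf σ
  rw [h, norm_zero] at this
  exact zero_ne_one this

/-- **The uniform square-lattice SAW observable admits NO exact boundary identity with
direction-indexed coefficients**, at any fugacity `x ≠ 0` and any spin `σ`: an exact boundary
relation forces `d = 0`. Twelve explicit finite domains suffice — the single vertex, the `2 × 2`
block and the `3 × 2` block, each with a pendant root edge, in their four orientations
(`NoBoundaryRelation.instV0` … `instR3`, kernel-checked walk enumerations), followed by the
elimination `NoBoundaryRelation.core`. Square-lattice counterpart (negative) of the summed identity (5)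
behind DCS's Lemma 2; the finite-width failure of that identity on `ℤ²` strips was a numerical
observation of Beaton–Guttmann–Jensen.
[cite: DuminilCopinSmirnov2012, §3, Lemma 2 and eq. (5) (shape of the identity; square-lattice counterpart refuted here)]
[cite: BeatonGuttmannJensen2012, p. 5 (numerical failure of the strip identity on the square lattice)] -/
theorem exactBoundaryRelationZ2_eq_zero {x σ : ℝ} {d : Fin 4 → ℂ} (hx : x ≠ 0)
    (h : ExactBoundaryRelationZ2 x σ d) : d = 0 := by
  obtain ⟨h0, h1, h2, h3⟩ := NoBoundaryRelation.core (x := (x : ℂ)) (t := NoVertexRelation.tOf σ)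
    (by exact_mod_cast hx) (NoBoundaryRelation.tOf_ne_zero σ)
    (NoBoundaryRelation.instV0 h) (NoBoundaryRelation.instV1 h) (NoBoundaryRelation.instV2 h)
    (NoBoundaryRelation.instV3 h) (NoBoundaryRelation.instQ0 h) (NoBoundaryRelation.instQ1 h)
    (NoBoundaryRelation.instQ2 h) (NoBoundaryRelation.instQ3 h) (NoBoundaryRelation.instR0 h)
    (NoBoundaryRelation.instR1 h) (NoBoundaryRelation.instR2 h) (NoBoundaryRelation.instR3 h)
  funext i; fin_cases i <;> simp [h0, h1, h2, h3]

/-- The hypothesis `x ≠ 0` is necessary: at `x = 0` the observable vanishes identically (every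
term carries `x^{n+1}`, root included), so every `d` satisfies the relation.
[cite: DuminilCopinSmirnov2012, §2, Definition 1 (weight `x^{ℓ(γ)}` of the observable)] -/
theorem exactBoundaryRelationZ2_zero_fugacity (σ : ℝ) (d : Fin 4 → ℂ) :
    ExactBoundaryRelationZ2 0 σ d := by
  intro Ω δ V a w₁ i₀ _ _ _ _ _
  have hF : ∀ e, midEdgeParafermionicObservable Ω δ a 0 σ e = 0 := by
    intro e
    induction e using Sym2.ind with
    | h z w => simp [midEdgeParafermionicObservable_mk, halfEdgeTerm]
  simp [boundaryFunctionalZ2, hF]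

/-! ### The barrier -/

/-- **Barrier `NoExactBoundaryRelationZ2`** (companion of `NienhuisWeightsExcludeVertexSAW`,
filling its scope caveat (b) "boundary/strip identities" for the direction-indexed shape): the
uniform square-lattice SAW mid-edge parafermionic observable admits NO exact boundary identity
`Σ_{boundary half-edges} d_{outward direction} F = 0` (root term included) with
direction-indexed, domain- and root-independent coefficients `d ≠ 0`, at any fugacity `x ≠ 0`
and any spin `σ` — the square-lattice shape of the identity that, on the hexagonal lattice,
follows from Duminil-Copin–Smirnov's Lemma 1 by summation over the domain and drives their
Lemma 2 / strip identity `1 = c_α A_T + B_T + c_ε E_T` (hence `μ(ℍ) = √(2+√2)`). PROVED below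
(`NoExactBoundaryRelationZ2_holds`) from twelve explicit finite domains.

BARRIER (structured block, D-0021):
- technique_class: discrete-holomorphicity parafermionic-observable boundary-identity strip-identity bridge-generating-function — explicitly the predicate `ExactBoundaryRelationZ2 x σ d` (for every finite discrete domain `Ω_δ ⊆ δℤ²` with a leaf root, `boundaryFunctionalZ2 Ω δ V a w₁ i₀ x σ d = 0`: the observable `Literature.Probability.RandomPlanarGeometry.SAW.midEdgeParafermionicObservable` summed over the boundary half-edges with one coefficient per OUTWARD lattice direction, root term included)
- blocks: transplanting to the UNIFORM self-avoiding walk on `ℤ²` the second half of the Duminil-Copin–Smirnov argument — a domain/strip identity with constant boundary coefficients obtained by summing a local relation (DCS Lemma 1 ⇒ Lemma 2 ⇒ `μ = √(2+√2)` via bridge generating functions `A_T, B_T, E_T`) — in order to get a closed form or exact identity for `μ(ℤ²)`, the critical bridge/arch generating functions, or the `x_c`-characterisation "`B_T(x) ≤ 1` with equality structure" on `ℤ²` strips [cite: DuminilCopinSmirnov2012, Lemma 2 and §3] [cite: BeatonGuttmannJensen2012, pp. 2, 5]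
- because: any such identity must hold on every finite domain with a boundary root; evaluating the library's observable exactly on the single vertex, the `2 × 2` block and the `3 × 2` block (pendant root, four orientations each; kernel-checked enumerations `NoBoundaryRelation.rowV0 … rowR3`) yields twelve linear forms in `d` whose only common zero, for every complex `x ≠ 0` and `t = e^{-iσπ/2} ≠ 0`, is `d = 0` (`NoBoundaryRelation.core`: Fourier split by the lattice rotation, the vertex row `1 + x c_ω(t)` being linear in `x`, then one Bézout identity in `t` per character `ω ∈ {1, -1, ±i}`); on `ℤ²` the vertex relation that would telescope to such an identity does not exist either (`not_hasExactVertexRelationZ2`, `NoExactVertexRelationZ2SC_holds`), but the boundary class is strictly weaker (a vertex relation implies it, not conversely) and is excluded here directly; numerically the DCS strip identity is known to FAIL on `ℤ²` at every finite width while holding asymptotically [cite: BeatonGuttmannJensen2012, pp. 2, 5, 13]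
- evasions_known: INEXACT / asymptotic boundary identities with lattice-dependent constants (`c_α/c_β → 0.382683(2) ≈ cos(3π/8)`, used to estimate `x_c(ℤ²) = 0.3790522775(5)`) [cite: BeatonGuttmannJensen2012, pp. 5, 13]; identities for MODIFIED walks (Yang–Baxter / Nienhuis weights on `ℤ²` and rhombic tilings, where the vertex relation and hence the boundary identity hold: `Literature.Probability.RandomPlanarGeometry.SAW.YangBaxter.GlazmanManolescu2019_thm1`) [cite: GlazmanManolescu2019, Theorems 1–3]; identities with explicit remainder terms (signed sums over returning walks), history-dependent or multi-edge boundary coefficients, or boundary coefficients allowed to depend on the position along the boundary (not only on the outward direction) — none of these is of the excluded shape; scaling-limit statements (DCS §4, transposed to `ℤ²`) need no exact lattice identity [cite: DuminilCopinSmirnov2012, §4]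
- scope_caveats: EXCLUDED is exactly the predicate `ExactBoundaryRelationZ2 x σ d` with `x ≠ 0` real, `σ` real, `d : Fin 4 → ℂ` constant: coefficients indexed by the outward direction only, the SAME on every finite domain and for every leaf root, root term `d_{i₀} F({w₁, a}) = d_{i₀} x` included, boundary half-edges = (domain vertex `z ≠ a`, lattice neighbour `z + dir i` NOT a domain vertex) — for domains whose root leaf has no other lattice neighbour in the domain (all twelve instances) this is, up to the global factor `x`, the mid-edge-rooted boundary sum of DCS; slits (non-adjacent pairs of domain vertices) are not counted as boundary. The proof uses only the twelve listed domains (all simply connected unions of closed unit squares/segments plus a pendant unit edge), so the class is already empty on compact simply connected domains; `x = 0` is genuinely exceptional (`exactBoundaryRelationZ2_zero_fugacity`). NOT excluded: see evasions_known; in particular nothing here bears on boundary identities whose coefficients vary along the boundary, on strip identities with `T`-dependent constants, or on identities valid only asymptotically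
- status: established — `NoExactBoundaryRelationZ2_holds` (this file; positive form `exactBoundaryRelationZ2_eq_zero`); the finite-width failure of the DCS strip identity on `ℤ²` was previously a numerical observation [cite: BeatonGuttmannJensen2012, p. 5]
[cite: DuminilCopinSmirnov2012, Lemma 2 (shape of the identity)] -/
def NoExactBoundaryRelationZ2 : Prop :=
  ∀ (x σ : ℝ) (d : Fin 4 → ℂ), x ≠ 0 → ExactBoundaryRelationZ2 x σ d → d = 0

/-- **The barrier statement holds.**
[cite: DuminilCopinSmirnov2012, §3, Lemma 2 and eq. (5) (shape of the identity; square-lattice counterpart refuted here)] -/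
theorem NoExactBoundaryRelationZ2_holds : NoExactBoundaryRelationZ2 :=
  fun _ _ _ hx h => exactBoundaryRelationZ2_eq_zero hx h

end Literature.Barriers.CriticalPhenomena


/-! ## Appendix S: the spin-free strip form — no exact Beaton–Guttmann–Jensen-type identity with constant coefficients on `ℤ²` rectangles

Duminil-Copin–Smirnov's Lemma 2 gives, on the hexagonal lattice, ONE set of constants valid for every
strip/trapezoid: `1 = c_α A^{x_c}_{T,L} + B^{x_c}_{T,L} + c_ε E^{x_c}_{T,L}` for all `T, L`
[cite: DuminilCopinSmirnov2012, §3, Lemma 2]. Beaton–Guttmann–Jensen, *A numerical adaptation of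
self-avoiding walk identities from the honeycomb to other 2D lattices*, J. Phys. A 45 (2012) 035201,
arXiv:1110.1141, p. 5: "while the relationship `1 = cos(3π/8)A_T(z_c) + B_T(z_c)`, which is an
identity for honeycomb lattice SAW for finite width `T`, cannot be expected to hold for the square and
triangular lattices, we might expect something like `1 = c_α(T)A_T(z_c) + c_β(T)B_T(z_c)` to hold,
where the “constants” `c_α(T)` and `c_β(T)` are weakly `T`-dependent" (and p. 10:
"`1.024966(1 - 0.14/T²) ≈ cos(3π/8) A_T(z_c) + B_T(z_c)`" on the square lattice; generating
functions "defined to include an extra half-step at the beginning of the walk and at the end", p. 5).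
Here the EXACT version with constant coefficients is excluded on `ℤ²`: with the spin-free generating
functions (`σ = 0`: `F = Σ x^{#vertices}`, no winding weight — on a rectangle rooted on its boundary
the winding to each side is constant anyway) of the walks from a pendant root on the WEST side of a
lattice rectangle to the boundary half-edges of its west (`A`), east (`B`), north (`E`) and south
(`Ē`) sides, NO constants `(c₀, c_W, c_E, c_N, c_S) ≠ 0` make `c₀ F(root) + c_W A + c_E B + c_N E +
c_S Ē = 0` hold on all rectangles with all west roots, at any fugacity `x ≠ 0` — already the seven
rectangles `1×1`, `2×1`, `1×2` (both roots), `2×2` (both roots), `2×3` (middle root) refuse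
(`exactStripRelationZ2_eq_zero`; certificates of `x`-degree `≤ 6`). The `1×1 … 2×2, 3×1, 1×3, 3×2`
rectangles alone still admit the isolated solutions `x ∈ {-1, (3 ± √5)/2}` (at `x = (3 - √5)/2`:
`(c₀, c_W, c_E, c_N, c_S) ∝ (-2, 1/φ, 2, φ, φ)/φ`, i.e. "`1 = cos(2π/5) A + B + cos(π/5)(E + Ē)`",
exact on those boxes and failing from the `2×3` rectangle on) — recorded as the mechanism-level
reason why a box of height `3` is needed. -/

namespace Literature.Barriers.CriticalPhenomena

open Literature.Probability.RandomPlanarGeometry.SAW Literature.Probability.LatticeModels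
  Literature.Probability.Percolation

/-- **The spin-free strip functional** (Beaton–Guttmann–Jensen shape) of a finite discrete domain with
vertex set `V` and leaf root `a` hanging off `w₁`: with `G = midEdgeParafermionicObservable Ω δ a x 0`
(spin `0`: the plain generating function `Σ x^{#vertices}` of the walks from `a`, half-steps included),
`c₀ G({w₁, a}) + Σ_{z ∈ V∖{a}} Σ_{i : z + dirᵢ ∉ V} c_i G({z, z + dirᵢ})` — a free coefficient `c₀` for
the root term (`G({w₁,a}) = x`, DCS's "`1`") and one coefficient per outward direction; on a
rectangle rooted on its west side, `c_W, c_E, c_N, c_S` multiply the generating functions `A, B, E, Ē`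
of the walks to the west, east, north, south sides.
[cite: BeatonGuttmannJensen2012, p. 5 (shape `1 = c_α A_T + c_β B_T`, generating functions with half-steps)] -/
def stripFunctionalZ2 (Ω : Set ℂ) (δ : ℝ) (V : Finset (Site 2)) (a w₁ : Site 2) (x : ℝ) (c₀ : ℂ)
    (c : Fin 4 → ℂ) : ℂ :=
  c₀ * midEdgeParafermionicObservable Ω δ a x 0 s(w₁, a) +
    ∑ z ∈ V.erase a, ∑ i : Fin 4,
      if z + dirZ2 i ∈ V then 0 else c i * midEdgeParafermionicObservable Ω δ a x 0 s(z, z + dirZ2 i)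

/-- **Technique class (explicit), spin-free strip form.** `ExactStripRelationZ2 x c₀ c`: the constants
`c₀, c_E, c_N, c_W, c_S` (`c` indexed by the outward direction in `dirZ2` order) give an EXACT identity
`stripFunctionalZ2 = 0` on EVERY discrete domain `Ω_δ` whose vertex set is a lattice rectangle `{0..W-1} × {0..H-1}` with a pendant root
`(-1, j)` on its west side (walks enter heading east) and induced nearest-neighbour edges — the
square-lattice, all-`T`-all-`L` form of "`1 = c_α A_{T,L} + B_{T,L} + c_ε E_{T,L}`".
[cite: DuminilCopinSmirnov2012, §3, Lemma 2 (shape)] [cite: BeatonGuttmannJensen2012, p. 5 (square-lattice question)] -/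
def ExactStripRelationZ2 (x : ℝ) (c₀ : ℂ) (c : Fin 4 → ℂ) : Prop :=
  ∀ (Ω : Set ℂ) (δ : ℝ) (V : Finset (Site 2)) (W H j : ℕ), 0 < δ → 0 < W → j < H →
    (∀ z, z ∈ V ↔ z ∈ meshDomain Ω δ) →
    (∀ z, z ∈ V ↔ (0 ≤ z 0 ∧ z 0 < W ∧ 0 ≤ z 1 ∧ z 1 < H) ∨ z = NoVertexRelation.toSite (-1, (j : ℤ))) →
    (∀ z z', (discreteDomainGraph Ω δ).Adj z z' ↔ z ∈ V ∧ z' ∈ V ∧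
        NoVertexRelation.IsUnitStep (NoVertexRelation.dirOf (NoVertexRelation.ofSite z) (NoVertexRelation.ofSite z'))) →
      stripFunctionalZ2 Ω δ V (NoVertexRelation.toSite (-1, (j : ℤ))) (NoVertexRelation.toSite (0, (j : ℤ))) x c₀ c = 0

namespace NoBoundaryRelation

open NoVertexRelation Complex

variable {E : List (ZZ × ZZ)}

/-- `e^{-i·0·π/2} = 1`. [folklore] -/
private theorem tOf_zero : tOf 0 = 1 := by simp [tOf]

/-- At spin `0` every phase is `1`. [folklore] -/
private theorem tpow_tOf_zero (m : ℤ) : tpow (tOf 0) m = 1 := by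
  rw [tOf_zero]; unfold tpow; split_ifs <;> simp

/-- The cells of the box in integer coordinates. [folklore] -/
def boxCells (W H : ℕ) : List ZZ :=
  (List.range W).flatMap fun (a : ℕ) => (List.range H).map fun (b : ℕ) => ((a : ℤ), (b : ℤ))

/-- Membership in `boxCells`. [folklore] -/
private theorem mem_boxCells_iff {W H : ℕ} {p : ZZ} :
    p ∈ boxCells W H ↔ 0 ≤ p.1 ∧ p.1 < W ∧ 0 ≤ p.2 ∧ p.2 < H := by
  obtain ⟨p1, p2⟩ := p
  constructor
  · intro h
    obtain ⟨a, ha, h⟩ := List.mem_flatMap.1 h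
    obtain ⟨b, hb, h⟩ := List.mem_map.1 h
    rw [List.mem_range] at ha hb
    simp only [Prod.mk.injEq] at h
    obtain ⟨rfl, rfl⟩ := h
    simp only
    omega
  · rintro ⟨h1, h2, h3, h4⟩
    refine List.mem_flatMap.2 ⟨p1.toNat, List.mem_range.2 (by omega),
      List.mem_map.2 ⟨p2.toNat, List.mem_range.2 (by omega), ?_⟩⟩
    simp only [Prod.mk.injEq]
    omega

/-- The vertex hypothesis of `ExactStripRelationZ2` for `Ω_E`, from kernel-checkable list facts. [folklore] -/
private theorem strip_hV {W H j : ℕ} (h1 : ∀ p ∈ verts E, p ∈ boxCells W H ∨ p = (-1, (j : ℤ)))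
    (h2 : ∀ p ∈ boxCells W H, p ∈ verts E) (h3 : ((-1 : ℤ), (j : ℤ)) ∈ verts E) :
    ∀ z, z ∈ vertsFinset E ↔ (0 ≤ z 0 ∧ z 0 < W ∧ 0 ≤ z 1 ∧ z 1 < H) ∨ z = toSite (-1, (j : ℤ)) := by
  intro z
  have hbox : (0 ≤ z 0 ∧ z 0 < W ∧ 0 ≤ z 1 ∧ z 1 < H) ↔ ofSite z ∈ boxCells W H := by
    rw [mem_boxCells_iff]; rfl
  rw [mem_vertsFinset_iff', hbox]
  constructor
  · intro h
    rcases h1 _ h with h' | h'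
    · exact Or.inl h'
    · exact Or.inr (by rw [← toSite_ofSite z, h'])
  · rintro (h | h)
    · exact h2 _ h
    · rw [h, ofSite_toSite]; exact h3

/-- The adjacency hypothesis of `ExactStripRelationZ2` for `Ω_E`, from kernel-checkable list facts. [folklore] -/
private theorem strip_hA (hG : GoodEdgeList E)
    (h4 : ∀ e ∈ E, IsUnitStep (dirOf e.1 e.2) ∧ IsUnitStep (dirOf e.2 e.1))
    (h5 : ∀ p ∈ verts E, ∀ q ∈ verts E, IsUnitStep (dirOf p q) → EAdj E p q) :
    ∀ z z', (discreteDomainGraph (Omega E) 1).Adj z z' ↔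
      z ∈ vertsFinset E ∧ z' ∈ vertsFinset E ∧ IsUnitStep (dirOf (ofSite z) (ofSite z')) := by
  intro z z'
  rw [hG.adj_iff, mem_vertsFinset_iff', mem_vertsFinset_iff']
  constructor
  · intro h
    refine ⟨h.fst_mem_verts, h.snd_mem_verts, ?_⟩
    rcases h with h | h
    · exact (h4 _ h).1
    · exact (h4 _ h).2
  · rintro ⟨hz, hz', hu⟩
    exact h5 _ hz _ hz' hu

/-- The strip functional is the boundary functional at spin `0` with the root coefficient freed. [folklore] -/
private theorem stripFunctional_eq_boundary (Ω : Set ℂ) (δ : ℝ) (V : Finset (Site 2)) (a w₁ : Site 2)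
    (i₀ : Fin 4) (x : ℝ) (c₀ : ℂ) (c : Fin 4 → ℂ) :
    stripFunctionalZ2 Ω δ V a w₁ x c₀ c =
      boundaryFunctionalZ2 Ω δ V a w₁ i₀ x 0 c + (c₀ - c i₀) * midEdgeParafermionicObservable Ω δ a x 0 s(w₁, a) := by
  unfold stripFunctionalZ2 boundaryFunctionalZ2; ring

/-- **Instantiating an exact strip relation on `Ω_E`** (a rectangle edge list with west pendant root). [folklore] -/
private theorem strip_inst (hG : GoodEdgeList E) {W H j : ℕ} (hW : 0 < W) (hj : j < H)
    (h1 : ∀ p ∈ verts E, p ∈ boxCells W H ∨ p = (-1, (j : ℤ)))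
    (h2 : ∀ p ∈ boxCells W H, p ∈ verts E) (h3 : ((-1 : ℤ), (j : ℤ)) ∈ verts E)
    (h4 : ∀ e ∈ E, IsUnitStep (dirOf e.1 e.2) ∧ IsUnitStep (dirOf e.2 e.1))
    (h5 : ∀ p ∈ verts E, ∀ q ∈ verts E, IsUnitStep (dirOf p q) → EAdj E p q)
    (hnb : nbrs E (-1, (j : ℤ)) = [(0, (j : ℤ))]) {fuel : ℕ} (hfuel : (verts E).length ≤ fuel)
    (hok : rowOK E fuel (-1, (j : ℤ)) = true) {x : ℝ} {c₀ : ℂ} {c : Fin 4 → ℂ}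
    (h : ExactStripRelationZ2 x c₀ c) :
    c₀ * x + ((rowTerms E fuel (-1, (j : ℤ))).map fun inm =>
        c inm.1 * ((x : ℂ) ^ inm.2.1 * tpow (tOf 0) inm.2.2)).sum = 0 := by
  have hadj : (discreteDomainGraph (Omega E) 1).Adj (toSite (0, (j : ℤ))) (toSite (-1, (j : ℤ))) :=
    hG.A _ _ (mem_nbrs_iff.1 (by rw [hnb]; simp)).symm
  have key := h (Omega E) 1 (vertsFinset E) W H j one_pos hW hj (mem_vertsFinset_iff hG)
    (strip_hV h1 h2 h3) (strip_hA hG h4 h5)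
  rw [stripFunctional_eq_boundary _ _ _ _ _ 2, boundaryFunctional_eq hG 2 h3 hnb hfuel hok x 0 c,
    midEdgeParafermionicObservable_mk, halfEdgeTerm_leaf hadj (leaf_of_nbrs hG hnb), halfEdgeTerm_self,
    zero_add] at key
  linear_combination key

/-- Edge list of the strip instance `S110`: the `1 × 1` rectangle with west pendant root `(-1, 0)`. [folklore] -/
def ES110 : List (ZZ × ZZ) :=
  [((-1, 0), (0, 0))]

/-- Kernel certificate: unit darts, connected. [folklore] -/
private theorem goodS110 : GoodEdgeList ES110 := ⟨by decide, ⟨(-1, 0), by decide, 2, by decide⟩⟩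

/-- The boundary monomials of the strip instance `S110` (kernel evaluation of `rowTerms`). [folklore] -/
private theorem rowS110 : rowTerms ES110 2 (-1, 0) =
  [(0, 2, Int.ofNat 0), (1, 2, Int.ofNat 1), (3, 2, Int.negSucc 0)] := by
  decide

/-- The exact strip relation instantiated on `S110`. [folklore] -/
private theorem instS110 {x : ℝ} {c₀ : ℂ} {c : Fin 4 → ℂ} (h : ExactStripRelationZ2 x c₀ c) :
    c₀ * (x : ℂ) + c 0 * ((x : ℂ) ^ (2 : ℕ)) + c 1 * ((x : ℂ) ^ (2 : ℕ)) + c 3 * ((x : ℂ) ^ (2 : ℕ)) = 0 := by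
  have h0 := strip_inst goodS110 (W := 1) (H := 1) (j := 0) (by decide) (by decide) (by decide) (by decide) (by decide)
    (by decide) (by decide) (by decide) (fuel := 2) (by decide) (by decide) h
  simp only [Nat.cast_zero] at h0
  rw [rowS110] at h0
  simp only [List.map_cons, List.map_nil, List.sum_cons, List.sum_nil, add_zero, tpow_tOf_zero, mul_one] at h0
  linear_combination h0

/-- Edge list of the strip instance `S210`: the `2 × 1` rectangle with west pendant root `(-1, 0)`. [folklore] -/
def ES210 : List (ZZ × ZZ) :=
  [((0, 0), (1, 0)), ((-1, 0), (0, 0))]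

/-- Kernel certificate: unit darts, connected. [folklore] -/
private theorem goodS210 : GoodEdgeList ES210 := ⟨by decide, ⟨(-1, 0), by decide, 4, by decide⟩⟩

/-- The boundary monomials of the strip instance `S210` (kernel evaluation of `rowTerms`). [folklore] -/
private theorem rowS210 : rowTerms ES210 4 (-1, 0) =
  [(0, 3, Int.ofNat 0), (1, 3, Int.ofNat 1), (3, 3, Int.negSucc 0), (1, 2, Int.ofNat 1), (3, 2, Int.negSucc 0)] := by
  decide

/-- The exact strip relation instantiated on `S210`. [folklore] -/
private theorem instS210 {x : ℝ} {c₀ : ℂ} {c : Fin 4 → ℂ} (h : ExactStripRelationZ2 x c₀ c) :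
    c₀ * (x : ℂ) + c 0 * ((x : ℂ) ^ (3 : ℕ)) + c 1 * ((x : ℂ) ^ (2 : ℕ) + (x : ℂ) ^ (3 : ℕ)) + c 3 * ((x : ℂ) ^ (2 : ℕ) + (x : ℂ) ^ (3 : ℕ)) = 0 := by
  have h0 := strip_inst goodS210 (W := 2) (H := 1) (j := 0) (by decide) (by decide) (by decide) (by decide) (by decide)
    (by decide) (by decide) (by decide) (fuel := 4) (by decide) (by decide) h
  simp only [Nat.cast_zero] at h0
  rw [rowS210] at h0
  simp only [List.map_cons, List.map_nil, List.sum_cons, List.sum_nil, add_zero, tpow_tOf_zero, mul_one] at h0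
  linear_combination h0

/-- Edge list of the strip instance `S120`: the `1 × 2` rectangle with west pendant root `(-1, 0)`. [folklore] -/
def ES120 : List (ZZ × ZZ) :=
  [((0, 0), (0, 1)), ((-1, 0), (0, 0))]

/-- Kernel certificate: unit darts, connected. [folklore] -/
private theorem goodS120 : GoodEdgeList ES120 := ⟨by decide, ⟨(-1, 0), by decide, 4, by decide⟩⟩

/-- The boundary monomials of the strip instance `S120` (kernel evaluation of `rowTerms`). [folklore] -/
private theorem rowS120 : rowTerms ES120 4 (-1, 0) =
  [(0, 3, Int.ofNat 0), (1, 3, Int.ofNat 1), (2, 3, Int.ofNat 2), (0, 2, Int.ofNat 0), (3, 2, Int.negSucc 0)] := by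
  decide

/-- The exact strip relation instantiated on `S120`. [folklore] -/
private theorem instS120 {x : ℝ} {c₀ : ℂ} {c : Fin 4 → ℂ} (h : ExactStripRelationZ2 x c₀ c) :
    c₀ * (x : ℂ) + c 0 * ((x : ℂ) ^ (2 : ℕ) + (x : ℂ) ^ (3 : ℕ)) + c 1 * ((x : ℂ) ^ (3 : ℕ)) + c 2 * ((x : ℂ) ^ (3 : ℕ)) +
        c 3 * ((x : ℂ) ^ (2 : ℕ)) = 0 := by
  have h0 := strip_inst goodS120 (W := 1) (H := 2) (j := 0) (by decide) (by decide) (by decide) (by decide) (by decide)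
    (by decide) (by decide) (by decide) (fuel := 4) (by decide) (by decide) h
  simp only [Nat.cast_zero] at h0
  rw [rowS120] at h0
  simp only [List.map_cons, List.map_nil, List.sum_cons, List.sum_nil, add_zero, tpow_tOf_zero, mul_one] at h0
  linear_combination h0

/-- Edge list of the strip instance `S121`: the `1 × 2` rectangle with west pendant root `(-1, 1)`. [folklore] -/
def ES121 : List (ZZ × ZZ) :=
  [((0, 0), (0, 1)), ((-1, 1), (0, 1))]

/-- Kernel certificate: unit darts, connected. [folklore] -/
private theorem goodS121 : GoodEdgeList ES121 := ⟨by decide, ⟨(-1, 1), by decide, 4, by decide⟩⟩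

/-- The boundary monomials of the strip instance `S121` (kernel evaluation of `rowTerms`). [folklore] -/
private theorem rowS121 : rowTerms ES121 4 (-1, 1) =
  [(0, 3, Int.ofNat 0), (2, 3, Int.negSucc 1), (3, 3, Int.negSucc 0), (0, 2, Int.ofNat 0), (1, 2, Int.ofNat 1)] := by
  decide

/-- The exact strip relation instantiated on `S121`. [folklore] -/
private theorem instS121 {x : ℝ} {c₀ : ℂ} {c : Fin 4 → ℂ} (h : ExactStripRelationZ2 x c₀ c) :
    c₀ * (x : ℂ) + c 0 * ((x : ℂ) ^ (2 : ℕ) + (x : ℂ) ^ (3 : ℕ)) + c 1 * ((x : ℂ) ^ (2 : ℕ)) + c 2 * ((x : ℂ) ^ (3 : ℕ)) +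
        c 3 * ((x : ℂ) ^ (3 : ℕ)) = 0 := by
  have h0 := strip_inst goodS121 (W := 1) (H := 2) (j := 1) (by decide) (by decide) (by decide) (by decide) (by decide)
    (by decide) (by decide) (by decide) (fuel := 4) (by decide) (by decide) h
  simp only [Nat.cast_one] at h0
  rw [rowS121] at h0
  simp only [List.map_cons, List.map_nil, List.sum_cons, List.sum_nil, add_zero, tpow_tOf_zero, mul_one] at h0
  linear_combination h0

/-- Edge list of the strip instance `S220`: the `2 × 2` rectangle with west pendant root `(-1, 0)`. [folklore] -/
def ES220 : List (ZZ × ZZ) :=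
  [((0, 0), (1, 0)), ((0, 0), (0, 1)), ((0, 1), (1, 1)), ((1, 0), (1, 1)), ((-1, 0), (0, 0))]

/-- Kernel certificate: unit darts, connected. [folklore] -/
private theorem goodS220 : GoodEdgeList ES220 := ⟨by decide, ⟨(-1, 0), by decide, 10, by decide⟩⟩

/-- The boundary monomials of the strip instance `S220` (kernel evaluation of `rowTerms`). [folklore] -/
private theorem rowS220 : rowTerms ES220 10 (-1, 0) =
  [(1, 5, Int.ofNat 1), (1, 3, Int.ofNat 1), (2, 5, Int.ofNat 2), (2, 3, Int.ofNat 2), (0, 3, Int.ofNat 0), (0, 5, Int.ofNat 0), (3, 3, Int.negSucc 0),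
      (3, 5, Int.negSucc 0), (0, 4, Int.ofNat 0), (0, 4, Int.ofNat 0), (1, 4, Int.ofNat 1), (1, 4, Int.ofNat 1), (3, 2, Int.negSucc 0)] := by
  decide

/-- The exact strip relation instantiated on `S220`. [folklore] -/
private theorem instS220 {x : ℝ} {c₀ : ℂ} {c : Fin 4 → ℂ} (h : ExactStripRelationZ2 x c₀ c) :
    c₀ * (x : ℂ) + c 0 * ((x : ℂ) ^ (3 : ℕ) + (2 : ℂ) * (x : ℂ) ^ (4 : ℕ) + (x : ℂ) ^ (5 : ℕ)) + c 1 * ((x : ℂ) ^ (3 : ℕ) +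
        (2 : ℂ) * (x : ℂ) ^ (4 : ℕ) + (x : ℂ) ^ (5 : ℕ)) + c 2 * ((x : ℂ) ^ (3 : ℕ) + (x : ℂ) ^ (5 : ℕ)) + c 3 * ((x : ℂ) ^ (2 : ℕ) +
        (x : ℂ) ^ (3 : ℕ) + (x : ℂ) ^ (5 : ℕ)) = 0 := by
  have h0 := strip_inst goodS220 (W := 2) (H := 2) (j := 0) (by decide) (by decide) (by decide) (by decide) (by decide)
    (by decide) (by decide) (by decide) (fuel := 10) (by decide) (by decide) h
  simp only [Nat.cast_zero] at h0
  rw [rowS220] at h0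
  simp only [List.map_cons, List.map_nil, List.sum_cons, List.sum_nil, add_zero, tpow_tOf_zero, mul_one] at h0
  linear_combination h0

/-- Edge list of the strip instance `S221`: the `2 × 2` rectangle with west pendant root `(-1, 1)`. [folklore] -/
def ES221 : List (ZZ × ZZ) :=
  [((0, 0), (1, 0)), ((0, 0), (0, 1)), ((0, 1), (1, 1)), ((1, 0), (1, 1)), ((-1, 1), (0, 1))]

/-- Kernel certificate: unit darts, connected. [folklore] -/
private theorem goodS221 : GoodEdgeList ES221 := ⟨by decide, ⟨(-1, 1), by decide, 10, by decide⟩⟩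

/-- The boundary monomials of the strip instance `S221` (kernel evaluation of `rowTerms`). [folklore] -/
private theorem rowS221 : rowTerms ES221 10 (-1, 1) =
  [(2, 5, Int.negSucc 1), (2, 3, Int.negSucc 1), (3, 5, Int.negSucc 0), (3, 3, Int.negSucc 0), (0, 4, Int.ofNat 0), (0, 4, Int.ofNat 0), (3, 4,
      Int.negSucc 0), (3, 4, Int.negSucc 0), (0, 3, Int.ofNat 0), (0, 5, Int.ofNat 0), (1, 3, Int.ofNat 1), (1, 5, Int.ofNat 1), (1, 2,
      Int.ofNat 1)] := by
  decide

/-- The exact strip relation instantiated on `S221`. [folklore] -/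
private theorem instS221 {x : ℝ} {c₀ : ℂ} {c : Fin 4 → ℂ} (h : ExactStripRelationZ2 x c₀ c) :
    c₀ * (x : ℂ) + c 0 * ((x : ℂ) ^ (3 : ℕ) + (2 : ℂ) * (x : ℂ) ^ (4 : ℕ) + (x : ℂ) ^ (5 : ℕ)) + c 1 * ((x : ℂ) ^ (2 : ℕ) + (x : ℂ) ^ (3 : ℕ) +
        (x : ℂ) ^ (5 : ℕ)) + c 2 * ((x : ℂ) ^ (3 : ℕ) + (x : ℂ) ^ (5 : ℕ)) + c 3 * ((x : ℂ) ^ (3 : ℕ) + (2 : ℂ) * (x : ℂ) ^ (4 : ℕ) +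
        (x : ℂ) ^ (5 : ℕ)) = 0 := by
  have h0 := strip_inst goodS221 (W := 2) (H := 2) (j := 1) (by decide) (by decide) (by decide) (by decide) (by decide)
    (by decide) (by decide) (by decide) (fuel := 10) (by decide) (by decide) h
  simp only [Nat.cast_one] at h0
  rw [rowS221] at h0
  simp only [List.map_cons, List.map_nil, List.sum_cons, List.sum_nil, add_zero, tpow_tOf_zero, mul_one] at h0
  linear_combination h0

/-- Edge list of the strip instance `S231`: the `2 × 3` rectangle with west pendant root `(-1, 1)`. [folklore] -/
def ES231 : List (ZZ × ZZ) :=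
  [((0, 0), (1, 0)), ((0, 0), (0, 1)), ((0, 1), (1, 1)), ((0, 1), (0, 2)), ((0, 2), (1, 2)), ((1, 0), (1, 1)), ((1, 1), (1, 2)), ((-1, 1), (0, 1))]

/-- Kernel certificate: unit darts, connected. [folklore] -/
private theorem goodS231 : GoodEdgeList ES231 := ⟨by decide, ⟨(-1, 1), by decide, 16, by decide⟩⟩

/-- The boundary monomials of the strip instance `S231` (kernel evaluation of `rowTerms`). [folklore] -/
private theorem rowS231 : rowTerms ES231 16 (-1, 1) =
  [(2, 5, Int.negSucc 1), (2, 7, Int.negSucc 1), (2, 3, Int.negSucc 1), (3, 5, Int.negSucc 0), (3, 7, Int.negSucc 0), (3, 3, Int.negSucc 0), (1, 5,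
      Int.ofNat 1), (1, 3, Int.ofNat 1), (1, 7, Int.ofNat 1), (2, 5, Int.ofNat 2), (2, 3, Int.ofNat 2), (2, 7, Int.ofNat 2), (0, 4, Int.ofNat 0), (0,
      6, Int.ofNat 0), (0, 4, Int.ofNat 0), (3, 4, Int.negSucc 0), (3, 6, Int.negSucc 0), (3, 4, Int.negSucc 0), (0, 3, Int.ofNat 0), (0, 5,
      Int.ofNat 0), (0, 5, Int.ofNat 0), (0, 4, Int.ofNat 0), (0, 4, Int.ofNat 0), (0, 6, Int.ofNat 0), (1, 4, Int.ofNat 1), (1, 4, Int.ofNat 1), (1,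
      6, Int.ofNat 1)] := by
  decide

/-- The exact strip relation instantiated on `S231`. [folklore] -/
private theorem instS231 {x : ℝ} {c₀ : ℂ} {c : Fin 4 → ℂ} (h : ExactStripRelationZ2 x c₀ c) :
    c₀ * (x : ℂ) + c 0 * ((x : ℂ) ^ (3 : ℕ) + (4 : ℂ) * (x : ℂ) ^ (4 : ℕ) + (2 : ℂ) * (x : ℂ) ^ (5 : ℕ) + (2 : ℂ) * (x : ℂ) ^ (6 : ℕ)) +
        c 1 * ((x : ℂ) ^ (3 : ℕ) + (2 : ℂ) * (x : ℂ) ^ (4 : ℕ) + (x : ℂ) ^ (5 : ℕ) + (x : ℂ) ^ (6 : ℕ) + (x : ℂ) ^ (7 : ℕ)) +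
        c 2 * ((2 : ℂ) * (x : ℂ) ^ (3 : ℕ) + (2 : ℂ) * (x : ℂ) ^ (5 : ℕ) + (2 : ℂ) * (x : ℂ) ^ (7 : ℕ)) + c 3 * ((x : ℂ) ^ (3 : ℕ) +
        (2 : ℂ) * (x : ℂ) ^ (4 : ℕ) + (x : ℂ) ^ (5 : ℕ) + (x : ℂ) ^ (6 : ℕ) + (x : ℂ) ^ (7 : ℕ)) = 0 := by
  have h0 := strip_inst goodS231 (W := 2) (H := 3) (j := 1) (by decide) (by decide) (by decide) (by decide) (by decide)
    (by decide) (by decide) (by decide) (fuel := 16) (by decide) (by decide) h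
  simp only [Nat.cast_one] at h0
  rw [rowS231] at h0
  simp only [List.map_cons, List.map_nil, List.sum_cons, List.sum_nil, add_zero, tpow_tOf_zero, mul_one] at h0
  linear_combination h0

/-- **Algebraic core of the strip form.** For `x ≠ 0` the seven instantiated relations force all five
constants to vanish (explicit certificates of degree `≤ 6`, found by linear algebra over `ℚ[x]`). [folklore] -/
private theorem strip_core {x : ℂ} (hx : x ≠ 0) {c₀ d0 d1 d2 d3 : ℂ}
    (e110 : c₀ * x + d0 * (x ^ (2 : ℕ)) + d1 * (x ^ (2 : ℕ)) + d3 * (x ^ (2 : ℕ)) = 0)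
    (e210 : c₀ * x + d0 * (x ^ (3 : ℕ)) + d1 * (x ^ (2 : ℕ) + x ^ (3 : ℕ)) + d3 * (x ^ (2 : ℕ) + x ^ (3 : ℕ)) = 0)
    (e120 : c₀ * x + d0 * (x ^ (2 : ℕ) + x ^ (3 : ℕ)) + d1 * (x ^ (3 : ℕ)) + d2 * (x ^ (3 : ℕ)) + d3 * (x ^ (2 : ℕ)) = 0)
    (e121 : c₀ * x + d0 * (x ^ (2 : ℕ) + x ^ (3 : ℕ)) + d1 * (x ^ (2 : ℕ)) + d2 * (x ^ (3 : ℕ)) + d3 * (x ^ (3 : ℕ)) = 0)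
    (e220 : c₀ * x + d0 * (x ^ (3 : ℕ) + (2 : ℂ) * x ^ (4 : ℕ) + x ^ (5 : ℕ)) + d1 * (x ^ (3 : ℕ) + (2 : ℂ) * x ^ (4 : ℕ) + x ^ (5 : ℕ)) +
        d2 * (x ^ (3 : ℕ) + x ^ (5 : ℕ)) + d3 * (x ^ (2 : ℕ) + x ^ (3 : ℕ) + x ^ (5 : ℕ)) = 0)
    (e221 : c₀ * x + d0 * (x ^ (3 : ℕ) + (2 : ℂ) * x ^ (4 : ℕ) + x ^ (5 : ℕ)) + d1 * (x ^ (2 : ℕ) + x ^ (3 : ℕ) + x ^ (5 : ℕ)) + d2 * (x ^ (3 : ℕ) +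
        x ^ (5 : ℕ)) + d3 * (x ^ (3 : ℕ) + (2 : ℂ) * x ^ (4 : ℕ) + x ^ (5 : ℕ)) = 0)
    (e231 : c₀ * x + d0 * (x ^ (3 : ℕ) + (4 : ℂ) * x ^ (4 : ℕ) + (2 : ℂ) * x ^ (5 : ℕ) + (2 : ℂ) * x ^ (6 : ℕ)) + d1 * (x ^ (3 : ℕ) +
        (2 : ℂ) * x ^ (4 : ℕ) + x ^ (5 : ℕ) + x ^ (6 : ℕ) + x ^ (7 : ℕ)) + d2 * ((2 : ℂ) * x ^ (3 : ℕ) + (2 : ℂ) * x ^ (5 : ℕ) +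
        (2 : ℂ) * x ^ (7 : ℕ)) + d3 * (x ^ (3 : ℕ) + (2 : ℂ) * x ^ (4 : ℕ) + x ^ (5 : ℕ) + x ^ (6 : ℕ) + x ^ (7 : ℕ)) = 0)
    : c₀ = 0 ∧ d0 = 0 ∧ d1 = 0 ∧ d2 = 0 ∧ d3 = 0 := by
  have hx4 : x ^ (4 : ℕ) ≠ 0 := pow_ne_zero 4 hx
  refine ⟨?_, ?_, ?_, ?_, ?_⟩
  · have h : x ^ (4 : ℕ) * c₀ = 0 := by
      linear_combination ((51 : ℂ) * x ^ (2 : ℕ) + (37 : ℂ) * x ^ (3 : ℕ) + (-53 : ℂ) * x ^ (4 : ℕ) + (-90 : ℂ) * x ^ (5 : ℕ) +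
          (-38 : ℂ) * x ^ (6 : ℕ)) * e110 + (((-49 : ℂ) / 2) + ((-31 : ℂ) / 2) * x + ((-83 : ℂ) / 2) * x ^ (2 : ℕ) + (-36 : ℂ) * x ^ (3 : ℕ) +
          (55 : ℂ) * x ^ (4 : ℕ) + (45 : ℂ) * x ^ (5 : ℕ) + (19 : ℂ) * x ^ (6 : ℕ)) * e210 + (((11 : ℂ) / 2) + (-10 : ℂ) * x +
          ((-125 : ℂ) / 2) * x ^ (2 : ℕ) + (8 : ℂ) * x ^ (3 : ℕ) + (70 : ℂ) * x ^ (4 : ℕ) + ((121 : ℂ) / 2) * x ^ (5 : ℕ) +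
          ((19 : ℂ) / 2) * x ^ (6 : ℕ)) * e120 + (((-11 : ℂ) / 2) + (10 : ℂ) * x + ((23 : ℂ) / 2) * x ^ (2 : ℕ) + (6 : ℂ) * x ^ (3 : ℕ) +
          (-34 : ℂ) * x ^ (4 : ℕ) + ((-31 : ℂ) / 2) * x ^ (5 : ℕ) + ((19 : ℂ) / 2) * x ^ (6 : ℕ)) * e121 + ((19 : ℂ) + (31 : ℂ) * x +
          (32 : ℂ) * x ^ (2 : ℕ) + (-14 : ℂ) * x ^ (3 : ℕ) + (-38 : ℂ) * x ^ (4 : ℕ)) * e220 + ((30 : ℂ)) * e221 + (((-49 : ℂ) / 2) +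
          ((-31 : ℂ) / 2) * x + ((19 : ℂ) / 2) * x ^ (2 : ℕ)) * e231
    exact (mul_eq_zero.1 h).resolve_left hx4
  · have h : x ^ (4 : ℕ) * d0 = 0 := by
      linear_combination ((-50 : ℂ) * x ^ (2 : ℕ) + (-36 : ℂ) * x ^ (3 : ℕ) + (53 : ℂ) * x ^ (4 : ℕ) + (90 : ℂ) * x ^ (5 : ℕ) +
          (38 : ℂ) * x ^ (6 : ℕ)) * e110 + (((49 : ℂ) / 2) + ((31 : ℂ) / 2) * x + ((81 : ℂ) / 2) * x ^ (2 : ℕ) + (36 : ℂ) * x ^ (3 : ℕ) +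
          (-55 : ℂ) * x ^ (4 : ℕ) + (-45 : ℂ) * x ^ (5 : ℕ) + (-19 : ℂ) * x ^ (6 : ℕ)) * e210 + (((-11 : ℂ) / 2) + (10 : ℂ) * x +
          ((125 : ℂ) / 2) * x ^ (2 : ℕ) + (-8 : ℂ) * x ^ (3 : ℕ) + (-70 : ℂ) * x ^ (4 : ℕ) + ((-121 : ℂ) / 2) * x ^ (5 : ℕ) +
          ((-19 : ℂ) / 2) * x ^ (6 : ℕ)) * e120 + (((11 : ℂ) / 2) + (-10 : ℂ) * x + ((-23 : ℂ) / 2) * x ^ (2 : ℕ) + (-6 : ℂ) * x ^ (3 : ℕ) +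
          (34 : ℂ) * x ^ (4 : ℕ) + ((31 : ℂ) / 2) * x ^ (5 : ℕ) + ((-19 : ℂ) / 2) * x ^ (6 : ℕ)) * e121 + ((-19 : ℂ) + (-31 : ℂ) * x +
          (-32 : ℂ) * x ^ (2 : ℕ) + (14 : ℂ) * x ^ (3 : ℕ) + (38 : ℂ) * x ^ (4 : ℕ)) * e220 + ((-30 : ℂ)) * e221 + (((49 : ℂ) / 2) +
          ((31 : ℂ) / 2) * x + ((-19 : ℂ) / 2) * x ^ (2 : ℕ)) * e231
    exact (mul_eq_zero.1 h).resolve_left hx4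
  · have h : x ^ (4 : ℕ) * d1 = 0 := by
      linear_combination (-(x) + (-42 : ℂ) * x ^ (2 : ℕ) + (-29 : ℂ) * x ^ (3 : ℕ) + (43 : ℂ) * x ^ (4 : ℕ) + (72 : ℂ) * x ^ (5 : ℕ) +
          (30 : ℂ) * x ^ (6 : ℕ)) * e110 + ((20 : ℂ) + (13 : ℂ) * x + ((69 : ℂ) / 2) * x ^ (2 : ℕ) + (28 : ℂ) * x ^ (3 : ℕ) + (-44 : ℂ) * x ^ (4 : ℕ) +
          (-36 : ℂ) * x ^ (5 : ℕ) + (-15 : ℂ) * x ^ (6 : ℕ)) * e210 + ((-5 : ℂ) + (8 : ℂ) * x + ((101 : ℂ) / 2) * x ^ (2 : ℕ) +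
          ((-13 : ℂ) / 2) * x ^ (3 : ℕ) + ((-113 : ℂ) / 2) * x ^ (4 : ℕ) + (-48 : ℂ) * x ^ (5 : ℕ) + ((-15 : ℂ) / 2) * x ^ (6 : ℕ)) * e120 + ((5 : ℂ) +
          (-7 : ℂ) * x + ((-19 : ℂ) / 2) * x ^ (2 : ℕ) + ((-9 : ℂ) / 2) * x ^ (3 : ℕ) + ((55 : ℂ) / 2) * x ^ (4 : ℕ) + (12 : ℂ) * x ^ (5 : ℕ) +
          ((-15 : ℂ) / 2) * x ^ (6 : ℕ)) * e121 + ((-15 : ℂ) + (-25 : ℂ) * x + (-26 : ℂ) * x ^ (2 : ℕ) + (12 : ℂ) * x ^ (3 : ℕ) +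
          (30 : ℂ) * x ^ (4 : ℕ)) * e220 + ((-25 : ℂ)) * e221 + ((20 : ℂ) + (12 : ℂ) * x + ((-15 : ℂ) / 2) * x ^ (2 : ℕ)) * e231
    exact (mul_eq_zero.1 h).resolve_left hx4
  · have h : x ^ (4 : ℕ) * d2 = 0 := by
      linear_combination ((-1 : ℂ) + (-2 : ℂ) * x + (-17 : ℂ) * x ^ (2 : ℕ) + (-12 : ℂ) * x ^ (3 : ℕ) + (16 : ℂ) * x ^ (4 : ℕ) +
          (28 : ℂ) * x ^ (5 : ℕ) + (12 : ℂ) * x ^ (6 : ℕ)) * e110 + (((17 : ℂ) / 2) + (6 : ℂ) * x + (13 : ℂ) * x ^ (2 : ℕ) + (12 : ℂ) * x ^ (3 : ℕ) +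
          (-17 : ℂ) * x ^ (4 : ℕ) + (-14 : ℂ) * x ^ (5 : ℕ) + (-6 : ℂ) * x ^ (6 : ℕ)) * e210 + (((-3 : ℂ) / 2) + ((7 : ℂ) / 2) * x +
          ((41 : ℂ) / 2) * x ^ (2 : ℕ) + (-2 : ℂ) * x ^ (3 : ℕ) + ((-43 : ℂ) / 2) * x ^ (4 : ℕ) + (-19 : ℂ) * x ^ (5 : ℕ) +
          (-3 : ℂ) * x ^ (6 : ℕ)) * e120 + (((5 : ℂ) / 2) + ((-5 : ℂ) / 2) * x + ((-7 : ℂ) / 2) * x ^ (2 : ℕ) + (-2 : ℂ) * x ^ (3 : ℕ) +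
          ((21 : ℂ) / 2) * x ^ (4 : ℕ) + (5 : ℂ) * x ^ (5 : ℕ) + (-3 : ℂ) * x ^ (6 : ℕ)) * e121 + ((-6 : ℂ) + (-10 : ℂ) * x + (-10 : ℂ) * x ^ (2 : ℕ) +
          (4 : ℂ) * x ^ (3 : ℕ) + (12 : ℂ) * x ^ (4 : ℕ)) * e220 + ((-10 : ℂ)) * e221 + (((15 : ℂ) / 2) + (5 : ℂ) * x + (-3 : ℂ) * x ^ (2 : ℕ)) * e231
    exact (mul_eq_zero.1 h).resolve_left hx4
  · have h : x ^ (4 : ℕ) * d3 = 0 := by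
      linear_combination (-(x) + (-42 : ℂ) * x ^ (2 : ℕ) + (-29 : ℂ) * x ^ (3 : ℕ) + (43 : ℂ) * x ^ (4 : ℕ) + (72 : ℂ) * x ^ (5 : ℕ) +
          (30 : ℂ) * x ^ (6 : ℕ)) * e110 + ((20 : ℂ) + (13 : ℂ) * x + ((69 : ℂ) / 2) * x ^ (2 : ℕ) + (28 : ℂ) * x ^ (3 : ℕ) + (-44 : ℂ) * x ^ (4 : ℕ) +
          (-36 : ℂ) * x ^ (5 : ℕ) + (-15 : ℂ) * x ^ (6 : ℕ)) * e210 + ((-4 : ℂ) + (9 : ℂ) * x + ((101 : ℂ) / 2) * x ^ (2 : ℕ) +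
          ((-13 : ℂ) / 2) * x ^ (3 : ℕ) + ((-113 : ℂ) / 2) * x ^ (4 : ℕ) + (-48 : ℂ) * x ^ (5 : ℕ) + ((-15 : ℂ) / 2) * x ^ (6 : ℕ)) * e120 + ((4 : ℂ) +
          (-8 : ℂ) * x + ((-19 : ℂ) / 2) * x ^ (2 : ℕ) + ((-9 : ℂ) / 2) * x ^ (3 : ℕ) + ((55 : ℂ) / 2) * x ^ (4 : ℕ) + (12 : ℂ) * x ^ (5 : ℕ) +
          ((-15 : ℂ) / 2) * x ^ (6 : ℕ)) * e121 + ((-16 : ℂ) + (-25 : ℂ) * x + (-26 : ℂ) * x ^ (2 : ℕ) + (12 : ℂ) * x ^ (3 : ℕ) +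
          (30 : ℂ) * x ^ (4 : ℕ)) * e220 + ((-24 : ℂ)) * e221 + ((20 : ℂ) + (12 : ℂ) * x + ((-15 : ℂ) / 2) * x ^ (2 : ℕ)) * e231
    exact (mul_eq_zero.1 h).resolve_left hx4

end NoBoundaryRelation

/-- **No exact strip identity with constant coefficients on `ℤ²` rectangles.** For every fugacity
`x ≠ 0`: if constants `c₀, c_W, c_E, c_N, c_S` make `c₀ x + c_W A + c_E B + c_N E + c_S Ē = 0` hold for
all lattice rectangles with all west pendant roots (`ExactStripRelationZ2`), then all five vanish —
seven rectangles (`1×1`, `2×1`, `1×2` twice, `2×2` twice, `2×3` with the middle root) suffice. The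
rigorous, constant-coefficient counterpart of Beaton–Guttmann–Jensen's numerical observation that
the honeycomb identity "cannot be expected to hold" on the square lattice at finite width.
[cite: BeatonGuttmannJensen2012, p. 5 (square lattice: identity fails at finite width; `T`-dependent constants)]
[cite: DuminilCopinSmirnov2012, §3, Lemma 2 (the honeycomb identity with constant coefficients)] -/
theorem exactStripRelationZ2_eq_zero {x : ℝ} {c₀ : ℂ} {c : Fin 4 → ℂ} (hx : x ≠ 0)
    (h : ExactStripRelationZ2 x c₀ c) : c₀ = 0 ∧ c = 0 := by
  obtain ⟨h0, h1, h2, h3, h4⟩ := NoBoundaryRelation.strip_core (x := (x : ℂ)) (by exact_mod_cast hx)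
    (NoBoundaryRelation.instS110 h) (NoBoundaryRelation.instS210 h) (NoBoundaryRelation.instS120 h)
    (NoBoundaryRelation.instS121 h) (NoBoundaryRelation.instS220 h) (NoBoundaryRelation.instS221 h)
    (NoBoundaryRelation.instS231 h)
  exact ⟨h0, by funext i; fin_cases i <;> simp [h1, h2, h3, h4]⟩

/-- The hypothesis `x ≠ 0` is necessary in the strip form too: at `x = 0` the generating functions
vanish identically. [cite: DuminilCopinSmirnov2012, §2, Definition 1 (weight `x^{ℓ(γ)}`)] -/
theorem exactStripRelationZ2_zero_fugacity (c₀ : ℂ) (c : Fin 4 → ℂ) : ExactStripRelationZ2 0 c₀ c := by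
  intro Ω δ V W H j _ _ _ _ _ _
  have hF : ∀ e, midEdgeParafermionicObservable Ω δ (NoVertexRelation.toSite (-1, (j : ℤ))) 0 0 e = 0 := by
    intro e
    induction e using Sym2.ind with
    | h z w => simp [midEdgeParafermionicObservable_mk, halfEdgeTerm]
  simp [stripFunctionalZ2, hF]

/-- **Barrier statement, spin-free strip form** (`NoExactStripRelationZ2`): no exact identity
`c₀ + c_W A + c_E B + c_N E + c_S Ē = 0` with constant coefficients among the plain SAW generating
functions to the four sides of `ℤ²` rectangles rooted on their west side, at any fugacity `x ≠ 0`
(the `ℤ²` analogue of DCS's Lemma 2 with `T`-, `L`-independent constants does not exist). Companion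
of `NoExactBoundaryRelationZ2` (same file, same technique class "boundary/strip identities";
evasions as there: `T`-dependent or asymptotic constants [cite: BeatonGuttmannJensen2012, pp. 5, 10]
are NOT excluded). PROVED: `NoExactStripRelationZ2_holds`.
[cite: BeatonGuttmannJensen2012, p. 5] [cite: DuminilCopinSmirnov2012, §3, Lemma 2 (shape)] -/
def NoExactStripRelationZ2 : Prop :=
  ∀ (x : ℝ) (c₀ : ℂ) (c : Fin 4 → ℂ), x ≠ 0 → ExactStripRelationZ2 x c₀ c → c₀ = 0 ∧ c = 0

/-- **The strip-form barrier statement holds.**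
[cite: BeatonGuttmannJensen2012, p. 5] [cite: DuminilCopinSmirnov2012, §3, Lemma 2 (shape)] -/
theorem NoExactStripRelationZ2_holds : NoExactStripRelationZ2 :=
  fun _ _ _ hx h => exactStripRelationZ2_eq_zero hx h

end Literature.Barriers.CriticalPhenomena
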